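import Literature.MathematicalPhysics.QuantumFieldTheory.Balaban1983to89.B3Op116MixedSeedRegion
import Literature.MathematicalPhysics.QuantumFieldTheory.Balaban1983to89.B3Op116CollarHolder

/-!
# `Balaban1983to89.B3Op116MixedSeedBox` — T. Bałaban, *(Higgs)₂,₃ quantum fields in a finite volume. III. Renormalization*,
# Commun. Math. Phys. **88** (1983) 411–445 [Balaban1983Higgs3], (1.16) p. 414 / (2.5)–(2.6) p. 424 / (2.10) p. 426 / p. 433:
# **THE MIXED SEED ON A `k`-BLOCK UNION `Ω` WITHOUT THE SUPPORT CLAUSE** — the difference `W = G_k(Ω,A+B) − G_k(Ω,B) = G_k(Ω,B)V_k^Ω(A,B)G_k(Ω,A+B)`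
# ((I.3.44)) on a dipole source `dip^B_{b′}Y` at a bond `b′ ⊂ Ω`, read through ONE covariant derivative `D^ε_B` at a bond `b₀ ⊂ Ω`: the box twin of
# p40's torus `B3Op116MixedSeed` (two-scale bookkeeping: the twice-differentiated piece always the COARSER one, directly or by the torus Leibniz
# identities A′/A″) in which the bonds of `supp A` crossing `∂Ω` leave FACE LEGS — a single layer `ε⁻¹|e|s·(differentiated column)·‖w‖` on the
# sites of `Ω` adjacent to `∂Ω`, DISPLAYED as a pending sheet of exponent `1` in the three-component state of p35's `B3Op116DKernelRegularBox`
# (file M1 of the mixed member `hM` of (2.5) for (1.16) on a box; p35 `DESIGN-FILE4.md` §19)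

statement-level skeleton of published theorems with citation tags; proofs where landed; nothing here is a claim about the Yang–Mills mass gap

PDFs held: `paper:balaban1983-higgs-2-3-quantum-fields-finite-volume` (journal page = PDF page + 410; p. 414 = `p0004.txt`, p. 424 = `p0014.txt`,
p. 426 = `p0016.txt`, p. 433 = `p0023.txt`); `paper:balaban1982-cmp85-higgs23-i` (p. 605 = `p0003.txt`, p. 610 = `p0008.txt`, pp. 614–615 =
`p0012.txt`–`p0013.txt`, p. 619 = `p0017.txt`).

CITATION HEADER (lean-in-tree rule).  T. Bałaban, CMP **88** (1983) 411–445 [Balaban1983Higgs3]: (1.16) p. 414, (2.5)/(2.6) p. 424, (2.10) p. 426,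
p. 433; part I, CMP **85** (1982) 603–636 [Balaban1982Higgs1]: (1.7) p. 605, (2.20) p. 610, (2.30)–(2.32) p. 611, (2.43) p. 612, (3.14)–(3.16)
pp. 614–615, (3.44) p. 619.  Cell `lit-balaban` (HOME `run/shared/lean/pub/lit-balaban/`), Phase-2 proof seat **p35** gen 28
(literature-prover-lit-balaban-p35-g28-0; free-target protocol G.5-34(d), TAKING HOME/STATUS.md, cc r15 / p40).  SKELETON rows **B3.Eq1.16** /
**B3.Eq2.5** / **B3.Txt@433** / **B3.Prop1** (owner r15) — LOCATED MEMBER, no head claim: file M1 of route γ′'s mixed member (GAPS.md G-B3-16.A1;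
p35 `DESIGN-FILE4.md` §14 (d), §18, §19).  USED BY NAME, never restated: p40's torus file `B3Op116MixedSeed` (§5 conversions, §6.1 the four
arithmetic lemmas `md_arith`/`dm_arith`/`mm_arith`/`avg_arith` and the constants `kC`, `gE`, `seedK1`, `seedK2`; §7 `dip_eq_dip_add_single`,
`norm_U_sub_U_add_le`; `norm_le_majorant_of_pieces`, `srcMD_sum`, `srcDM_sum`, `mul_sumS_eq_maj`) and its region twin `B3Op116MixedSeedRegion`
((2.6) on every `Ω`: `covDeriv_propagatorK_eq_sum_piecesR`, `propagatorK_apply_eq_sum_piecesR`; the symmetry of `W`: `norm_W_dip_apply_le` — that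
file treats regions WITH the support clause `dist(supp Ã, ∂Ω) > 2r(L^kε)`, no legs; this file drops the clause), the engine `B3Op116OrderedPairs` (`pair_bond_le`,
`sum_sq_le_of_cases`, `sum_lower_pair_le`, `bump_shift_le(')`, `mesh_rpow_zero_sub`, `norm_pieceR_dip_apply_le` (every `Ω`), `block_avg_majorant_le`,
`norm_fOne_apply_le_of_abs_le`), p35's `B3Op116LeibnizRows` (A′ `inv_smul_sum_srcDM_eq`, A″ `sum_srcMD_eq`, `nMul`, `norm_nMul_apply_le`, `reg_neg`,
`norm_fOne_neg_apply_le`, `U_neg_mulM_apply`), r14's `B3Op116SourceForm` (THEOREM A `opV_apply_eq_srcV` and (I.3.44) `eq344_model` on every `Ω`,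
`srcMD/srcDM/srcMM/bondSrc/avgSrc/srcV`, `covDerivAt`, `norm_mapE_*`, `inner_propagatorK_dip_apply`), p40's `B3Op116CollarSources` (`exB`/`enB`,
`norm_covDeriv_of_src/tgt_eq_zero`, `covDeriv_eq_zero_of_apply_eq_zero`, block-diagonality `propagatorK_single_apply_eq_zero_of_mem`) and
`B3Op116RegionSources` (`srcMD_eq_zero`, `srcDM_eq_zero`), `B3Op116CollarHolder` (`sum_le_sum_cover`, `sum_src_le`, `sum_tgt_le`), r14's region cut
machinery `B3Ineq210RegularRegion.{pieceR, sandwichR, levelSet, sum_pieceR, propagatorK_cutTo, avgQkLin_cutTo, avgQkAdj_cutTo, cutToLin_mul_precOpA,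
cutToLin_mul_inverse}` and `B1Eq230FluctCovPos.isUnit_precOpA_of_le`, p33's `B3Op116MajorantConvolution` (`sum_kernel_mul_le`, `sum_bond_kernel_mul_le`),
`B3Op116KernelRegularTorus` (`norm_covDeriv_le_add_split`, `majorant_shift_le(')`, `majorant_mono`, `top_bump_le_majorant_succ`, `norm_mapE_avgSrc_le_block`),
p35's `B3Op116MajorantStep.maj`.

WHAT IS PRINTED (verbatim).  p. 414 [PDF 4]: *"for n, n′ sufficiently large, a kernel of the operator (1.16) is a sufficiently regular function of
both variables. More exactly the Hölder norms of the covariant derivatives of this kernel, the norms defined for example in the inequalities (I.2.24)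
and (I.2.25) of Proposition I.2.1, are exponentially decaying with the distance of the arguments and are uniformly bounded by
O(1)(e(L^kε)^{1−α})^{n+n′} … This estimate follows easily from the properties of the propagators G_k(Ω, A) proved in the next paper."*  p. 426 (2.10)
[PDF 16]: *"|G^η_{(j)}(Ω, B̃; x, x′)| ≤ O(1)(L^jη)^{−d+2}e^{−δ₁(L^jη)^{−1}|x−x′|}, (2.10) and if the propagator is differentiated, then for each
differentiation, there is an additional factor (L^jη)^{−1} on the right side."*  p. 433 [PDF 23]: *"we take a cube □ of size 3r(L^kε) and with □₁ in the
center. We assume that □₁, □ are sums of big blocks of the unit lattice. … We have B̃ = B̃₀ + B̃′, and we expand in B̃′ … we include the operators (1.16)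
… into the external fields"* — the (1.16)/(2.5) bookkeeping on a box with the perturbation field live up to `∂□` (GAPS G-B3-16.A1: print does not
spell the face bookkeeping out; route γ′ is the cell's reading of print's one-piece expansion).  [B1] (3.16) p. 615 (the bracket `V_k`), (3.44) p. 619.

WHAT THIS FILE PROVES (every `Ω` that is a union of `l`-blocks for all `l ≤ k`; `m² > 0`, `a > 0`, `1 ≤ k ≤ K`, `L > 1`).
* §1 THE PIECES (2.6) OF `G_k(Ω,X)` COMMUTE WITH THE CUT TO `Ω` (`sandwichR_cutTo`, `pieceR_cutTo`: r14's `propagatorK_cutTo`, `avgQkLin/Adj_cutTo`,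
  `cutToLin_mul_precOpA` + `cutToLin_mul_inverse`), hence map `Ω`-supported fields to `Ω`-supported fields and kill one-site sources off `Ω` on `Ω`
  (`pieceR_apply_eq_zero_of_not_mem`, `pieceR_single_apply_eq_zero_of_not_mem`, `covDeriv_pieceR_single_eq_zero`).
* §2 the per-piece (2.10) dictionary ON `Ω` (value / differentiated column / twice-differentiated kernel of a piece, own background: the conclusion
  shapes of p35 g21's `B3Ineq210RegularBox.ineq210_regularBox_explicit_small` and `B3Ineq210MixedRegularBox.ineq210_mixed_regularBox`) as HYPOTHESES,
  extended to every second argument by §1 (`pdcolO_le_all`, `pcolO_le_all`).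
* §3 THE FOUR PAIR BOUNDS ON `Ω` (`md_direct_le_box`, `md_parts_le_box`, `dm_direct_le_box`, `dm_parts_le_box`): the torus right sides of
  `B3Op116MixedSeed` §2 VERBATIM for the bulk, PLUS — in the two Leibniz forms only — the legs `ε⁻¹|e|s·Σ_{b∈exB}κ^D_{(i)}(b₀,b₋)‖w_j(b₋)‖`,
  `ε⁻¹|e|s·Σ_{b∈enB}κ^D_{(i)}(b₀,b₊)‖w_j(b₊)‖` of the charged bonds crossing `∂Ω` (the torus identities are exact; the bonds not inside `Ω` are
  either killed by §1 or leave these one-site charges).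
* §4 the scale-pair sums (`md_sum_le_box`, `dm_sum_le_box`): torus bulk + the legs summed over ALL pairs, i.e. against the whole differentiated column
  `Σ_iκ^D_{(i)} = κ^D` and the whole value majorant `Σ_j‖w_j‖`; §5 the `M^*M` and averaging sources (`mm_le_box`, `avg_le_box`: torus shapes, no legs).
* §6 **THE ROW THEOREM ON `Ω`** `phi_row_srcV_le_box`: `‖(D^ε_BG_k(Ω,B)V_k^Ω(A,B)w)(b₀)‖ ≤ 𝔪_k(|e|s·K₁ + L^k|e|δ_A·K₂, a_w; δ₁/(4L))(b₀₋,x′)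
  + 4dε⁻¹|e|s·Σ_iΣ_{u∈F_i}𝔪_k(ε^dC,1;δ₁)(b₀₋,u)·𝔪_k(c_w,a_w;δ₁)(u,x′)` with the TORUS constants `seedK1`, `seedK2` and any finite family of site sets
  `F_i` covering the initial points of `exB` and the final points of `enB` (`legs_le_faces`: at most `d` bonds per site, two Leibniz families ×
  (exiting + entering) legs) — the three-component derivative state of `B3Op116DKernelRegularBox.BoxState` with the pending sheet
  `S = 4dε⁻¹|e|s·𝔪_k(c_w,a_w;δ₁)(·,x′)` DISPLAYED.
* §7 THE INSTANCES: the pieces of `w = G_k(Ω,A+B)dip^B_{b′}Y` (`b′ ⊂ Ω`) obey the hypotheses with `a_w = 1` (`norm_pieceR_dipB_le_box`,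
  `norm_covDeriv_pieceR_dipB_le_box`), hence **`mixed_seed_le_box`** (the `D^ε_B`-row of `Wdip^B_{b′}Y` at every bond `b₀ ⊂ Ω`: regular part of exponent
  `1` + the sheet) and **`deriv_W_single_le_box`** (the `D^ε_B`-row of `We_{(y,i)}` at `b₀ ⊂ Ω`, exponent `2` + its sheet) — by the symmetry of `W`
  (p40's `B3Op116MixedSeedRegion.norm_W_dip_apply_le`, every `Ω`) the latter is the VALUE of `Wdip^B_{b′}Y` with the sheet sitting at the source bond `b′` (**`value_W_dip_le_box`**;
  off `Ω` the value is `0`, `W_dip_apply_eq_zero_of_not_mem`).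
WHAT REPLACES THE SUPPORT CLAUSE (for the reader of GAPS G-B3-16.A1): NO hypothesis on `supp Ã ∩ ∂Ω` is made — the charged bonds crossing `∂Ω`
are not assumed away (as in `B3Op116MixedSeedRegion`, print p. 412 «dist(supp Ã, ∂Ω) > 2r(L^kε)») but BOOKED, bond by bond, as the sheet term
`4dε⁻¹|e|s·Σ_iΣ_{u∈F_i}𝔪_k(ε^dC,1;δ₁)(b₀₋,u)·𝔪_k(c_w,a_w;δ₁)(u,x′)` of the row theorem, which M0's far-anchored step
`B3Op116MajorantStepBoxFar.step_fields_box_far` digests by the margin of the Interior source `x′`; this is why the file is (2.5) for (1.16) on `□`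
WITHOUT the clause and not a re-statement of the torus ∕ region seed.
HONEST SCOPE.  (B)-level: the per-piece dictionaries of `G_k(Ω,B)`, `G_k(Ω,A+B)` on `Ω`, `A` small (`|A_b| ≤ s`) and (I.2.23)-regular (`δ_A`) on the
whole torus, `(L^kε)|e|s ≤ 1`, the face family are HYPOTHESES (the plug on cell-product boxes — p35 g21's box dictionaries — and the digestion of the
sheet — M0 `B3Op116MajorantStepBoxFar`, M2 — are the sequel); `m² > 0`, `a > 0`, `1 ≤ k ≤ K`, `0 < δ₁ ≤ 1`; every `d ≥ 1`, `L ≥ 2`, `N`.  Constants =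
the torus file's (not optimized).  NEW WRITING = §1 (cut/kill for the pieces), the legs of §3–§4 and their regrouping `legs_le_faces` in §6; everything else is
the torus file line by line with `T_ε ↦ Ω` and `Σ_b ↦ Σ_{b⊂Ω}`.  Three `def`s (`pcolO`, `pdcolO`, `pmixO`: displayed nonnegative sums); no `def … : Prop`, no new named fact,
no `sorry`; axioms standard.  Value = the located non-bookkeeping step of a by-reference estimate of B3 on a box — NOT summit progress, nothing about
the mass gap.
-/

noncomputable section

open scoped BigOperators InnerProductSpace

namespace Literature.MathematicalPhysics.QuantumFieldTheory.Balaban1983to89.B3Op116MixedSeedBox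

open HiggsLattice (ChargeData ScalarField siteInner covDeriv)
open HiggsCovariance (propagatorK E avgQkLin avgQkAdj)
open B1Eq230FluctCov (Ix cb fluctCovA precOpA)
open B1Ineq234Concrete (nCol)
open B1Ineq234LevelZero (tdist_comm)
open B2Eq255Concrete (cutTo cutToLin cutToLin_apply cutTo_of_mem cutTo_of_not_mem)
open B3Ineq210RegularRegion (pieceR pieceR_zero pieceR_of_pos pieceR_of_le sum_pieceR sandwichR levelSet propagatorK_cutTo avgQkLin_cutTo
  avgQkAdj_cutTo cutToLin_mul_precOpA cutToLin_mul_inverse)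
open B1Eq230FluctCovPos (isUnit_precOpA_of_le)
open B3Op116Pieces (mulM fOne norm_U_apply)
open B3Op116ScaleChains (rate_eq mesh_rpow_add)
open B3Op116MajorantConvolution (majorant_nonneg majorant_rate_mono bump_mono_rate sum_kernel_mul_le sum_bond_kernel_mul_le)
open B3Op116SourceForm (mulMT srcMD srcDM srcMM bondSrc avgSrc srcV covDerivAt covDerivAt_apply norm_mapE_srcMD_le norm_mapE_srcDM_le
  norm_mapE_srcMM_le norm_mapE_single_le norm_mapE_dip_le map_srcV)
open B3Op116KernelRegularTorus (norm_covDeriv_le_add_split majorant_shift_le majorant_shift_le' majorant_mono top_bump_le_majorant_succ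
  norm_mapE_avgSrc_le_block)
open B3Op116OrderedPairs (pair_bond_le sum_sq_le_of_cases sum_lower_pair_le bump_shift_le bump_shift_le' mesh_rpow_zero_sub
  norm_pieceR_dip_apply_le block_avg_majorant_le norm_fOne_apply_le_of_abs_le mesh_rpow_mul_inv_pow_eq)
open B3Op116LeibnizRows (nMul pred norm_nMul_apply_le reg_neg norm_fOne_neg_apply_le sum_srcMD_eq inv_smul_sum_srcDM_eq U_neg_mulM_apply)
open B3Op116MixedSeed (srcMD_sum srcDM_sum mesh_one_mul_rpow_mul_inv mesh_rpow_mul_one_mul_inv mesh_rpow_mul_zero_mul_inv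
  kC gE seedK1 seedK2 md_arith dm_arith mm_arith avg_arith dip_eq_dip_add_single norm_U_sub_U_add_le norm_le_majorant_of_pieces mul_sumS_eq_maj)
open B3Op116RegionSources (nMul_eq_zero bondSrc_eq_zero srcMD_eq_zero srcDM_eq_zero srcMM_eq_zero mulM_eq_zero)
open B3Op116MixedSeedRegion (covDeriv_propagatorK_eq_sum_piecesR propagatorK_apply_eq_sum_piecesR norm_W_dip_apply_le)
open B3Op116CollarSources (inB exB enB mem_inB mem_exB mem_enB srcV_eq_univ_add propagatorK_single_apply_eq_zero_of_mem
  norm_covDeriv_of_tgt_eq_zero norm_covDeriv_of_src_eq_zero covDeriv_eq_zero_of_apply_eq_zero propagatorK_cb_apply_eq_zero_of_not_mem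
  covDeriv_propagatorK_cb_eq_zero_of_not_mem)
open B3Op116CollarHolder (sum_le_sum_cover sum_src_le sum_tgt_le)
open B3Op116MajorantStep (maj maj_nonneg)
open HiggsCovariancePos (Inside)
open B3Ineq210MixedRegularTorus (dip onb dip_zero)
open HiggsAveraging (blockIter blockK)

variable {P : HiggsLattice.Params} {N : ℕ}

/-- a single-scale bump with a nonnegative constant is nonnegative. [cite: Balaban1983Higgs3, (2.10) p.426] -/
private theorem bump_nonneg {c : ℝ} (hc : 0 ≤ c) (j : ℕ) (e t : ℝ) : 0 ≤ c * P.mesh j ^ e * Real.exp t :=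
  mul_nonneg (mul_nonneg hc (Real.rpow_nonneg (P.mesh_pos j).le e)) (Real.exp_nonneg _)

/-! ## §1 The pieces (2.6) of `G_k(Ω,X)` commute with the cut to `Ω`: support and one-site sources off `Ω` -/

section Pieces

variable (C : ChargeData N) (Ω : Finset (HiggsLattice.Site P 0)) (X : HiggsLattice.VecField P 0) {msq a : ℝ} {k : ℕ}
  (hmsq : 0 < msq) (ha : 0 < a) (hL1 : 1 < P.L) (hkK : k ≤ P.K)
  (hΩ : ∀ l, l ≤ k → ∀ x x' : HiggsLattice.Site P 0, blockIter l x = blockIter l x' → (x ∈ Ω ↔ x' ∈ Ω))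
include hmsq ha hL1 hkK hΩ

/-- **The sandwich `G^ε_lQ_l^*C^{(l)}(Ω)Q_lG^ε_l` of (I.2.43) on `Ω` commutes with the cut to `Ω`** (`1 ≤ l`, `l + 1 ≤ k ≤ K`; `Ω` a union of `l`- and
`(l+1)`-blocks): each factor does — `G^ε_l(Ω)` (r14's `propagatorK_cutTo`), `Q_l`, `Q_l^*` (the cuts to `Ω` and to `Ω^{(l)}` correspond), and
`C^{(l)}(Ω) = (Δ^{(l)}(Ω) + a_lP)^{-1}` (its operator commutes with the cut to `Ω^{(l)}`, r14's `cutToLin_mul_precOpA`, hence so does the inverse).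
[cite: Balaban1982Higgs1, (2.20) p.610, (2.30)–(2.32) p.611, (2.43) p.612] -/
theorem sandwichR_cutTo {l : ℕ} (hl1 : 1 ≤ l) (hlk : l + 1 ≤ k) (ψ : ScalarField P 0 N) :
    sandwichR C Ω X msq a l (cutTo Ω ψ) = cutTo Ω (sandwichR C Ω X msq a l ψ) := by
  obtain ⟨j, rfl⟩ : ∃ j, l = j + 1 := ⟨l - 1, by omega⟩
  have hL : (1 : ℝ) < (P.L : ℝ) := by exact_mod_cast hL1
  have hjK : j + 1 ≤ P.K := by omega
  have hak : 0 ≤ B1.aSeq a P.L (j + 1) := (B1.aSeq_pos ha hL (by omega)).le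
  have hΩ1 := hΩ (j + 1) (by omega)
  have hΩ2 := hΩ (j + 2) (by omega)
  have hC : ∀ φ : ScalarField P (j + 1) N, fluctCovA C Ω X msq a (j + 1) (cutTo (levelSet (j + 1) Ω) φ)
      = cutTo (levelSet (j + 1) Ω) (fluctCovA C Ω X msq a (j + 1) φ) := by
    intro φ
    have h := cutToLin_mul_inverse (isUnit_precOpA_of_le C Ω X hmsq ha hL hjK) (cutToLin_mul_precOpA C X hjK hmsq hak hΩ1 hΩ2)
    have h' := congrArg (fun T : Module.End ℝ (ScalarField P (j + 1) N) => T φ) h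
    simp only [Module.End.mul_apply, cutToLin_apply] at h'
    exact h'.symm
  simp only [sandwichR, LinearMap.coe_comp, Function.comp_apply]
  rw [propagatorK_cutTo C X hmsq hak hΩ1, avgQkLin_cutTo C X hΩ1, hC, avgQkAdj_cutTo C X hΩ1, propagatorK_cutTo C X hmsq hak hΩ1]

/-- **The pieces `G^η_{(j)}(Ω,X)` of (2.6) commute with the cut to `Ω`** (`1 ≤ k ≤ K`, `Ω` a union of `l`-blocks for every `l ≤ k`):
`G^η_{(0)} = G^ε_1(Ω,X)`, `G^η_{(j)} ∝` the sandwich at level `j < k`, `0` beyond. [cite: Balaban1983Higgs3, (2.6) p.424] [cite: Balaban1982Higgs1, (2.20) p.610, (2.43) p.612] -/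
theorem pieceR_cutTo (hk : 1 ≤ k) (j : ℕ) (ψ : ScalarField P 0 N) :
    pieceR C Ω X msq a k j (cutTo Ω ψ) = cutTo Ω (pieceR C Ω X msq a k j ψ) := by
  have hL : (1 : ℝ) < (P.L : ℝ) := by exact_mod_cast hL1
  rcases Nat.eq_zero_or_pos j with rfl | hj
  · rw [pieceR_zero]
    exact propagatorK_cutTo C X hmsq (B1.aSeq_pos ha hL le_rfl).le (hΩ 1 hk) ψ
  · by_cases hjk : j < k
    · rw [pieceR_of_pos hj hjk, LinearMap.smul_apply, LinearMap.smul_apply, sandwichR_cutTo C Ω X hmsq ha hL1 hkK hΩ hj (by omega) ψ,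
        ← cutToLin_apply, ← cutToLin_apply, map_smul]
    · rw [pieceR_of_le hj (not_lt.mp hjk), LinearMap.zero_apply, LinearMap.zero_apply, ← cutToLin_apply, map_zero]

/-- **A piece of an `Ω`-supported field vanishes off `Ω`.** [cite: Balaban1982Higgs1, (2.20) p.610] [cite: Balaban1983Higgs3, (2.6) p.424] -/
theorem pieceR_apply_eq_zero_of_not_mem (hk : 1 ≤ k) (j : ℕ) (φ : ScalarField P 0 N) (hφ : ∀ y : HiggsLattice.Site P 0, y ∉ Ω → φ y = 0)
    {y : HiggsLattice.Site P 0} (hy : y ∉ Ω) : pieceR C Ω X msq a k j φ y = 0 := by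
  have hcut : cutTo Ω φ = φ := by
    funext z
    by_cases hz : z ∈ Ω
    · rw [cutTo_of_mem _ _ hz]
    · rw [cutTo_of_not_mem _ _ hz, hφ z hz]
  have h := pieceR_cutTo C Ω X hmsq ha hL1 hkK hΩ hk j φ
  rw [hcut] at h
  rw [h, cutTo_of_not_mem _ _ hy]

/-- **A piece of a one-site source OFF `Ω` vanishes ON `Ω`.** [cite: Balaban1982Higgs1, (2.20) p.610] [cite: Balaban1983Higgs3, (2.6) p.424] -/
theorem pieceR_single_apply_eq_zero_of_not_mem (hk : 1 ≤ k) (j : ℕ) {z : HiggsLattice.Site P 0} (hz : z ∉ Ω) (v : E N)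
    {x : HiggsLattice.Site P 0} (hx : x ∈ Ω) : pieceR C Ω X msq a k j (Pi.single z v) x = 0 := by
  have hcut : cutTo Ω (Pi.single z v : ScalarField P 0 N) = 0 := by
    funext y
    by_cases hy : y ∈ Ω
    · rw [cutTo_of_mem _ _ hy, Pi.zero_apply, Pi.single_eq_of_ne (fun h : y = z => hz (h ▸ hy))]
    · rw [cutTo_of_not_mem _ _ hy, Pi.zero_apply]
  have h := pieceR_cutTo C Ω X hmsq ha hL1 hkK hΩ hk j (Pi.single z v)
  rw [hcut, map_zero] at h
  have h' := congrFun h x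
  rw [Pi.zero_apply, cutTo_of_mem _ _ hx] at h'
  exact h'.symm

/-- The basis column of a source off `Ω` vanishes on `Ω`, piece by piece. [cite: Balaban1982Higgs1, (2.20) p.610] -/
theorem pieceR_cb_apply_eq_zero_of_not_mem (hk : 1 ≤ k) (j : ℕ) {z : HiggsLattice.Site P 0} (hz : z ∉ Ω) (i : Ix N)
    {x : HiggsLattice.Site P 0} (hx : x ∈ Ω) : pieceR C Ω X msq a k j (cb P N 0 (z, i)) x = 0 := by
  rw [B3Ineq210MixedRegularTorus.cb_eq_single]
  exact pieceR_single_apply_eq_zero_of_not_mem C Ω X hmsq ha hL1 hkK hΩ hk j hz _ hx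

/-- **The differentiated row of a piece at a bond `⊂ Ω` kills one-site sources off `Ω`.** [cite: Balaban1982Higgs1, (1.7) p.605, (2.20) p.610] -/
theorem covDeriv_pieceR_single_eq_zero (hk : 1 ≤ k) (Y : HiggsLattice.VecField P 0) (j : ℕ) {z : HiggsLattice.Site P 0} (hz : z ∉ Ω)
    (v : E N) {b₀ : HiggsLattice.PBond P 0} (hb₀ : Inside Ω b₀) : covDeriv C Y (pieceR C Ω X msq a k j (Pi.single z v)) b₀ = 0 :=
  covDeriv_eq_zero_of_apply_eq_zero C Y _ (pieceR_single_apply_eq_zero_of_not_mem C Ω X hmsq ha hL1 hkK hΩ hk j hz v hb₀.1)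
    (pieceR_single_apply_eq_zero_of_not_mem C Ω X hmsq ha hL1 hkK hΩ hk j hz v hb₀.2)

omit hmsq ha hL1 hkK hΩ in
/-- The row functional `Φ_j = D^ε_Y(·)(b₀)∘G^η_{(j)}(Ω,X)` of a piece, unfolded. [cite: Balaban1983Higgs3, (2.6) p.424] -/
theorem phiO_apply (Y : HiggsLattice.VecField P 0) (b₀ : HiggsLattice.PBond P 0) (j : ℕ) (f : ScalarField P 0 N) :
    (covDerivAt C Y b₀ ∘ₗ pieceR C Ω X msq a k j) f = covDeriv C Y (pieceR C Ω X msq a k j f) b₀ := rfl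

end Pieces

/-! ## §2 The per-piece dictionary on `Ω` and the field pieces -/

section Dictionary

variable (C : ChargeData N) (Ω : Finset (HiggsLattice.Site P 0)) (msq a : ℝ) (k j : ℕ)

/-- the value column of the piece `G^η_{(j)}(Ω,X)`: `Σ_i‖(G^η_{(j)}(Ω,X)e_{(y,i)})(x)‖`. [cite: Balaban1983Higgs3, (2.6) p.424, (2.10) p.426] -/
def pcolO (X : HiggsLattice.VecField P 0) (x y : HiggsLattice.Site P 0) : ℝ :=
  ∑ i : Ix N, ‖pieceR C Ω X msq a k j (cb P N 0 (y, i)) x‖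

/-- the differentiated column of the piece `G^η_{(j)}(Ω,X)`, derivative `D^ε_Y` at the bond `b`: `Σ_i‖(D^ε_YG^η_{(j)}(Ω,X)e_{(y,i)})(b)‖`.
[cite: Balaban1983Higgs3, (2.6) p.424, (2.10) p.426] -/
def pdcolO (Y X : HiggsLattice.VecField P 0) (b : HiggsLattice.PBond P 0) (y : HiggsLattice.Site P 0) : ℝ :=
  ∑ i : Ix N, ‖covDeriv C Y (pieceR C Ω X msq a k j (cb P N 0 (y, i))) b‖

/-- the twice-differentiated kernel of the piece `G^η_{(j)}(Ω,X)` (row derivative `D^ε_Y` at `b₀`, dipole `dip^Y` across `b`), with the dipole's `ε⁻¹`: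
`ε⁻¹Σ_i‖(D^ε_YG^η_{(j)}(Ω,X)dip^Y_be_i)(b₀)‖` (`= ε^d`× p33's `mixedTermR` for `Y = X`). [cite: Balaban1983Higgs3, (2.6) p.424, (2.10) p.426] -/
def pmixO (Y X : HiggsLattice.VecField P 0) (b₀ b : HiggsLattice.PBond P 0) : ℝ :=
  (P.mesh 0)⁻¹ * ∑ i : Ix N, ‖covDeriv C Y (pieceR C Ω X msq a k j (dip C Y b (onb N i))) b₀‖

variable {C Ω msq a k j}

/-- `pcolO ≥ 0`. [cite: Balaban1983Higgs3, (2.10) p.426] -/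
theorem pcolO_nonneg (X : HiggsLattice.VecField P 0) (x y : HiggsLattice.Site P 0) : 0 ≤ pcolO C Ω msq a k j X x y :=
  Finset.sum_nonneg fun _ _ => norm_nonneg _

/-- `pdcolO ≥ 0`. [cite: Balaban1983Higgs3, (2.10) p.426] -/
theorem pdcolO_nonneg (Y X : HiggsLattice.VecField P 0) (b : HiggsLattice.PBond P 0) (y : HiggsLattice.Site P 0) :
    0 ≤ pdcolO C Ω msq a k j Y X b y :=
  Finset.sum_nonneg fun _ _ => norm_nonneg _

/-- `pmixO ≥ 0`. [cite: Balaban1983Higgs3, (2.10) p.426] -/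
theorem pmixO_nonneg (Y X : HiggsLattice.VecField P 0) (b₀ b : HiggsLattice.PBond P 0) : 0 ≤ pmixO C Ω msq a k j Y X b₀ b :=
  mul_nonneg (inv_nonneg.mpr (P.mesh_pos 0).le) (Finset.sum_nonneg fun _ _ => norm_nonneg _)

/-- `pmixO` IS `ε^d`× p33's region quantity `mixedTermR` (same pieces, same dipole) — the shape bounded on cell-product boxes by p35 g21's
`B3Ineq210MixedRegularBox.ineq210_mixed_regularBox`. [cite: Balaban1983Higgs3, (2.6) p.424, (2.10) p.426] -/
theorem pmixO_eq_mixedTermR (X : HiggsLattice.VecField P 0) (b₀ b : HiggsLattice.PBond P 0) :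
    pmixO C Ω msq a k j X X b₀ b
      = P.mesh 0 ^ P.d * B3Ineq210MixedRegularRegion.mixedTermR C Ω X msq a k j b₀.dir b.dir b₀.src b.src := by
  unfold pmixO B3Ineq210MixedRegularRegion.mixedTermR
  rw [← mul_assoc, mul_inv_cancel₀ (pow_pos (P.mesh_pos 0) _).ne', one_mul]

variable (C Ω) (X : HiggsLattice.VecField P 0) {msq a : ℝ} {k : ℕ}
  (hmsq : 0 < msq) (ha : 0 < a) (hL1 : 1 < P.L) (hk : 1 ≤ k) (hkK : k ≤ P.K)
  (hΩ : ∀ l, l ≤ k → ∀ x x' : HiggsLattice.Site P 0, blockIter l x = blockIter l x' → (x ∈ Ω ↔ x' ∈ Ω))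
include hmsq ha hL1 hk hkK hΩ

/-- **The differentiated column of a piece is majorised at EVERY source site** once the dictionary holds on `Ω` (off `Ω` it vanishes, §1):
for `b ⊂ Ω` and all `y`, `pdcolO j Y X b y ≤ ε^dC·(L^jε)^{e−d}e_j(b₋,y)`. [cite: Balaban1983Higgs3, (2.6) p.424, (2.10) p.426] [cite: Balaban1982Higgs1, (2.20) p.610] -/
theorem pdcolO_le_all (Y : HiggsLattice.VecField P 0) (j : ℕ) {c e δ : ℝ} (hc : 0 ≤ c)
    (hpd : ∀ b : HiggsLattice.PBond P 0, Inside Ω b → ∀ y ∈ Ω, pdcolO C Ω msq a k j Y X b y ≤ c * P.mesh j ^ e *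
      Real.exp (-(δ * (P.mesh j)⁻¹ * (P.mesh 0 * (HiggsLattice.Site.tdist b.src y : ℝ)))))
    {b : HiggsLattice.PBond P 0} (hb : Inside Ω b) (y : HiggsLattice.Site P 0) :
    pdcolO C Ω msq a k j Y X b y ≤ c * P.mesh j ^ e * Real.exp (-(δ * (P.mesh j)⁻¹ * (P.mesh 0 * (HiggsLattice.Site.tdist b.src y : ℝ)))) := by
  by_cases hy : y ∈ Ω
  · exact hpd b hb y hy
  · unfold pdcolO
    rw [Finset.sum_eq_zero (fun i _ => by
      rw [B3Ineq210MixedRegularTorus.cb_eq_single, covDeriv_pieceR_single_eq_zero C Ω X hmsq ha hL1 hkK hΩ hk Y j hy _ hb, norm_zero])]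
    exact bump_nonneg hc j e _

/-- **The value column of a piece is majorised at every source site** (for `x ∈ Ω`). [cite: Balaban1983Higgs3, (2.6) p.424, (2.10) p.426] [cite: Balaban1982Higgs1, (2.20) p.610] -/
theorem pcolO_le_all (j : ℕ) {c e δ : ℝ} (hc : 0 ≤ c)
    (hpc : ∀ x ∈ Ω, ∀ y ∈ Ω, pcolO C Ω msq a k j X x y ≤ c * P.mesh j ^ e *
      Real.exp (-(δ * (P.mesh j)⁻¹ * (P.mesh 0 * (HiggsLattice.Site.tdist x y : ℝ)))))
    {x : HiggsLattice.Site P 0} (hx : x ∈ Ω) (y : HiggsLattice.Site P 0) :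
    pcolO C Ω msq a k j X x y ≤ c * P.mesh j ^ e * Real.exp (-(δ * (P.mesh j)⁻¹ * (P.mesh 0 * (HiggsLattice.Site.tdist x y : ℝ)))) := by
  by_cases hy : y ∈ Ω
  · exact hpc x hx y hy
  · unfold pcolO
    rw [Finset.sum_eq_zero (fun i _ => by rw [pieceR_cb_apply_eq_zero_of_not_mem C Ω X hmsq ha hL1 hkK hΩ hk j hy i hx, norm_zero])]
    exact bump_nonneg hc j e _

end Dictionary

/-! ## §3 ONE PAIR OF SCALES ON `Ω`: the `M^*D` and `D^*M` sources of a scale-`j₁` field piece (vanishing off `Ω`) through the row functional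
of the scale-`j₂` piece of `G_k(Ω,B)` at a bond `b₀ ⊂ Ω` — directly (no legs) and in Leibniz form (torus bulk + the face legs) -/

section Pairs

variable {C : ChargeData N} {Ω : Finset (HiggsLattice.Site P 0)} {A B : HiggsLattice.VecField P 0} {msq a : ℝ} {k : ℕ}
  {δ₁ Cst CM s δA : ℝ}

/-- an indicator-restricted sum over all indices is the sum over the finset. [folklore] -/
private theorem sum_ite_mem_eq {ι : Type*} [Fintype ι] (S : Finset ι) [DecidablePred (· ∈ S)] (f : ι → ℝ) :
    ∑ b, (if b ∈ S then f b else 0) = ∑ b ∈ S, f b := by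
  rw [← Finset.sum_filter]
  exact Finset.sum_congr (by ext b; simp) fun _ _ => rfl

/-- `F₁(0) = 0` (`U(η,0) = 1`). [cite: Balaban1982Higgs1, (3.14) p.614] -/
private theorem fOne_zero_arg (C : ChargeData N) (η : ℝ) (v : E N) : fOne C η 0 v = 0 := by
  rw [B3Op116Pieces.fOne_apply, ChargeData.U_zero]
  simp

/-- `Σ_{b⊂Ω}srcMD_b u = Σ_b srcMD_b u − Σ_{b⊄Ω}srcMD_b u` (and the same for any bond source). [cite: Balaban1982Higgs1, (3.16) p.615] -/
private theorem sum_ite_inside_eq_sub (f : HiggsLattice.PBond P 0 → ScalarField P 0 N) :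
    (∑ b : HiggsLattice.PBond P 0, if Inside Ω b then f b else 0)
      = (∑ b : HiggsLattice.PBond P 0, f b) - ∑ b : HiggsLattice.PBond P 0, (if Inside Ω b then 0 else f b) := by
  rw [← Finset.sum_sub_distrib]
  exact Finset.sum_congr rfl fun b _ => by split_ifs <;> simp

variable (hmsq : 0 < msq) (ha : 0 < a) (hL1 : 1 < P.L) (hk : 1 ≤ k) (hkK : k ≤ P.K)
  (hΩ : ∀ l, l ≤ k → ∀ x x' : HiggsLattice.Site P 0, blockIter l x = blockIter l x' → (x ∈ Ω ↔ x' ∈ Ω))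

/-- `‖(D^ε_YG^η_{(j)}(Ω,X)δ_yv)(b₀)‖ ≤ ‖v‖·pdcolO j Y X b₀ y`. [cite: Balaban1982Higgs1, (1.5) p.604] [cite: Balaban1983Higgs3, (2.6) p.424] -/
theorem norm_phiO_single_le (Y X : HiggsLattice.VecField P 0) (j : ℕ) (b₀ : HiggsLattice.PBond P 0) (y : HiggsLattice.Site P 0) (v : E N) :
    ‖covDeriv C Y (pieceR C Ω X msq a k j (Pi.single y v)) b₀‖ ≤ ‖v‖ * pdcolO C Ω msq a k j Y X b₀ y :=
  B3Ineq210MixedRegularTorus.norm_covDeriv_apply_single_le C Y (pieceR C Ω X msq a k j) y v b₀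

/-- `ε⁻¹‖(D^ε_YG^η_{(j)}(Ω,X)dip^Y_bv)(b₀)‖ ≤ ‖v‖·pmixO j Y X b₀ b`. [cite: Balaban1982Higgs1, (1.7) p.605] [cite: Balaban1983Higgs3, (2.6) p.424] -/
theorem norm_phiO_dip_le (Y X : HiggsLattice.VecField P 0) (j : ℕ) (b₀ b : HiggsLattice.PBond P 0) (v : E N) :
    (P.mesh 0)⁻¹ * ‖covDeriv C Y (pieceR C Ω X msq a k j (dip C Y b v)) b₀‖ ≤ ‖v‖ * pmixO C Ω msq a k j Y X b₀ b := by
  have h := norm_mapE_dip_le C Y (covDerivAt C Y b₀ ∘ₗ pieceR C Ω X msq a k j) b v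
  simp only [phiO_apply] at h
  calc (P.mesh 0)⁻¹ * ‖covDeriv C Y (pieceR C Ω X msq a k j (dip C Y b v)) b₀‖
      ≤ (P.mesh 0)⁻¹ * (‖v‖ * ∑ i : Ix N, ‖covDeriv C Y (pieceR C Ω X msq a k j (dip C Y b (onb N i))) b₀‖) :=
        mul_le_mul_of_nonneg_left h (inv_nonneg.mpr (P.mesh_pos 0).le)
    _ = _ := by rw [pmixO]; ring

include hmsq ha hL1 hk hkK hΩ

/-- **An exiting dipole seen from inside**: for `b₊ ∉ Ω` and `b₀ ⊂ Ω`, `(D^ε_YG^η_{(j)}(Ω,X)dip^Y_bv)(b₀) = −(D^ε_YG^η_{(j)}(Ω,X)δ_{b₋}v)(b₀)`.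
[cite: Balaban1982Higgs1, (1.7) p.605, (2.20) p.610] -/
theorem phiO_dip_of_tgt_not_mem (Y X : HiggsLattice.VecField P 0) (j : ℕ) {b₀ b : HiggsLattice.PBond P 0} (hb₀ : Inside Ω b₀)
    (hbt : b.tgt ∉ Ω) (v : E N) :
    covDeriv C Y (pieceR C Ω X msq a k j (dip C Y b v)) b₀ = -covDeriv C Y (pieceR C Ω X msq a k j (Pi.single b.src v)) b₀ := by
  rw [← phiO_apply, ← phiO_apply, dip, map_sub, phiO_apply, covDeriv_pieceR_single_eq_zero C Ω X hmsq ha hL1 hkK hΩ hk Y j hbt _ hb₀,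
    zero_sub]

/-- **An entering dipole seen from inside**: for `b₋ ∉ Ω` and `b₀ ⊂ Ω`, `(D^ε_YG^η_{(j)}(Ω,X)dip^Y_bv)(b₀) = (D^ε_YG^η_{(j)}(Ω,X)δ_{b₊}U(ε,−Y_b)v)(b₀)`.
[cite: Balaban1982Higgs1, (1.7) p.605, (2.20) p.610] -/
theorem phiO_dip_of_src_not_mem (Y X : HiggsLattice.VecField P 0) (j : ℕ) {b₀ b : HiggsLattice.PBond P 0} (hb₀ : Inside Ω b₀)
    (hbs : b.src ∉ Ω) (v : E N) :
    covDeriv C Y (pieceR C Ω X msq a k j (dip C Y b v)) b₀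
      = covDeriv C Y (pieceR C Ω X msq a k j (Pi.single b.tgt (C.U (P.mesh 0) (-(Y b)) v))) b₀ := by
  rw [← phiO_apply, ← phiO_apply, dip, map_sub, phiO_apply, phiO_apply,
    covDeriv_pieceR_single_eq_zero C Ω X hmsq ha hL1 hkK hΩ hk Y j hbs _ hb₀, sub_zero]

omit hmsq ha hL1 hk hkK hΩ in
/-- **PAIR BOUND 1 ON `Ω` — the `M^*D` sources of the bonds `⊂ Ω`, directly** (no legs; the field's derivative at bonds `⊂ Ω` only):
the torus right side of `B3Op116MixedSeed.md_direct_le` verbatim. [cite: Balaban1983Higgs3, (1.16) p.414, (2.6) p.424, (2.10) p.426] [cite: Balaban1982Higgs1, (3.16) p.615] -/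
theorem md_direct_le_box (hδ₁ : 0 < δ₁) (hδ₁1 : δ₁ ≤ 1) (hCst : 0 ≤ Cst) (hs : 0 ≤ s)
    (hpd : ∀ (j : ℕ) (b : HiggsLattice.PBond P 0), Inside Ω b → ∀ y : HiggsLattice.Site P 0,
      pdcolO C Ω msq a k j B B b y ≤ (P.mesh 0 ^ P.d * Cst) * P.mesh j ^ ((1 : ℝ) - (P.d : ℝ)) *
        Real.exp (-(δ₁ * (P.mesh j)⁻¹ * (P.mesh 0 * (HiggsLattice.Site.tdist b.src y : ℝ)))))
    (hA : ∀ b : HiggsLattice.PBond P 0, |A b| ≤ s) (i₀ : Ix N) {b₀ : HiggsLattice.PBond P 0} (hb₀ : Inside Ω b₀)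
    (x' : HiggsLattice.Site P 0) (j₁ j₂ : ℕ) (u : ScalarField P 0 N) {aw cu' : ℝ} (hcu' : 0 ≤ cu')
    (hud : ∀ b : HiggsLattice.PBond P 0, Inside Ω b → ‖covDeriv C B u b‖ ≤ cu' * P.mesh j₁ ^ (aw - 1 - (P.d : ℝ)) *
      Real.exp (-(δ₁ * (P.mesh j₁)⁻¹ * (P.mesh 0 * (HiggsLattice.Site.tdist b.src x' : ℝ))))) :
    ‖covDeriv C B (pieceR C Ω B msq a k j₂ (∑ b : HiggsLattice.PBond P 0, if Inside Ω b then srcMD C A B b u else 0)) b₀‖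
      ≤ (P.d : ℝ) * ((Real.exp 1 * (P.mesh 0 ^ P.d * Cst)) * (|C.e| * s * cu') *
            ((nCol N : ℝ) * (8 * P.d / δ₁) ^ P.d * (P.mesh 0 ^ P.d)⁻¹)) *
          (P.mesh j₂ ^ (1 : ℝ) * P.mesh j₁ ^ (aw - 1) * (P.mesh (max j₂ j₁) ^ P.d)⁻¹) *
          Real.exp (-(δ₁ / 2 * (P.mesh (max j₂ j₁))⁻¹ * (P.mesh 0 * (HiggsLattice.Site.tdist b₀.src x' : ℝ)))) := by
  have hes : 0 ≤ |C.e| * s := mul_nonneg (abs_nonneg _) hs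
  have hc : 0 ≤ P.mesh 0 ^ P.d * Cst := mul_nonneg (pow_nonneg (P.mesh_pos 0).le _) hCst
  set G : HiggsLattice.PBond P 0 → ℝ := fun b => if Inside Ω b then |C.e| * s * ‖covDeriv C B u b‖ else 0 with hG
  have hG0 : ∀ b, 0 ≤ G b := fun b => by simp only [hG]; split_ifs; exacts [mul_nonneg hes (norm_nonneg _), le_rfl]
  -- separate the bonds
  have step1 : ‖covDeriv C B (pieceR C Ω B msq a k j₂ (∑ b : HiggsLattice.PBond P 0, if Inside Ω b then srcMD C A B b u else 0)) b₀‖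
      ≤ ∑ b : HiggsLattice.PBond P 0, pdcolO C Ω msq a k j₂ B B b₀ b.tgt * G b := by
    rw [map_sum, B3Ineq210RegularTorus.covDeriv_sum'']
    refine (norm_sum_le _ _).trans (Finset.sum_le_sum fun b _ => ?_)
    by_cases hb : Inside Ω b
    · rw [if_pos hb]; simp only [hG, if_pos hb]
      have h := norm_mapE_srcMD_le C A B (covDerivAt C B b₀ ∘ₗ pieceR C Ω B msq a k j₂) (hA b) u
      simp only [phiO_apply] at h
      refine h.trans (le_of_eq ?_)
      rw [pdcolO]; ring
    · rw [if_neg hb, map_zero, B3Ineq210RegularTorus.covDeriv_zero'', norm_zero]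
      exact mul_nonneg (pdcolO_nonneg _ _ _ _) (hG0 b)
  refine step1.trans ?_
  refine pair_bond_le hδ₁ hδ₁1 j₂ j₁ (mul_nonneg (Real.exp_nonneg _) hc) (mul_nonneg hes hcu') i₀ b₀.src x'
    (fun b => pdcolO C Ω msq a k j₂ B B b₀ b.tgt) G (fun b => pdcolO_nonneg _ _ _ _) hG0 (fun b => ?_) (fun b => ?_)
  · -- the differentiated column of the piece, shifted from `b₊` to `b₋`
    refine (hpd j₂ b₀ hb₀ b.tgt).trans ?_
    have hsh := bump_shift_le hδ₁.le hδ₁1 j₂ b₀.src b.src b.dir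
    have hm : 0 ≤ (P.mesh 0 ^ P.d * Cst) * P.mesh j₂ ^ ((1 : ℝ) - (P.d : ℝ)) := mul_nonneg hc (Real.rpow_nonneg (P.mesh_pos _).le _)
    calc (P.mesh 0 ^ P.d * Cst) * P.mesh j₂ ^ ((1 : ℝ) - (P.d : ℝ)) *
          Real.exp (-(δ₁ * (P.mesh j₂)⁻¹ * (P.mesh 0 * (HiggsLattice.Site.tdist b₀.src b.tgt : ℝ))))
        ≤ (P.mesh 0 ^ P.d * Cst) * P.mesh j₂ ^ ((1 : ℝ) - (P.d : ℝ)) *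
          (Real.exp 1 * Real.exp (-(δ₁ * (P.mesh j₂)⁻¹ * (P.mesh 0 * (HiggsLattice.Site.tdist b₀.src b.src : ℝ))))) :=
          mul_le_mul_of_nonneg_left hsh hm
      _ = _ := by ring
  · simp only [hG]
    split_ifs with hb
    · exact (mul_le_mul_of_nonneg_left (hud b hb) hes).trans (le_of_eq (by ring))
    · exact bump_nonneg (mul_nonneg hes hcu') j₁ _ _

/-- **PAIR BOUND 2 ON `Ω` — the `M^*D` sources of the bonds `⊂ Ω` in Leibniz form** (THEOREM A″ on the sum over ALL bonds, minus the bonds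
`⊄ Ω`): the torus right side of `B3Op116MixedSeed.md_parts_le` (twice-differentiated kernel on pairs of bonds `⊂ Ω`, `N`-term on all bonds)
PLUS THE LEGS — the exiting charged bonds `b ∈ exB` (the dipole of A″ loses its far end: `ε⁻¹|e|s·pdcolO(b₀,b₋)‖u(b₋)‖`) and the entering
charged bonds `b ∈ enB` (the subtracted source `srcMD_b u = δ_{b₊}M_b^*(D^ε_Bu)(b)` with `(D^ε_Bu)(b) = ε⁻¹U·u(b₊)`: `ε⁻¹|e|s·pdcolO(b₀,b₊)‖u(b₊)‖`).
[cite: Balaban1983Higgs3, (1.16) p.414, (2.6) p.424, (2.10) p.426, p.433] [cite: Balaban1982Higgs1, (2.23) p.610, (3.16) p.615] -/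
theorem md_parts_le_box (hδ₁ : 0 < δ₁) (hδ₁1 : δ₁ ≤ 1) (hCst : 0 ≤ Cst) (hCM : 0 ≤ CM) (hs : 0 ≤ s) (hδA : 0 ≤ δA)
    (hpd : ∀ (j : ℕ) (b : HiggsLattice.PBond P 0), Inside Ω b → ∀ y : HiggsLattice.Site P 0,
      pdcolO C Ω msq a k j B B b y ≤ (P.mesh 0 ^ P.d * Cst) * P.mesh j ^ ((1 : ℝ) - (P.d : ℝ)) *
        Real.exp (-(δ₁ * (P.mesh j)⁻¹ * (P.mesh 0 * (HiggsLattice.Site.tdist b.src y : ℝ)))))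
    (hpm : ∀ (j : ℕ) (b₀ b : HiggsLattice.PBond P 0), Inside Ω b₀ → Inside Ω b →
      pmixO C Ω msq a k j B B b₀ b ≤ (P.mesh 0 ^ P.d * CM) * P.mesh j ^ ((0 : ℝ) - (P.d : ℝ)) *
        Real.exp (-(δ₁ * (P.mesh j)⁻¹ * (P.mesh 0 * (HiggsLattice.Site.tdist b₀.src b.src : ℝ)))))
    (hA : ∀ b : HiggsLattice.PBond P 0, |A b| ≤ s)
    (hreg : ∀ (z : HiggsLattice.Site P 0) (μ ν : Fin P.d), |A ⟨z.shift ν, μ⟩ - A ⟨z, μ⟩| ≤ δA)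
    (i₀ : Ix N) {b₀ : HiggsLattice.PBond P 0} (hb₀ : Inside Ω b₀) (x' : HiggsLattice.Site P 0) (j₁ j₂ : ℕ) (u : ScalarField P 0 N)
    (hu0 : ∀ y : HiggsLattice.Site P 0, y ∉ Ω → u y = 0) {aw cu : ℝ} (hcu : 0 ≤ cu)
    (huv : ∀ y : HiggsLattice.Site P 0, ‖u y‖ ≤ cu * P.mesh j₁ ^ (aw - (P.d : ℝ)) *
      Real.exp (-(δ₁ * (P.mesh j₁)⁻¹ * (P.mesh 0 * (HiggsLattice.Site.tdist y x' : ℝ))))) :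
    ‖covDeriv C B (pieceR C Ω B msq a k j₂ (∑ b : HiggsLattice.PBond P 0, if Inside Ω b then srcMD C A B b u else 0)) b₀‖
      ≤ (P.d : ℝ) * ((P.mesh 0 ^ P.d * Cst) * ((P.mesh 0)⁻¹ * (|C.e| * δA) * cu) *
            ((nCol N : ℝ) * (8 * P.d / δ₁) ^ P.d * (P.mesh 0 ^ P.d)⁻¹)) *
          (P.mesh j₂ ^ (1 : ℝ) * P.mesh j₁ ^ aw * (P.mesh (max j₂ j₁) ^ P.d)⁻¹) *
          Real.exp (-(δ₁ / 2 * (P.mesh (max j₂ j₁))⁻¹ * (P.mesh 0 * (HiggsLattice.Site.tdist b₀.src x' : ℝ))))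
        + (P.d : ℝ) * ((P.mesh 0 ^ P.d * CM) * (|C.e| * s * cu) *
            ((nCol N : ℝ) * (8 * P.d / δ₁) ^ P.d * (P.mesh 0 ^ P.d)⁻¹)) *
          (P.mesh j₂ ^ (0 : ℝ) * P.mesh j₁ ^ aw * (P.mesh (max j₂ j₁) ^ P.d)⁻¹) *
          Real.exp (-(δ₁ / 2 * (P.mesh (max j₂ j₁))⁻¹ * (P.mesh 0 * (HiggsLattice.Site.tdist b₀.src x' : ℝ))))
        + (P.mesh 0)⁻¹ * (|C.e| * s) *
          ((∑ b ∈ exB Ω A, pdcolO C Ω msq a k j₂ B B b₀ b.src * ‖u b.src‖)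
            + ∑ b ∈ enB Ω A, pdcolO C Ω msq a k j₂ B B b₀ b.tgt * ‖u b.tgt‖) := by
  classical
  have hε := P.mesh_pos 0
  have hε0 : 0 ≤ (P.mesh 0)⁻¹ := inv_nonneg.mpr hε.le
  have hes : 0 ≤ |C.e| * s := mul_nonneg (abs_nonneg _) hs
  have hN : 0 ≤ (P.mesh 0)⁻¹ * (|C.e| * δA) := mul_nonneg hε0 (mul_nonneg (abs_nonneg _) hδA)
  have hc : 0 ≤ P.mesh 0 ^ P.d * Cst := mul_nonneg (pow_nonneg hε.le _) hCst
  have hcM : 0 ≤ P.mesh 0 ^ P.d * CM := mul_nonneg (pow_nonneg hε.le _) hCM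
  have hles : (P.mesh 0)⁻¹ * (|C.e| * s) ≥ 0 := mul_nonneg hε0 hes
  -- abbreviations
  set Φ : ScalarField P 0 N → E N := fun f => covDeriv C B (pieceR C Ω B msq a k j₂ f) b₀ with hΦ
  set FI : HiggsLattice.PBond P 0 → ℝ := fun b => if Inside Ω b then pmixO C Ω msq a k j₂ B B b₀ b else 0 with hFI
  set Lex : HiggsLattice.PBond P 0 → ℝ := fun b =>
    if b ∈ exB Ω A then (P.mesh 0)⁻¹ * (|C.e| * s) * (pdcolO C Ω msq a k j₂ B B b₀ b.src * ‖u b.src‖) else 0 with hLex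
  set Len : HiggsLattice.PBond P 0 → ℝ := fun b =>
    if b ∈ enB Ω A then (P.mesh 0)⁻¹ * (|C.e| * s) * (pdcolO C Ω msq a k j₂ B B b₀ b.tgt * ‖u b.tgt‖) else 0 with hLen
  have hFI0 : ∀ b, 0 ≤ FI b := fun b => by simp only [hFI]; split_ifs; exacts [pmixO_nonneg _ _ _ _, le_rfl]
  have hLex0 : ∀ b, 0 ≤ Lex b := fun b => by
    simp only [hLex]; split_ifs; exacts [mul_nonneg hles (mul_nonneg (pdcolO_nonneg _ _ _ _) (norm_nonneg _)), le_rfl]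
  have hLen0 : ∀ b, 0 ≤ Len b := fun b => by
    simp only [hLen]; split_ifs; exacts [mul_nonneg hles (mul_nonneg (pdcolO_nonneg _ _ _ _) (norm_nonneg _)), le_rfl]
  -- the dipole of A″, bond by bond: bulk on bonds `⊂ Ω`, a leg on `exB`, nothing elsewhere
  have key_dip : ∀ b : HiggsLattice.PBond P 0,
      (P.mesh 0)⁻¹ * ‖Φ (dip C B b (fOne C (P.mesh 0) (-(A b)) (u b.src)))‖ ≤ FI b * (|C.e| * s * ‖u b.src‖) + Lex b := by
    intro b
    by_cases hb : Inside Ω b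
    · have hin : FI b = pmixO C Ω msq a k j₂ B B b₀ b := by simp only [hFI]; exact if_pos hb
      rw [hin]
      refine le_add_of_le_of_nonneg ?_ (hLex0 b)
      calc (P.mesh 0)⁻¹ * ‖Φ (dip C B b (fOne C (P.mesh 0) (-(A b)) (u b.src)))‖
          ≤ ‖fOne C (P.mesh 0) (-(A b)) (u b.src)‖ * pmixO C Ω msq a k j₂ B B b₀ b := norm_phiO_dip_le B B j₂ b₀ b _
        _ = pmixO C Ω msq a k j₂ B B b₀ b * ‖fOne C (P.mesh 0) (-(A b)) (u b.src)‖ := mul_comm _ _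
        _ ≤ _ := mul_le_mul_of_nonneg_left (norm_fOne_neg_apply_le C A (hA b) _) (pmixO_nonneg _ _ _ _)
    · have hout : FI b = 0 := by simp only [hFI]; exact if_neg hb
      rw [hout, zero_mul, zero_add]
      by_cases hbs : b.src ∈ Ω
      · have hbt : b.tgt ∉ Ω := fun h => hb ⟨hbs, h⟩
        by_cases hAb : A b = 0
        · have h0 : fOne C (P.mesh 0) (-(A b)) (u b.src) = 0 := by rw [hAb, neg_zero, fOne_zero_arg]
          rw [h0, dip_zero, hΦ]; simp only
          rw [map_zero, B3Ineq210RegularTorus.covDeriv_zero'', norm_zero, mul_zero]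
          exact hLex0 b
        · have hex : b ∈ exB Ω A := mem_exB.2 ⟨hbs, hbt, Or.inl hAb⟩
          have hl : Lex b = (P.mesh 0)⁻¹ * (|C.e| * s) * (pdcolO C Ω msq a k j₂ B B b₀ b.src * ‖u b.src‖) := by
            simp only [hLex]; exact if_pos hex
          rw [hl, hΦ]; simp only
          rw [phiO_dip_of_tgt_not_mem hmsq ha hL1 hk hkK hΩ B B j₂ hb₀ hbt, norm_neg]
          calc (P.mesh 0)⁻¹ * ‖covDeriv C B (pieceR C Ω B msq a k j₂ (Pi.single b.src (fOne C (P.mesh 0) (-(A b)) (u b.src)))) b₀‖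
              ≤ (P.mesh 0)⁻¹ * (‖fOne C (P.mesh 0) (-(A b)) (u b.src)‖ * pdcolO C Ω msq a k j₂ B B b₀ b.src) :=
                mul_le_mul_of_nonneg_left (norm_phiO_single_le B B j₂ b₀ b.src _) hε0
            _ ≤ (P.mesh 0)⁻¹ * ((|C.e| * s * ‖u b.src‖) * pdcolO C Ω msq a k j₂ B B b₀ b.src) :=
                mul_le_mul_of_nonneg_left (mul_le_mul_of_nonneg_right (norm_fOne_neg_apply_le C A (hA b) _) (pdcolO_nonneg _ _ _ _)) hε0
            _ = _ := by ring
      · rw [hu0 _ hbs, map_zero, dip_zero, hΦ]; simp only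
        rw [map_zero, B3Ineq210RegularTorus.covDeriv_zero'', norm_zero, mul_zero]
        exact hLex0 b
  -- the `N`-term of A″, bond by bond (all bonds; the all-sites column)
  have key_N : ∀ b : HiggsLattice.PBond P 0,
      ‖Φ (Pi.single b.src (nMul C (-A) b (u b.src)))‖
        ≤ pdcolO C Ω msq a k j₂ B B b₀ b.src * ((P.mesh 0)⁻¹ * (|C.e| * δA) * ‖u b.src‖) := by
    intro b
    rw [hΦ]; simp only
    refine (norm_phiO_single_le B B j₂ b₀ b.src _).trans ?_
    rw [mul_comm]
    exact mul_le_mul_of_nonneg_left (norm_nMul_apply_le C (-A) (reg_neg A hreg) b _) (pdcolO_nonneg _ _ _ _)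
  -- the subtracted bonds `⊄ Ω`, bond by bond: a leg on `enB`, nothing elsewhere
  have key_corr : ∀ b : HiggsLattice.PBond P 0, ‖Φ (if Inside Ω b then 0 else srcMD C A B b u)‖ ≤ Len b := by
    intro b
    by_cases hb : Inside Ω b
    · rw [if_pos hb, hΦ]; simp only
      rw [map_zero, B3Ineq210RegularTorus.covDeriv_zero'', norm_zero]; exact hLen0 b
    · rw [if_neg hb]
      by_cases hbt : b.tgt ∈ Ω
      · have hbs : b.src ∉ Ω := fun h => hb ⟨h, hbt⟩
        by_cases hAb : A b = 0
        · rw [srcMD_eq_zero C A B hAb, hΦ]; simp only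
          rw [map_zero, B3Ineq210RegularTorus.covDeriv_zero'', norm_zero]; exact hLen0 b
        · have hen : b ∈ enB Ω A := mem_enB.2 ⟨hbs, hbt, hAb⟩
          have hl : Len b = (P.mesh 0)⁻¹ * (|C.e| * s) * (pdcolO C Ω msq a k j₂ B B b₀ b.tgt * ‖u b.tgt‖) := by
            simp only [hLen]; exact if_pos hen
          rw [hl, hΦ]; simp only
          have h := norm_mapE_srcMD_le C A B (covDerivAt C B b₀ ∘ₗ pieceR C Ω B msq a k j₂) (hA b) u
          simp only [phiO_apply] at h
          rw [norm_covDeriv_of_src_eq_zero C B u (hu0 _ hbs)] at h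
          refine h.trans (le_of_eq ?_)
          rw [pdcolO]; ring
      · rw [srcMD, hΦ]; simp only
        rw [covDeriv_pieceR_single_eq_zero C Ω B hmsq ha hL1 hkK hΩ hk B j₂ hbt _ hb₀, norm_zero]; exact hLen0 b
  -- THEOREM A″ and the resulting bond sums
  have step1 : ‖covDeriv C B (pieceR C Ω B msq a k j₂ (∑ b : HiggsLattice.PBond P 0, if Inside Ω b then srcMD C A B b u else 0)) b₀‖
      ≤ (∑ b : HiggsLattice.PBond P 0, pdcolO C Ω msq a k j₂ B B b₀ b.src * ((P.mesh 0)⁻¹ * (|C.e| * δA) * ‖u b.src‖))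
        + (∑ b : HiggsLattice.PBond P 0, FI b * (|C.e| * s * ‖u b.src‖))
        + ((∑ b : HiggsLattice.PBond P 0, Lex b) + ∑ b : HiggsLattice.PBond P 0, Len b) := by
    rw [sum_ite_inside_eq_sub, ← phiO_apply, map_sub, sum_srcMD_eq, map_add, map_neg, map_smul, map_sum, map_sum, map_sum,
      Finset.smul_sum]
    simp only [phiO_apply]
    refine (norm_sub_le _ _).trans ?_
    have hA'' : ‖-(∑ b : HiggsLattice.PBond P 0, (P.mesh 0)⁻¹ • Φ (dip C B b (fOne C (P.mesh 0) (-(A b)) (u b.src))))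
          + ∑ b : HiggsLattice.PBond P 0, Φ (Pi.single b.src (nMul C (-A) b (u b.src)))‖
        ≤ (∑ b : HiggsLattice.PBond P 0, (FI b * (|C.e| * s * ‖u b.src‖) + Lex b))
          + ∑ b : HiggsLattice.PBond P 0, pdcolO C Ω msq a k j₂ B B b₀ b.src * ((P.mesh 0)⁻¹ * (|C.e| * δA) * ‖u b.src‖) := by
      refine (norm_add_le _ _).trans (add_le_add ?_ ?_)
      · rw [norm_neg]
        refine (norm_sum_le _ _).trans (Finset.sum_le_sum fun b _ => ?_)
        rw [norm_smul, Real.norm_eq_abs, abs_of_pos (inv_pos.mpr hε)]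
        exact key_dip b
      · exact (norm_sum_le _ _).trans (Finset.sum_le_sum fun b _ => key_N b)
    have hC'' : ‖∑ b : HiggsLattice.PBond P 0, Φ (if Inside Ω b then 0 else srcMD C A B b u)‖ ≤ ∑ b : HiggsLattice.PBond P 0, Len b :=
      (norm_sum_le _ _).trans (Finset.sum_le_sum fun b _ => key_corr b)
    rw [Finset.sum_add_distrib] at hA''
    linarith [hA'', hC'']
  -- the legs are the two face sums
  have hlegs : (∑ b : HiggsLattice.PBond P 0, Lex b) + ∑ b : HiggsLattice.PBond P 0, Len b
      = (P.mesh 0)⁻¹ * (|C.e| * s) *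
          ((∑ b ∈ exB Ω A, pdcolO C Ω msq a k j₂ B B b₀ b.src * ‖u b.src‖)
            + ∑ b ∈ enB Ω A, pdcolO C Ω msq a k j₂ B B b₀ b.tgt * ‖u b.tgt‖) := by
    rw [hLex, hLen, sum_ite_mem_eq, sum_ite_mem_eq, mul_add, Finset.mul_sum, Finset.mul_sum]
  -- the two bulk sums
  have hbulkN : ∑ b : HiggsLattice.PBond P 0, pdcolO C Ω msq a k j₂ B B b₀ b.src * ((P.mesh 0)⁻¹ * (|C.e| * δA) * ‖u b.src‖)
      ≤ (P.d : ℝ) * ((P.mesh 0 ^ P.d * Cst) * ((P.mesh 0)⁻¹ * (|C.e| * δA) * cu) *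
            ((nCol N : ℝ) * (8 * P.d / δ₁) ^ P.d * (P.mesh 0 ^ P.d)⁻¹)) *
          (P.mesh j₂ ^ (1 : ℝ) * P.mesh j₁ ^ aw * (P.mesh (max j₂ j₁) ^ P.d)⁻¹) *
          Real.exp (-(δ₁ / 2 * (P.mesh (max j₂ j₁))⁻¹ * (P.mesh 0 * (HiggsLattice.Site.tdist b₀.src x' : ℝ)))) := by
    refine pair_bond_le hδ₁ hδ₁1 j₂ j₁ hc (mul_nonneg hN hcu) i₀ b₀.src x' _ _ (fun b => pdcolO_nonneg _ _ _ _)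
      (fun b => mul_nonneg hN (norm_nonneg _)) (fun b => hpd j₂ b₀ hb₀ b.src) (fun b => ?_)
    exact (mul_le_mul_of_nonneg_left (huv b.src) hN).trans (le_of_eq (by ring))
  have hbulkM : ∑ b : HiggsLattice.PBond P 0, FI b * (|C.e| * s * ‖u b.src‖)
      ≤ (P.d : ℝ) * ((P.mesh 0 ^ P.d * CM) * (|C.e| * s * cu) *
            ((nCol N : ℝ) * (8 * P.d / δ₁) ^ P.d * (P.mesh 0 ^ P.d)⁻¹)) *
          (P.mesh j₂ ^ (0 : ℝ) * P.mesh j₁ ^ aw * (P.mesh (max j₂ j₁) ^ P.d)⁻¹) *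
          Real.exp (-(δ₁ / 2 * (P.mesh (max j₂ j₁))⁻¹ * (P.mesh 0 * (HiggsLattice.Site.tdist b₀.src x' : ℝ)))) := by
    refine pair_bond_le hδ₁ hδ₁1 j₂ j₁ hcM (mul_nonneg hes hcu) i₀ b₀.src x' _ _ hFI0
      (fun b => mul_nonneg hes (norm_nonneg _)) (fun b => ?_) (fun b => ?_)
    · simp only [hFI]
      split_ifs with hb
      · exact hpm j₂ b₀ b hb₀ hb
      · exact bump_nonneg hcM j₂ _ _
    · exact (mul_le_mul_of_nonneg_left (huv b.src) hes).trans (le_of_eq (by ring))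
  rw [← hlegs]
  linarith [step1, hbulkN, hbulkM]

omit hmsq ha hL1 hk hkK hΩ in
/-- **PAIR BOUND 3 ON `Ω` — the `D^*M` sources of the bonds `⊂ Ω`, directly** (no legs): the torus right side of `B3Op116MixedSeed.dm_direct_le`.
[cite: Balaban1983Higgs3, (1.16) p.414, (2.6) p.424, (2.10) p.426] [cite: Balaban1982Higgs1, (3.16) p.615] -/
theorem dm_direct_le_box (hδ₁ : 0 < δ₁) (hδ₁1 : δ₁ ≤ 1) (hCM : 0 ≤ CM) (hs : 0 ≤ s)
    (hpm : ∀ (j : ℕ) (b₀ b : HiggsLattice.PBond P 0), Inside Ω b₀ → Inside Ω b →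
      pmixO C Ω msq a k j B B b₀ b ≤ (P.mesh 0 ^ P.d * CM) * P.mesh j ^ ((0 : ℝ) - (P.d : ℝ)) *
        Real.exp (-(δ₁ * (P.mesh j)⁻¹ * (P.mesh 0 * (HiggsLattice.Site.tdist b₀.src b.src : ℝ)))))
    (hA : ∀ b : HiggsLattice.PBond P 0, |A b| ≤ s) (i₀ : Ix N) {b₀ : HiggsLattice.PBond P 0} (hb₀ : Inside Ω b₀)
    (x' : HiggsLattice.Site P 0) (j₁ j₂ : ℕ) (u : ScalarField P 0 N) {aw cu : ℝ} (hcu : 0 ≤ cu)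
    (huv : ∀ y : HiggsLattice.Site P 0, ‖u y‖ ≤ cu * P.mesh j₁ ^ (aw - (P.d : ℝ)) *
      Real.exp (-(δ₁ * (P.mesh j₁)⁻¹ * (P.mesh 0 * (HiggsLattice.Site.tdist y x' : ℝ))))) :
    ‖covDeriv C B (pieceR C Ω B msq a k j₂
        ((P.mesh 0)⁻¹ • ∑ b : HiggsLattice.PBond P 0, if Inside Ω b then srcDM C A B b u else 0)) b₀‖
      ≤ (P.d : ℝ) * ((P.mesh 0 ^ P.d * CM) * (Real.exp 1 * (|C.e| * s * cu)) *
            ((nCol N : ℝ) * (8 * P.d / δ₁) ^ P.d * (P.mesh 0 ^ P.d)⁻¹)) *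
          (P.mesh j₂ ^ (0 : ℝ) * P.mesh j₁ ^ aw * (P.mesh (max j₂ j₁) ^ P.d)⁻¹) *
          Real.exp (-(δ₁ / 2 * (P.mesh (max j₂ j₁))⁻¹ * (P.mesh 0 * (HiggsLattice.Site.tdist b₀.src x' : ℝ)))) := by
  have hε := P.mesh_pos 0
  have hε0 : 0 ≤ (P.mesh 0)⁻¹ := inv_nonneg.mpr hε.le
  have hes : 0 ≤ |C.e| * s := mul_nonneg (abs_nonneg _) hs
  have hcM : 0 ≤ P.mesh 0 ^ P.d * CM := mul_nonneg (pow_nonneg hε.le _) hCM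
  set FI : HiggsLattice.PBond P 0 → ℝ := fun b => if Inside Ω b then pmixO C Ω msq a k j₂ B B b₀ b else 0 with hFI
  have hFI0 : ∀ b, 0 ≤ FI b := fun b => by simp only [hFI]; split_ifs; exacts [pmixO_nonneg _ _ _ _, le_rfl]
  have step1 : ‖covDeriv C B (pieceR C Ω B msq a k j₂
        ((P.mesh 0)⁻¹ • ∑ b : HiggsLattice.PBond P 0, if Inside Ω b then srcDM C A B b u else 0)) b₀‖
      ≤ ∑ b : HiggsLattice.PBond P 0, FI b * (|C.e| * s * ‖u b.tgt‖) := by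
    rw [map_smul, B3Ineq210RegularTorus.covDeriv_smul'', map_sum, B3Ineq210RegularTorus.covDeriv_sum'', norm_smul, Real.norm_eq_abs,
      abs_of_pos (inv_pos.mpr hε)]
    refine le_trans (mul_le_mul_of_nonneg_left (norm_sum_le _ _) hε0) ?_
    rw [Finset.mul_sum]
    refine Finset.sum_le_sum fun b _ => ?_
    by_cases hb : Inside Ω b
    · have hin : FI b = pmixO C Ω msq a k j₂ B B b₀ b := by simp only [hFI]; exact if_pos hb
      rw [if_pos hb, hin]
      have h := norm_mapE_srcDM_le C A B (covDerivAt C B b₀ ∘ₗ pieceR C Ω B msq a k j₂) (hA b) u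
      simp only [phiO_apply] at h
      refine (mul_le_mul_of_nonneg_left h hε0).trans (le_of_eq ?_)
      rw [pmixO]; ring
    · have hout : FI b = 0 := by simp only [hFI]; exact if_neg hb
      rw [if_neg hb, hout, map_zero, B3Ineq210RegularTorus.covDeriv_zero'', norm_zero, mul_zero, zero_mul]
  refine step1.trans ?_
  refine pair_bond_le hδ₁ hδ₁1 j₂ j₁ hcM (mul_nonneg (Real.exp_nonneg _) (mul_nonneg hes hcu)) i₀ b₀.src x' _ _ hFI0
    (fun b => mul_nonneg hes (norm_nonneg _)) (fun b => ?_) (fun b => ?_)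
  · simp only [hFI]
    split_ifs with hb
    · exact hpm j₂ b₀ b hb₀ hb
    · exact bump_nonneg hcM j₂ _ _
  · have hsh := bump_shift_le' hδ₁.le hδ₁1 j₁ b.src x' b.dir
    have hm : 0 ≤ |C.e| * s * (cu * P.mesh j₁ ^ (aw - (P.d : ℝ))) := mul_nonneg hes (mul_nonneg hcu (Real.rpow_nonneg (P.mesh_pos _).le _))
    calc |C.e| * s * ‖u b.tgt‖
        ≤ |C.e| * s * (cu * P.mesh j₁ ^ (aw - (P.d : ℝ)) *
            Real.exp (-(δ₁ * (P.mesh j₁)⁻¹ * (P.mesh 0 * (HiggsLattice.Site.tdist (b.src.shift b.dir) x' : ℝ))))) :=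
          mul_le_mul_of_nonneg_left (huv b.tgt) hes
      _ ≤ |C.e| * s * (cu * P.mesh j₁ ^ (aw - (P.d : ℝ))) *
            (Real.exp 1 * Real.exp (-(δ₁ * (P.mesh j₁)⁻¹ * (P.mesh 0 * (HiggsLattice.Site.tdist b.src x' : ℝ))))) := by
          rw [← mul_assoc]; exact mul_le_mul_of_nonneg_left hsh hm
      _ = _ := by ring

/-- **PAIR BOUND 4 ON `Ω` — the `D^*M` sources of the bonds `⊂ Ω` in Leibniz form** (THEOREM A′ on all bonds minus the bonds `⊄ Ω`): the
torus right side of `B3Op116MixedSeed.dm_parts_le` (the field's derivative at bonds `⊂ Ω`, the `N`-term on all bonds) PLUS THE SAME LEGS —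
exiting charged bonds (`F₁(A_b)(D^ε_Bu)(b)` with `(D^ε_Bu)(b) = −ε⁻¹u(b₋)`: `ε⁻¹|e|s·pdcolO(b₀,b₋)‖u(b₋)‖`) and entering charged bonds (the subtracted
`ε⁻¹srcDM_b u = ε⁻¹dip_b(M_bu(b₊))` loses its near end, `U(−B_b)M_b = F₁(A_b)`: `ε⁻¹|e|s·pdcolO(b₀,b₊)‖u(b₊)‖`).
[cite: Balaban1983Higgs3, (1.16) p.414, (2.6) p.424, (2.10) p.426, p.433] [cite: Balaban1982Higgs1, (2.23) p.610, (3.14) p.614, (3.16) p.615] -/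
theorem dm_parts_le_box (hδ₁ : 0 < δ₁) (hδ₁1 : δ₁ ≤ 1) (hCst : 0 ≤ Cst) (hs : 0 ≤ s) (hδA : 0 ≤ δA)
    (hpd : ∀ (j : ℕ) (b : HiggsLattice.PBond P 0), Inside Ω b → ∀ y : HiggsLattice.Site P 0,
      pdcolO C Ω msq a k j B B b y ≤ (P.mesh 0 ^ P.d * Cst) * P.mesh j ^ ((1 : ℝ) - (P.d : ℝ)) *
        Real.exp (-(δ₁ * (P.mesh j)⁻¹ * (P.mesh 0 * (HiggsLattice.Site.tdist b.src y : ℝ)))))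
    (hA : ∀ b : HiggsLattice.PBond P 0, |A b| ≤ s)
    (hreg : ∀ (z : HiggsLattice.Site P 0) (μ ν : Fin P.d), |A ⟨z.shift ν, μ⟩ - A ⟨z, μ⟩| ≤ δA)
    (i₀ : Ix N) {b₀ : HiggsLattice.PBond P 0} (hb₀ : Inside Ω b₀) (x' : HiggsLattice.Site P 0) (j₁ j₂ : ℕ) (u : ScalarField P 0 N)
    (hu0 : ∀ y : HiggsLattice.Site P 0, y ∉ Ω → u y = 0) {aw cu cu' : ℝ} (hcu : 0 ≤ cu) (hcu' : 0 ≤ cu')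
    (huv : ∀ y : HiggsLattice.Site P 0, ‖u y‖ ≤ cu * P.mesh j₁ ^ (aw - (P.d : ℝ)) *
      Real.exp (-(δ₁ * (P.mesh j₁)⁻¹ * (P.mesh 0 * (HiggsLattice.Site.tdist y x' : ℝ)))))
    (hud : ∀ b : HiggsLattice.PBond P 0, Inside Ω b → ‖covDeriv C B u b‖ ≤ cu' * P.mesh j₁ ^ (aw - 1 - (P.d : ℝ)) *
      Real.exp (-(δ₁ * (P.mesh j₁)⁻¹ * (P.mesh 0 * (HiggsLattice.Site.tdist b.src x' : ℝ))))) :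
    ‖covDeriv C B (pieceR C Ω B msq a k j₂
        ((P.mesh 0)⁻¹ • ∑ b : HiggsLattice.PBond P 0, if Inside Ω b then srcDM C A B b u else 0)) b₀‖
      ≤ (P.d : ℝ) * ((P.mesh 0 ^ P.d * Cst) * ((P.mesh 0)⁻¹ * (|C.e| * δA) * cu) *
            ((nCol N : ℝ) * (8 * P.d / δ₁) ^ P.d * (P.mesh 0 ^ P.d)⁻¹)) *
          (P.mesh j₂ ^ (1 : ℝ) * P.mesh j₁ ^ aw * (P.mesh (max j₂ j₁) ^ P.d)⁻¹) *
          Real.exp (-(δ₁ / 2 * (P.mesh (max j₂ j₁))⁻¹ * (P.mesh 0 * (HiggsLattice.Site.tdist b₀.src x' : ℝ))))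
        + (P.d : ℝ) * ((P.mesh 0 ^ P.d * Cst) * (|C.e| * s * cu') *
            ((nCol N : ℝ) * (8 * P.d / δ₁) ^ P.d * (P.mesh 0 ^ P.d)⁻¹)) *
          (P.mesh j₂ ^ (1 : ℝ) * P.mesh j₁ ^ (aw - 1) * (P.mesh (max j₂ j₁) ^ P.d)⁻¹) *
          Real.exp (-(δ₁ / 2 * (P.mesh (max j₂ j₁))⁻¹ * (P.mesh 0 * (HiggsLattice.Site.tdist b₀.src x' : ℝ))))
        + (P.mesh 0)⁻¹ * (|C.e| * s) *
          ((∑ b ∈ exB Ω A, pdcolO C Ω msq a k j₂ B B b₀ b.src * ‖u b.src‖)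
            + ∑ b ∈ enB Ω A, pdcolO C Ω msq a k j₂ B B b₀ b.tgt * ‖u b.tgt‖) := by
  classical
  have hε := P.mesh_pos 0
  have hε0 : 0 ≤ (P.mesh 0)⁻¹ := inv_nonneg.mpr hε.le
  have hes : 0 ≤ |C.e| * s := mul_nonneg (abs_nonneg _) hs
  have hN : 0 ≤ (P.mesh 0)⁻¹ * (|C.e| * δA) := mul_nonneg hε0 (mul_nonneg (abs_nonneg _) hδA)
  have hc : 0 ≤ P.mesh 0 ^ P.d * Cst := mul_nonneg (pow_nonneg hε.le _) hCst
  have hles : (P.mesh 0)⁻¹ * (|C.e| * s) ≥ 0 := mul_nonneg hε0 hes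
  -- abbreviations
  set Φ : ScalarField P 0 N → E N := fun f => covDeriv C B (pieceR C Ω B msq a k j₂ f) b₀ with hΦ
  set GI : HiggsLattice.PBond P 0 → ℝ := fun b => if Inside Ω b then |C.e| * s * ‖covDeriv C B u b‖ else 0 with hGI
  set Lex : HiggsLattice.PBond P 0 → ℝ := fun b =>
    if b ∈ exB Ω A then (P.mesh 0)⁻¹ * (|C.e| * s) * (pdcolO C Ω msq a k j₂ B B b₀ b.src * ‖u b.src‖) else 0 with hLex
  set Len : HiggsLattice.PBond P 0 → ℝ := fun b =>
    if b ∈ enB Ω A then (P.mesh 0)⁻¹ * (|C.e| * s) * (pdcolO C Ω msq a k j₂ B B b₀ b.tgt * ‖u b.tgt‖) else 0 with hLen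
  have hGI0 : ∀ b, 0 ≤ GI b := fun b => by simp only [hGI]; split_ifs; exacts [mul_nonneg hes (norm_nonneg _), le_rfl]
  have hLex0 : ∀ b, 0 ≤ Lex b := fun b => by
    simp only [hLex]; split_ifs; exacts [mul_nonneg hles (mul_nonneg (pdcolO_nonneg _ _ _ _) (norm_nonneg _)), le_rfl]
  have hLen0 : ∀ b, 0 ≤ Len b := fun b => by
    simp only [hLen]; split_ifs; exacts [mul_nonneg hles (mul_nonneg (pdcolO_nonneg _ _ _ _) (norm_nonneg _)), le_rfl]
  -- THEOREM A′, bond by bond: the `N`-term everywhere, the derivative term on bonds `⊂ Ω`, a leg on `exB`, nothing at `b₋ ∉ Ω`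
  have key_A : ∀ b : HiggsLattice.PBond P 0,
      ‖Φ (Pi.single b.src (nMul C A b (u b.src) - fOne C (P.mesh 0) (A b) (covDeriv C B u b)))‖
        ≤ pdcolO C Ω msq a k j₂ B B b₀ b.src * ((P.mesh 0)⁻¹ * (|C.e| * δA) * ‖u b.src‖)
          + pdcolO C Ω msq a k j₂ B B b₀ b.src * GI b + Lex b := by
    intro b
    have hpd0 := pdcolO_nonneg (C := C) (Ω := Ω) (msq := msq) (a := a) (k := k) (j := j₂) B B b₀ b.src
    by_cases hbs : b.src ∈ Ω
    · rw [hΦ]; simp only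
      refine (norm_phiO_single_le B B j₂ b₀ b.src _).trans ?_
      have hn := norm_nMul_apply_le C A hreg b (u b.src)
      by_cases hb : Inside Ω b
      · have hin : GI b = |C.e| * s * ‖covDeriv C B u b‖ := by simp only [hGI]; exact if_pos hb
        rw [hin]
        refine le_add_of_le_of_nonneg ?_ (hLex0 b)
        rw [← mul_add, mul_comm]
        exact mul_le_mul_of_nonneg_left ((norm_sub_le _ _).trans (add_le_add hn (norm_fOne_apply_le_of_abs_le (hA b) _))) hpd0
      · have hbt : b.tgt ∉ Ω := fun h => hb ⟨hbs, h⟩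
        have hout : GI b = 0 := by simp only [hGI]; exact if_neg hb
        rw [hout, mul_zero, add_zero]
        have hD : ‖covDeriv C B u b‖ = (P.mesh 0)⁻¹ * ‖u b.src‖ := norm_covDeriv_of_tgt_eq_zero C B u (hu0 _ hbt)
        by_cases hAb : A b = 0
        · have h0 : fOne C (P.mesh 0) (A b) (covDeriv C B u b) = 0 := by rw [hAb, fOne_zero_arg]
          rw [h0, sub_zero]
          refine le_add_of_le_of_nonneg ?_ (hLex0 b)
          rw [mul_comm]
          exact mul_le_mul_of_nonneg_left hn hpd0
        · have hex : b ∈ exB Ω A := mem_exB.2 ⟨hbs, hbt, Or.inl hAb⟩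
          have hl : Lex b = (P.mesh 0)⁻¹ * (|C.e| * s) * (pdcolO C Ω msq a k j₂ B B b₀ b.src * ‖u b.src‖) := by
            simp only [hLex]; exact if_pos hex
          rw [hl]
          have hf : ‖fOne C (P.mesh 0) (A b) (covDeriv C B u b)‖ ≤ |C.e| * s * ((P.mesh 0)⁻¹ * ‖u b.src‖) := by
            rw [← hD]; exact norm_fOne_apply_le_of_abs_le (hA b) _
          calc ‖nMul C A b (u b.src) - fOne C (P.mesh 0) (A b) (covDeriv C B u b)‖ * pdcolO C Ω msq a k j₂ B B b₀ b.src
              ≤ ((P.mesh 0)⁻¹ * (|C.e| * δA) * ‖u b.src‖ + |C.e| * s * ((P.mesh 0)⁻¹ * ‖u b.src‖)) *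
                  pdcolO C Ω msq a k j₂ B B b₀ b.src :=
                mul_le_mul_of_nonneg_right ((norm_sub_le _ _).trans (add_le_add hn hf)) hpd0
            _ = _ := by ring
    · rw [hΦ]; simp only
      rw [covDeriv_pieceR_single_eq_zero C Ω B hmsq ha hL1 hkK hΩ hk B j₂ hbs _ hb₀, norm_zero]
      exact add_nonneg (add_nonneg (mul_nonneg hpd0 (mul_nonneg hN (norm_nonneg _))) (mul_nonneg hpd0 (hGI0 b))) (hLex0 b)
  -- the subtracted bonds `⊄ Ω`, bond by bond: a leg on `enB`, nothing elsewhere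
  have key_corr : ∀ b : HiggsLattice.PBond P 0, (P.mesh 0)⁻¹ * ‖Φ (if Inside Ω b then 0 else srcDM C A B b u)‖ ≤ Len b := by
    intro b
    by_cases hb : Inside Ω b
    · rw [if_pos hb, hΦ]; simp only
      rw [map_zero, B3Ineq210RegularTorus.covDeriv_zero'', norm_zero, mul_zero]; exact hLen0 b
    · rw [if_neg hb]
      by_cases hbt : b.tgt ∈ Ω
      · have hbs : b.src ∉ Ω := fun h => hb ⟨h, hbt⟩
        by_cases hAb : A b = 0
        · rw [srcDM_eq_zero C A B hAb, hΦ]; simp only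
          rw [map_zero, B3Ineq210RegularTorus.covDeriv_zero'', norm_zero, mul_zero]; exact hLen0 b
        · have hen : b ∈ enB Ω A := mem_enB.2 ⟨hbs, hbt, hAb⟩
          have hl : Len b = (P.mesh 0)⁻¹ * (|C.e| * s) * (pdcolO C Ω msq a k j₂ B B b₀ b.tgt * ‖u b.tgt‖) := by
            simp only [hLen]; exact if_pos hen
          rw [hl, hΦ]; simp only
          rw [srcDM, phiO_dip_of_src_not_mem hmsq ha hL1 hk hkK hΩ B B j₂ hb₀ hbs, U_neg_mulM_apply]
          calc (P.mesh 0)⁻¹ * ‖covDeriv C B (pieceR C Ω B msq a k j₂ (Pi.single b.tgt (fOne C (P.mesh 0) (A b) (u b.tgt)))) b₀‖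
              ≤ (P.mesh 0)⁻¹ * (‖fOne C (P.mesh 0) (A b) (u b.tgt)‖ * pdcolO C Ω msq a k j₂ B B b₀ b.tgt) :=
                mul_le_mul_of_nonneg_left (norm_phiO_single_le B B j₂ b₀ b.tgt _) hε0
            _ ≤ (P.mesh 0)⁻¹ * ((|C.e| * s * ‖u b.tgt‖) * pdcolO C Ω msq a k j₂ B B b₀ b.tgt) :=
                mul_le_mul_of_nonneg_left (mul_le_mul_of_nonneg_right (norm_fOne_apply_le_of_abs_le (hA b) _) (pdcolO_nonneg _ _ _ _))
                  hε0
            _ = _ := by ring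
      · rw [srcDM, hu0 _ hbt, map_zero, dip_zero, hΦ]; simp only
        rw [map_zero, B3Ineq210RegularTorus.covDeriv_zero'', norm_zero, mul_zero]; exact hLen0 b
  -- THEOREM A′ and the resulting bond sums
  have step1 : ‖covDeriv C B (pieceR C Ω B msq a k j₂
        ((P.mesh 0)⁻¹ • ∑ b : HiggsLattice.PBond P 0, if Inside Ω b then srcDM C A B b u else 0)) b₀‖
      ≤ (∑ b : HiggsLattice.PBond P 0, pdcolO C Ω msq a k j₂ B B b₀ b.src * ((P.mesh 0)⁻¹ * (|C.e| * δA) * ‖u b.src‖))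
        + (∑ b : HiggsLattice.PBond P 0, pdcolO C Ω msq a k j₂ B B b₀ b.src * GI b)
        + ((∑ b : HiggsLattice.PBond P 0, Lex b) + ∑ b : HiggsLattice.PBond P 0, Len b) := by
    rw [sum_ite_inside_eq_sub, smul_sub, ← phiO_apply, map_sub, inv_smul_sum_srcDM_eq, map_sum, map_smul, map_sum, Finset.smul_sum]
    simp only [phiO_apply]
    refine (norm_sub_le _ _).trans ?_
    have hA' : ‖∑ b : HiggsLattice.PBond P 0, Φ (Pi.single b.src (nMul C A b (u b.src) - fOne C (P.mesh 0) (A b) (covDeriv C B u b)))‖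
        ≤ ∑ b : HiggsLattice.PBond P 0, (pdcolO C Ω msq a k j₂ B B b₀ b.src * ((P.mesh 0)⁻¹ * (|C.e| * δA) * ‖u b.src‖)
          + pdcolO C Ω msq a k j₂ B B b₀ b.src * GI b + Lex b) :=
      (norm_sum_le _ _).trans (Finset.sum_le_sum fun b _ => key_A b)
    have hC' : ‖∑ b : HiggsLattice.PBond P 0, (P.mesh 0)⁻¹ • Φ (if Inside Ω b then 0 else srcDM C A B b u)‖
        ≤ ∑ b : HiggsLattice.PBond P 0, Len b := by
      refine (norm_sum_le _ _).trans (Finset.sum_le_sum fun b _ => ?_)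
      rw [norm_smul, Real.norm_eq_abs, abs_of_pos (inv_pos.mpr hε)]
      exact key_corr b
    rw [Finset.sum_add_distrib, Finset.sum_add_distrib] at hA'
    linarith [hA', hC']
  have hlegs : (∑ b : HiggsLattice.PBond P 0, Lex b) + ∑ b : HiggsLattice.PBond P 0, Len b
      = (P.mesh 0)⁻¹ * (|C.e| * s) *
          ((∑ b ∈ exB Ω A, pdcolO C Ω msq a k j₂ B B b₀ b.src * ‖u b.src‖)
            + ∑ b ∈ enB Ω A, pdcolO C Ω msq a k j₂ B B b₀ b.tgt * ‖u b.tgt‖) := by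
    rw [hLex, hLen, sum_ite_mem_eq, sum_ite_mem_eq, mul_add, Finset.mul_sum, Finset.mul_sum]
  have hbulkN : ∑ b : HiggsLattice.PBond P 0, pdcolO C Ω msq a k j₂ B B b₀ b.src * ((P.mesh 0)⁻¹ * (|C.e| * δA) * ‖u b.src‖)
      ≤ (P.d : ℝ) * ((P.mesh 0 ^ P.d * Cst) * ((P.mesh 0)⁻¹ * (|C.e| * δA) * cu) *
            ((nCol N : ℝ) * (8 * P.d / δ₁) ^ P.d * (P.mesh 0 ^ P.d)⁻¹)) *
          (P.mesh j₂ ^ (1 : ℝ) * P.mesh j₁ ^ aw * (P.mesh (max j₂ j₁) ^ P.d)⁻¹) *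
          Real.exp (-(δ₁ / 2 * (P.mesh (max j₂ j₁))⁻¹ * (P.mesh 0 * (HiggsLattice.Site.tdist b₀.src x' : ℝ)))) := by
    refine pair_bond_le hδ₁ hδ₁1 j₂ j₁ hc (mul_nonneg hN hcu) i₀ b₀.src x' _ _ (fun b => pdcolO_nonneg _ _ _ _)
      (fun b => mul_nonneg hN (norm_nonneg _)) (fun b => hpd j₂ b₀ hb₀ b.src) (fun b => ?_)
    exact (mul_le_mul_of_nonneg_left (huv b.src) hN).trans (le_of_eq (by ring))
  have hbulkD : ∑ b : HiggsLattice.PBond P 0, pdcolO C Ω msq a k j₂ B B b₀ b.src * GI b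
      ≤ (P.d : ℝ) * ((P.mesh 0 ^ P.d * Cst) * (|C.e| * s * cu') *
            ((nCol N : ℝ) * (8 * P.d / δ₁) ^ P.d * (P.mesh 0 ^ P.d)⁻¹)) *
          (P.mesh j₂ ^ (1 : ℝ) * P.mesh j₁ ^ (aw - 1) * (P.mesh (max j₂ j₁) ^ P.d)⁻¹) *
          Real.exp (-(δ₁ / 2 * (P.mesh (max j₂ j₁))⁻¹ * (P.mesh 0 * (HiggsLattice.Site.tdist b₀.src x' : ℝ)))) := by
    refine pair_bond_le hδ₁ hδ₁1 j₂ j₁ hc (mul_nonneg hes hcu') i₀ b₀.src x' _ _ (fun b => pdcolO_nonneg _ _ _ _) hGI0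
      (fun b => hpd j₂ b₀ hb₀ b.src) (fun b => ?_)
    simp only [hGI]
    split_ifs with hb
    · exact (mul_le_mul_of_nonneg_left (hud b hb) hes).trans (le_of_eq (by ring))
    · exact bump_nonneg (mul_nonneg hes hcu') j₁ _ _
  rw [← hlegs]
  linarith [step1, hbulkN, hbulkD]

end Pairs

/-! ## §4 THE SCALE-PAIR SUMS ON `Ω`: each pair filed under its coarser index (torus bookkeeping), the legs summed over all pairs -/

section PairSums

variable {C : ChargeData N} {Ω : Finset (HiggsLattice.Site P 0)} {A B : HiggsLattice.VecField P 0} {msq a : ℝ} {k : ℕ}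
  {δ₁ Cst CM s δA : ℝ}

/-- `Σ_yΣ_xΣ_{b∈S}p_y(b)v_x(b) = Σ_{b∈S}(Σ_yp_y(b))(Σ_xv_x(b))`. [folklore] -/
private theorem sum_sum_mul_eq {ι : Type*} (S : Finset ι) (k : ℕ) (p v : ℕ → ι → ℝ) :
    ∑ y ∈ Finset.range k, ∑ x ∈ Finset.range k, ∑ b ∈ S, p y b * v x b
      = ∑ b ∈ S, (∑ y ∈ Finset.range k, p y b) * (∑ x ∈ Finset.range k, v x b) := by
  symm
  calc ∑ b ∈ S, (∑ y ∈ Finset.range k, p y b) * (∑ x ∈ Finset.range k, v x b)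
      = ∑ b ∈ S, ∑ y ∈ Finset.range k, ∑ x ∈ Finset.range k, p y b * v x b :=
        Finset.sum_congr rfl fun b _ => Finset.sum_mul_sum _ _ _ _
    _ = ∑ y ∈ Finset.range k, ∑ b ∈ S, ∑ x ∈ Finset.range k, p y b * v x b := Finset.sum_comm
    _ = _ := Finset.sum_congr rfl fun y _ => Finset.sum_comm

/-- `Σ_yΣ_xΣ_{b∈S}p_x(b)v_y(b) = Σ_{b∈S}(Σ_xp_x(b))(Σ_yv_y(b))`. [folklore] -/
private theorem sum_sum_mul_eq' {ι : Type*} (S : Finset ι) (k : ℕ) (p v : ℕ → ι → ℝ) :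
    ∑ y ∈ Finset.range k, ∑ x ∈ Finset.range k, ∑ b ∈ S, p x b * v y b
      = ∑ b ∈ S, (∑ x ∈ Finset.range k, p x b) * (∑ y ∈ Finset.range k, v y b) := by
  rw [Finset.sum_comm, sum_sum_mul_eq]

variable (hmsq : 0 < msq) (ha : 0 < a) (hL1 : 1 < P.L) (hk : 1 ≤ k) (hkK : k ≤ P.K)
  (hΩ : ∀ l, l ≤ k → ∀ x x' : HiggsLattice.Site P 0, blockIter l x = blockIter l x' → (x ∈ Ω ↔ x' ∈ Ω))
include hmsq ha hL1 hk hkK hΩ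

/-- **THE `M^*D` SOURCES (bonds `⊂ Ω`) OF A MULTI-SCALE `Ω`-SUPPORTED FIELD THROUGH `D^ε_BG_k(Ω,B)` at `b₀ ⊂ Ω`, summed over all scale pairs**:
the torus right side of `B3Op116MixedSeed.md_sum_le` PLUS the legs summed over all pairs — `ε⁻¹|e|s·[Σ_{b∈exB}κ^D(b₀,b₋)N_w(b₋) +
Σ_{b∈enB}κ^D(b₀,b₊)N_w(b₊)]` with `κ^D(b₀,z) = Σ_{i<k}pdcolO_i(b₀,z)` (the piecewise differentiated column) and `N_w(z) = Σ_{j<k}‖w_j(z)‖`.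
[cite: Balaban1983Higgs3, (1.16) p.414, (2.6) p.424, (2.10) p.426, p.433] [cite: Balaban1982Higgs1, (3.16) p.615] -/
theorem md_sum_le_box (hδ₁ : 0 < δ₁) (hδ₁1 : δ₁ ≤ 1) (hCst : 0 ≤ Cst) (hCM : 0 ≤ CM) (hs : 0 ≤ s) (hδA : 0 ≤ δA)
    (hpd : ∀ (j : ℕ) (b : HiggsLattice.PBond P 0), Inside Ω b → ∀ y : HiggsLattice.Site P 0,
      pdcolO C Ω msq a k j B B b y ≤ (P.mesh 0 ^ P.d * Cst) * P.mesh j ^ ((1 : ℝ) - (P.d : ℝ)) *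
        Real.exp (-(δ₁ * (P.mesh j)⁻¹ * (P.mesh 0 * (HiggsLattice.Site.tdist b.src y : ℝ)))))
    (hpm : ∀ (j : ℕ) (b₀ b : HiggsLattice.PBond P 0), Inside Ω b₀ → Inside Ω b →
      pmixO C Ω msq a k j B B b₀ b ≤ (P.mesh 0 ^ P.d * CM) * P.mesh j ^ ((0 : ℝ) - (P.d : ℝ)) *
        Real.exp (-(δ₁ * (P.mesh j)⁻¹ * (P.mesh 0 * (HiggsLattice.Site.tdist b₀.src b.src : ℝ)))))
    (hA : ∀ b : HiggsLattice.PBond P 0, |A b| ≤ s)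
    (hreg : ∀ (z : HiggsLattice.Site P 0) (μ ν : Fin P.d), |A ⟨z.shift ν, μ⟩ - A ⟨z, μ⟩| ≤ δA)
    (i₀ : Ix N) {b₀ : HiggsLattice.PBond P 0} (hb₀ : Inside Ω b₀) (x' : HiggsLattice.Site P 0)
    (w : ScalarField P 0 N) (wp : ℕ → ScalarField P 0 N) (hw : ∑ j ∈ Finset.range k, wp j = w)
    (hw0 : ∀ (j : ℕ) (y : HiggsLattice.Site P 0), y ∉ Ω → wp j y = 0) {aw cw cw' : ℝ} (haw : 0 < aw) (hcw : 0 ≤ cw) (hcw' : 0 ≤ cw')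
    (hwv : ∀ (j : ℕ) (y : HiggsLattice.Site P 0), ‖wp j y‖ ≤ cw * P.mesh j ^ (aw - (P.d : ℝ)) *
      Real.exp (-(δ₁ * (P.mesh j)⁻¹ * (P.mesh 0 * (HiggsLattice.Site.tdist y x' : ℝ)))))
    (hwd : ∀ (j : ℕ) (b : HiggsLattice.PBond P 0), Inside Ω b → ‖covDeriv C B (wp j) b‖ ≤ cw' * P.mesh j ^ (aw - 1 - (P.d : ℝ)) *
      Real.exp (-(δ₁ * (P.mesh j)⁻¹ * (P.mesh 0 * (HiggsLattice.Site.tdist b.src x' : ℝ))))) :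
    ‖covDeriv C B (propagatorK C Ω B msq a k (∑ b : HiggsLattice.PBond P 0, if Inside Ω b then srcMD C A B b w else 0)) b₀‖
      ≤ ((P.L : ℝ) ^ (1 : ℝ) / ((P.L : ℝ) ^ (1 : ℝ) - 1) *
            ((P.d : ℝ) * ((Real.exp 1 * (P.mesh 0 ^ P.d * Cst)) * (|C.e| * s * cw') *
              ((nCol N : ℝ) * (8 * P.d / δ₁) ^ P.d * (P.mesh 0 ^ P.d)⁻¹)))
          + (P.L : ℝ) ^ aw / ((P.L : ℝ) ^ aw - 1) *
            ((P.d : ℝ) * ((P.mesh 0 ^ P.d * CM) * (|C.e| * s * cw) *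
              ((nCol N : ℝ) * (8 * P.d / δ₁) ^ P.d * (P.mesh 0 ^ P.d)⁻¹)))) *
          ∑ j ∈ Finset.range k, P.mesh j ^ (aw - (P.d : ℝ)) *
            Real.exp (-(δ₁ / 2 * (P.mesh j)⁻¹ * (P.mesh 0 * (HiggsLattice.Site.tdist b₀.src x' : ℝ))))
        + (P.L : ℝ) ^ aw / ((P.L : ℝ) ^ aw - 1) *
            ((P.d : ℝ) * ((P.mesh 0 ^ P.d * Cst) * ((P.mesh 0)⁻¹ * (|C.e| * δA) * cw) *
              ((nCol N : ℝ) * (8 * P.d / δ₁) ^ P.d * (P.mesh 0 ^ P.d)⁻¹))) *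
          ∑ j ∈ Finset.range k, P.mesh j ^ (aw + 1 - (P.d : ℝ)) *
            Real.exp (-(δ₁ / 2 * (P.mesh j)⁻¹ * (P.mesh 0 * (HiggsLattice.Site.tdist b₀.src x' : ℝ))))
        + (P.mesh 0)⁻¹ * (|C.e| * s) *
          ((∑ b ∈ exB Ω A, (∑ i ∈ Finset.range k, pdcolO C Ω msq a k i B B b₀ b.src) * (∑ j ∈ Finset.range k, ‖wp j b.src‖))
            + ∑ b ∈ enB Ω A, (∑ i ∈ Finset.range k, pdcolO C Ω msq a k i B B b₀ b.tgt) * (∑ j ∈ Finset.range k, ‖wp j b.tgt‖)) := by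
  have hL1' : (1 : ℝ) < (P.L : ℝ) := by exact_mod_cast hL1
  have hε := P.mesh_pos 0
  have hles : 0 ≤ (P.mesh 0)⁻¹ * (|C.e| * s) := mul_nonneg (inv_nonneg.mpr hε.le) (mul_nonneg (abs_nonneg _) hs)
  -- names for the constants and the bumps
  set K' : ℝ := (nCol N : ℝ) * (8 * P.d / δ₁) ^ P.d * (P.mesh 0 ^ P.d)⁻¹ with hK'
  set KA : ℝ := (P.d : ℝ) * ((Real.exp 1 * (P.mesh 0 ^ P.d * Cst)) * (|C.e| * s * cw') * K') with hKA
  set KB1 : ℝ := (P.d : ℝ) * ((P.mesh 0 ^ P.d * Cst) * ((P.mesh 0)⁻¹ * (|C.e| * δA) * cw) * K') with hKB1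
  set KB2 : ℝ := (P.d : ℝ) * ((P.mesh 0 ^ P.d * CM) * (|C.e| * s * cw) * K') with hKB2
  have hKA0 : 0 ≤ KA := by rw [hKA, hK']; positivity
  have hKB10 : 0 ≤ KB1 := by rw [hKB1, hK']; positivity
  have hKB20 : 0 ≤ KB2 := by rw [hKB2, hK']; positivity
  set E2 : ℕ → ℝ := fun j => Real.exp (-(δ₁ / 2 * (P.mesh j)⁻¹ * (P.mesh 0 * (HiggsLattice.Site.tdist b₀.src x' : ℝ)))) with hE2
  have hE20 : ∀ j, 0 ≤ E2 j := fun j => Real.exp_nonneg _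
  set G1 : ℝ := (P.L : ℝ) ^ (1 : ℝ) / ((P.L : ℝ) ^ (1 : ℝ) - 1) with hG1
  set Ga : ℝ := (P.L : ℝ) ^ aw / ((P.L : ℝ) ^ aw - 1) with hGa
  have hGa0 : 0 ≤ Ga := by
    have := Real.one_lt_rpow hL1' haw; rw [hGa]; exact div_nonneg (by linarith) (by linarith)
  have hm : ∀ j (e : ℝ), 0 ≤ P.mesh j ^ e := fun j e => Real.rpow_nonneg (P.mesh_pos j).le e
  have hmi : ∀ j, 0 ≤ (P.mesh j ^ P.d)⁻¹ := fun j => inv_nonneg.mpr (pow_nonneg (P.mesh_pos j).le _)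
  -- the legs of one pair and of all pairs
  set Leg : ℕ → ℕ → ℝ := fun j₁ j₂ => (P.mesh 0)⁻¹ * (|C.e| * s) *
    ((∑ b ∈ exB Ω A, pdcolO C Ω msq a k j₂ B B b₀ b.src * ‖wp j₁ b.src‖)
      + ∑ b ∈ enB Ω A, pdcolO C Ω msq a k j₂ B B b₀ b.tgt * ‖wp j₁ b.tgt‖) with hLeg
  set LEG : ℝ := (P.mesh 0)⁻¹ * (|C.e| * s) *
    ((∑ b ∈ exB Ω A, (∑ i ∈ Finset.range k, pdcolO C Ω msq a k i B B b₀ b.src) * (∑ j ∈ Finset.range k, ‖wp j b.src‖))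
      + ∑ b ∈ enB Ω A, (∑ i ∈ Finset.range k, pdcolO C Ω msq a k i B B b₀ b.tgt) * (∑ j ∈ Finset.range k, ‖wp j b.tgt‖)) with hLEG
  have hLeg0 : ∀ j₁ j₂, 0 ≤ Leg j₁ j₂ := fun j₁ j₂ => by
    rw [hLeg]
    exact mul_nonneg hles (add_nonneg (Finset.sum_nonneg fun b _ => mul_nonneg (pdcolO_nonneg _ _ _ _) (norm_nonneg _))
      (Finset.sum_nonneg fun b _ => mul_nonneg (pdcolO_nonneg _ _ _ _) (norm_nonneg _)))
  have hLegsum : ∑ j₂ ∈ Finset.range k, ∑ j₁ ∈ Finset.range k, Leg j₁ j₂ = LEG := by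
    rw [hLEG, ← sum_sum_mul_eq, ← sum_sum_mul_eq, ← Finset.sum_add_distrib, Finset.mul_sum]
    refine Finset.sum_congr rfl fun j₂ _ => ?_
    rw [← Finset.sum_add_distrib, Finset.mul_sum]
  -- the double sum over the pieces
  set T : ℕ → ℕ → ℝ := fun j₁ j₂ =>
    ‖covDeriv C B (pieceR C Ω B msq a k j₂ (∑ b : HiggsLattice.PBond P 0, if Inside Ω b then srcMD C A B b (wp j₁) else 0)) b₀‖ with hT
  have step1 : ‖covDeriv C B (propagatorK C Ω B msq a k (∑ b : HiggsLattice.PBond P 0, if Inside Ω b then srcMD C A B b w else 0)) b₀‖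
      ≤ ∑ j₁ ∈ Finset.range k, ∑ j₂ ∈ Finset.range k, T j₁ j₂ := by
    have hsrc : (∑ b : HiggsLattice.PBond P 0, if Inside Ω b then srcMD C A B b w else 0)
        = ∑ j₁ ∈ Finset.range k, ∑ b : HiggsLattice.PBond P 0, (if Inside Ω b then srcMD C A B b (wp j₁) else 0) := by
      rw [Finset.sum_comm]
      refine Finset.sum_congr rfl fun b _ => ?_
      split_ifs
      · rw [← hw]; exact srcMD_sum C A B _ _ b
      · simp
    rw [hsrc, map_sum, B3Ineq210RegularTorus.covDeriv_sum'']
    refine (norm_sum_le _ _).trans (Finset.sum_le_sum fun j₁ _ => ?_)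
    rw [covDeriv_propagatorK_eq_sum_piecesR C msq a k B B hmsq ha hL1 hk hkK]
    rw [hT]
    exact norm_sum_le (Finset.range k)
      (fun j₂ => covDeriv C B (pieceR C Ω B msq a k j₂ (∑ b : HiggsLattice.PBond P 0, if Inside Ω b then srcMD C A B b (wp j₁) else 0)) b₀)
  -- the two cases
  set gA : ℕ → ℝ := fun j₁ => KA * (P.mesh j₁ ^ (aw - 1) * (P.mesh j₁ ^ P.d)⁻¹) * E2 j₁ with hgA
  set gB : ℕ → ℝ := fun j₂ => (KB1 * (P.mesh j₂ ^ (1 : ℝ) * (P.mesh j₂ ^ P.d)⁻¹) + KB2 * (P.mesh j₂ ^ (0 : ℝ) * (P.mesh j₂ ^ P.d)⁻¹))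
    * E2 j₂ with hgB
  have hgA0 : ∀ j, 0 ≤ gA j := fun j => by
    rw [hgA]; exact mul_nonneg (mul_nonneg hKA0 (mul_nonneg (hm j _) (hmi j))) (hE20 j)
  have hgB0 : ∀ j, 0 ≤ gB j := fun j => by
    rw [hgB]
    exact mul_nonneg (add_nonneg (mul_nonneg hKB10 (mul_nonneg (hm j _) (hmi j))) (mul_nonneg hKB20 (mul_nonneg (hm j _) (hmi j))))
      (hE20 j)
  have hle : ∀ j₁ j₂, j₂ ≤ j₁ → T j₁ j₂ ≤ P.mesh j₂ ^ (1 : ℝ) * gA j₁ := by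
    intro j₁ j₂ hj
    have h := md_direct_le_box hδ₁ hδ₁1 hCst hs hpd hA i₀ hb₀ x' j₁ j₂ (wp j₁) hcw' (hwd j₁)
    rw [max_eq_right hj] at h
    refine h.trans (le_of_eq ?_)
    rw [hgA, hKA, hE2]; ring
  have hlt : ∀ j₁ j₂, j₁ < j₂ → T j₁ j₂ ≤ P.mesh j₁ ^ aw * gB j₂ + Leg j₁ j₂ := by
    intro j₁ j₂ hj
    have h := md_parts_le_box hmsq ha hL1 hk hkK hΩ hδ₁ hδ₁1 hCst hCM hs hδA hpd hpm hA hreg i₀ hb₀ x' j₁ j₂ (wp j₁) (hw0 j₁) hcw (hwv j₁)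
    rw [max_eq_left hj.le] at h
    refine h.trans (le_of_eq ?_)
    rw [hgB, hKB1, hKB2, hE2]; ring
  have step2 := sum_sq_le_of_cases k T (fun j₁ j₂ => P.mesh j₂ ^ (1 : ℝ) * gA j₁) (fun j₁ j₂ => P.mesh j₁ ^ aw * gB j₂ + Leg j₁ j₂)
    (fun i j => add_nonneg (mul_nonneg (hm i _) (hgB0 j)) (hLeg0 i j)) hle hlt
  -- the lower triangle: pairs `j₂ ≤ j₁` (PAIR BOUND 1), finer index `j₂` with exponent `1`
  have step3 : ∑ j₁ ∈ Finset.range k, ∑ j₂ ∈ Finset.range (j₁ + 1), P.mesh j₂ ^ (1 : ℝ) * gA j₁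
      ≤ G1 * (KA * ∑ j ∈ Finset.range k, P.mesh j ^ (aw - (P.d : ℝ)) * E2 j) := by
    have hpt : ∀ j, P.mesh j ^ (1 : ℝ) * gA j = KA * (P.mesh j ^ (aw - (P.d : ℝ)) * E2 j) := by
      intro j
      rw [hgA]
      calc P.mesh j ^ (1 : ℝ) * (KA * (P.mesh j ^ (aw - 1) * (P.mesh j ^ P.d)⁻¹) * E2 j)
          = KA * (P.mesh j ^ (1 : ℝ) * P.mesh j ^ (aw - 1) * (P.mesh j ^ P.d)⁻¹) * E2 j := by ring
        _ = KA * P.mesh j ^ (aw - (P.d : ℝ)) * E2 j := by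
            rw [mesh_one_mul_rpow_mul_inv, show (1 : ℝ) + (aw - 1) - (P.d : ℝ) = aw - (P.d : ℝ) by ring]
        _ = _ := by ring
    have hsum : ∑ j ∈ Finset.range k, P.mesh j ^ (1 : ℝ) * gA j = KA * ∑ j ∈ Finset.range k, P.mesh j ^ (aw - (P.d : ℝ)) * E2 j := by
      rw [Finset.mul_sum]; exact Finset.sum_congr rfl fun j _ => hpt j
    refine (sum_lower_pair_le hL1 one_pos k gA hgA0).trans (le_of_eq ?_)
    rw [hsum]
  -- the upper triangle: pairs `j₁ ≤ j₂` (PAIR BOUND 2), finer index `j₁` with exponent `a_w`, plus the legs of all pairs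
  have step4 : ∑ j₂ ∈ Finset.range k, ∑ j₁ ∈ Finset.range (j₂ + 1), P.mesh j₁ ^ aw * gB j₂
      ≤ Ga * (KB1 * ∑ j ∈ Finset.range k, P.mesh j ^ (aw + 1 - (P.d : ℝ)) * E2 j
          + KB2 * ∑ j ∈ Finset.range k, P.mesh j ^ (aw - (P.d : ℝ)) * E2 j) := by
    have hpt : ∀ j, P.mesh j ^ aw * gB j
        = KB1 * (P.mesh j ^ (aw + 1 - (P.d : ℝ)) * E2 j) + KB2 * (P.mesh j ^ (aw - (P.d : ℝ)) * E2 j) := by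
      intro j
      rw [hgB]
      calc P.mesh j ^ aw * ((KB1 * (P.mesh j ^ (1 : ℝ) * (P.mesh j ^ P.d)⁻¹) + KB2 * (P.mesh j ^ (0 : ℝ) * (P.mesh j ^ P.d)⁻¹)) * E2 j)
          = KB1 * (P.mesh j ^ aw * P.mesh j ^ (1 : ℝ) * (P.mesh j ^ P.d)⁻¹) * E2 j
            + KB2 * (P.mesh j ^ aw * P.mesh j ^ (0 : ℝ) * (P.mesh j ^ P.d)⁻¹) * E2 j := by ring
        _ = KB1 * P.mesh j ^ (aw + 1 - (P.d : ℝ)) * E2 j + KB2 * P.mesh j ^ (aw - (P.d : ℝ)) * E2 j := by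
            rw [mesh_rpow_mul_one_mul_inv, mesh_rpow_mul_zero_mul_inv]
        _ = _ := by ring
    have hsum : ∑ j ∈ Finset.range k, P.mesh j ^ aw * gB j
        = KB1 * ∑ j ∈ Finset.range k, P.mesh j ^ (aw + 1 - (P.d : ℝ)) * E2 j
          + KB2 * ∑ j ∈ Finset.range k, P.mesh j ^ (aw - (P.d : ℝ)) * E2 j := by
      rw [Finset.mul_sum, Finset.mul_sum, ← Finset.sum_add_distrib]; exact Finset.sum_congr rfl fun j _ => hpt j
    refine (sum_lower_pair_le hL1 haw k gB hgB0).trans (le_of_eq ?_)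
    rw [hsum]
  have step4L : ∑ j₂ ∈ Finset.range k, ∑ j₁ ∈ Finset.range (j₂ + 1), Leg j₁ j₂ ≤ LEG := by
    rw [← hLegsum]
    refine Finset.sum_le_sum fun j₂ hj₂ => ?_
    exact Finset.sum_le_sum_of_subset_of_nonneg (Finset.range_subset_range.2 (by have := Finset.mem_range.1 hj₂; omega))
      (fun j₁ _ _ => hLeg0 j₁ j₂)
  have step4' : ∑ j₂ ∈ Finset.range k, ∑ j₁ ∈ Finset.range (j₂ + 1), (P.mesh j₁ ^ aw * gB j₂ + Leg j₁ j₂)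
      ≤ Ga * (KB1 * ∑ j ∈ Finset.range k, P.mesh j ^ (aw + 1 - (P.d : ℝ)) * E2 j
          + KB2 * ∑ j ∈ Finset.range k, P.mesh j ^ (aw - (P.d : ℝ)) * E2 j) + LEG := by
    simp only [Finset.sum_add_distrib]
    exact add_le_add step4 step4L
  -- assemble
  calc ‖covDeriv C B (propagatorK C Ω B msq a k (∑ b : HiggsLattice.PBond P 0, if Inside Ω b then srcMD C A B b w else 0)) b₀‖
      ≤ ∑ j₁ ∈ Finset.range k, ∑ j₂ ∈ Finset.range k, T j₁ j₂ := step1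
    _ ≤ _ := step2
    _ ≤ G1 * (KA * ∑ j ∈ Finset.range k, P.mesh j ^ (aw - (P.d : ℝ)) * E2 j)
        + (Ga * (KB1 * ∑ j ∈ Finset.range k, P.mesh j ^ (aw + 1 - (P.d : ℝ)) * E2 j
          + KB2 * ∑ j ∈ Finset.range k, P.mesh j ^ (aw - (P.d : ℝ)) * E2 j) + LEG) := add_le_add step3 step4'
    _ = _ := by rw [hG1, hGa, hKA, hKB1, hKB2, hK', hE2]; ring

/-- **THE `D^*M` SOURCES (bonds `⊂ Ω`) OF A MULTI-SCALE `Ω`-SUPPORTED FIELD THROUGH `D^ε_BG_k(Ω,B)` at `b₀ ⊂ Ω`, summed over all scale pairs**: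
the torus right side of `B3Op116MixedSeed.dm_sum_le` PLUS the same legs summed over all pairs.
[cite: Balaban1983Higgs3, (1.16) p.414, (2.6) p.424, (2.10) p.426, p.433] [cite: Balaban1982Higgs1, (3.16) p.615] -/
theorem dm_sum_le_box (hδ₁ : 0 < δ₁) (hδ₁1 : δ₁ ≤ 1) (hCst : 0 ≤ Cst) (hCM : 0 ≤ CM) (hs : 0 ≤ s) (hδA : 0 ≤ δA)
    (hpd : ∀ (j : ℕ) (b : HiggsLattice.PBond P 0), Inside Ω b → ∀ y : HiggsLattice.Site P 0,
      pdcolO C Ω msq a k j B B b y ≤ (P.mesh 0 ^ P.d * Cst) * P.mesh j ^ ((1 : ℝ) - (P.d : ℝ)) *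
        Real.exp (-(δ₁ * (P.mesh j)⁻¹ * (P.mesh 0 * (HiggsLattice.Site.tdist b.src y : ℝ)))))
    (hpm : ∀ (j : ℕ) (b₀ b : HiggsLattice.PBond P 0), Inside Ω b₀ → Inside Ω b →
      pmixO C Ω msq a k j B B b₀ b ≤ (P.mesh 0 ^ P.d * CM) * P.mesh j ^ ((0 : ℝ) - (P.d : ℝ)) *
        Real.exp (-(δ₁ * (P.mesh j)⁻¹ * (P.mesh 0 * (HiggsLattice.Site.tdist b₀.src b.src : ℝ)))))
    (hA : ∀ b : HiggsLattice.PBond P 0, |A b| ≤ s)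
    (hreg : ∀ (z : HiggsLattice.Site P 0) (μ ν : Fin P.d), |A ⟨z.shift ν, μ⟩ - A ⟨z, μ⟩| ≤ δA)
    (i₀ : Ix N) {b₀ : HiggsLattice.PBond P 0} (hb₀ : Inside Ω b₀) (x' : HiggsLattice.Site P 0)
    (w : ScalarField P 0 N) (wp : ℕ → ScalarField P 0 N) (hw : ∑ j ∈ Finset.range k, wp j = w)
    (hw0 : ∀ (j : ℕ) (y : HiggsLattice.Site P 0), y ∉ Ω → wp j y = 0) {aw cw cw' : ℝ} (haw : 0 < aw) (hcw : 0 ≤ cw) (hcw' : 0 ≤ cw')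
    (hwv : ∀ (j : ℕ) (y : HiggsLattice.Site P 0), ‖wp j y‖ ≤ cw * P.mesh j ^ (aw - (P.d : ℝ)) *
      Real.exp (-(δ₁ * (P.mesh j)⁻¹ * (P.mesh 0 * (HiggsLattice.Site.tdist y x' : ℝ)))))
    (hwd : ∀ (j : ℕ) (b : HiggsLattice.PBond P 0), Inside Ω b → ‖covDeriv C B (wp j) b‖ ≤ cw' * P.mesh j ^ (aw - 1 - (P.d : ℝ)) *
      Real.exp (-(δ₁ * (P.mesh j)⁻¹ * (P.mesh 0 * (HiggsLattice.Site.tdist b.src x' : ℝ))))) :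
    ‖covDeriv C B (propagatorK C Ω B msq a k
        ((P.mesh 0)⁻¹ • ∑ b : HiggsLattice.PBond P 0, if Inside Ω b then srcDM C A B b w else 0)) b₀‖
      ≤ ((P.L : ℝ) ^ aw / ((P.L : ℝ) ^ aw - 1) *
            ((P.d : ℝ) * ((P.mesh 0 ^ P.d * CM) * (Real.exp 1 * (|C.e| * s * cw)) *
              ((nCol N : ℝ) * (8 * P.d / δ₁) ^ P.d * (P.mesh 0 ^ P.d)⁻¹)))
          + (P.L : ℝ) ^ (1 : ℝ) / ((P.L : ℝ) ^ (1 : ℝ) - 1) *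
            ((P.d : ℝ) * ((P.mesh 0 ^ P.d * Cst) * (|C.e| * s * cw') *
              ((nCol N : ℝ) * (8 * P.d / δ₁) ^ P.d * (P.mesh 0 ^ P.d)⁻¹)))) *
          ∑ j ∈ Finset.range k, P.mesh j ^ (aw - (P.d : ℝ)) *
            Real.exp (-(δ₁ / 2 * (P.mesh j)⁻¹ * (P.mesh 0 * (HiggsLattice.Site.tdist b₀.src x' : ℝ))))
        + (P.L : ℝ) ^ (1 : ℝ) / ((P.L : ℝ) ^ (1 : ℝ) - 1) *
            ((P.d : ℝ) * ((P.mesh 0 ^ P.d * Cst) * ((P.mesh 0)⁻¹ * (|C.e| * δA) * cw) *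
              ((nCol N : ℝ) * (8 * P.d / δ₁) ^ P.d * (P.mesh 0 ^ P.d)⁻¹))) *
          ∑ j ∈ Finset.range k, P.mesh j ^ (aw + 1 - (P.d : ℝ)) *
            Real.exp (-(δ₁ / 2 * (P.mesh j)⁻¹ * (P.mesh 0 * (HiggsLattice.Site.tdist b₀.src x' : ℝ))))
        + (P.mesh 0)⁻¹ * (|C.e| * s) *
          ((∑ b ∈ exB Ω A, (∑ i ∈ Finset.range k, pdcolO C Ω msq a k i B B b₀ b.src) * (∑ j ∈ Finset.range k, ‖wp j b.src‖))
            + ∑ b ∈ enB Ω A, (∑ i ∈ Finset.range k, pdcolO C Ω msq a k i B B b₀ b.tgt) * (∑ j ∈ Finset.range k, ‖wp j b.tgt‖)) := by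
  have hL1' : (1 : ℝ) < (P.L : ℝ) := by exact_mod_cast hL1
  have hε := P.mesh_pos 0
  have hles : 0 ≤ (P.mesh 0)⁻¹ * (|C.e| * s) := mul_nonneg (inv_nonneg.mpr hε.le) (mul_nonneg (abs_nonneg _) hs)
  set K' : ℝ := (nCol N : ℝ) * (8 * P.d / δ₁) ^ P.d * (P.mesh 0 ^ P.d)⁻¹ with hK'
  set KD : ℝ := (P.d : ℝ) * ((P.mesh 0 ^ P.d * CM) * (Real.exp 1 * (|C.e| * s * cw)) * K') with hKD
  set KP1 : ℝ := (P.d : ℝ) * ((P.mesh 0 ^ P.d * Cst) * ((P.mesh 0)⁻¹ * (|C.e| * δA) * cw) * K') with hKP1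
  set KP2 : ℝ := (P.d : ℝ) * ((P.mesh 0 ^ P.d * Cst) * (|C.e| * s * cw') * K') with hKP2
  have hKD0 : 0 ≤ KD := by rw [hKD, hK']; positivity
  have hKP10 : 0 ≤ KP1 := by rw [hKP1, hK']; positivity
  have hKP20 : 0 ≤ KP2 := by rw [hKP2, hK']; positivity
  set E2 : ℕ → ℝ := fun j => Real.exp (-(δ₁ / 2 * (P.mesh j)⁻¹ * (P.mesh 0 * (HiggsLattice.Site.tdist b₀.src x' : ℝ)))) with hE2
  have hE20 : ∀ j, 0 ≤ E2 j := fun j => Real.exp_nonneg _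
  set G1 : ℝ := (P.L : ℝ) ^ (1 : ℝ) / ((P.L : ℝ) ^ (1 : ℝ) - 1) with hG1
  set Ga : ℝ := (P.L : ℝ) ^ aw / ((P.L : ℝ) ^ aw - 1) with hGa
  have hm : ∀ j (e : ℝ), 0 ≤ P.mesh j ^ e := fun j e => Real.rpow_nonneg (P.mesh_pos j).le e
  have hmi : ∀ j, 0 ≤ (P.mesh j ^ P.d)⁻¹ := fun j => inv_nonneg.mpr (pow_nonneg (P.mesh_pos j).le _)
  -- the legs of one pair (piece `j₂`, field piece `j₁`) and of all pairs
  set Leg : ℕ → ℕ → ℝ := fun j₂ j₁ => (P.mesh 0)⁻¹ * (|C.e| * s) *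
    ((∑ b ∈ exB Ω A, pdcolO C Ω msq a k j₂ B B b₀ b.src * ‖wp j₁ b.src‖)
      + ∑ b ∈ enB Ω A, pdcolO C Ω msq a k j₂ B B b₀ b.tgt * ‖wp j₁ b.tgt‖) with hLeg
  set LEG : ℝ := (P.mesh 0)⁻¹ * (|C.e| * s) *
    ((∑ b ∈ exB Ω A, (∑ i ∈ Finset.range k, pdcolO C Ω msq a k i B B b₀ b.src) * (∑ j ∈ Finset.range k, ‖wp j b.src‖))
      + ∑ b ∈ enB Ω A, (∑ i ∈ Finset.range k, pdcolO C Ω msq a k i B B b₀ b.tgt) * (∑ j ∈ Finset.range k, ‖wp j b.tgt‖)) with hLEG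
  have hLeg0 : ∀ j₂ j₁, 0 ≤ Leg j₂ j₁ := fun j₂ j₁ => by
    rw [hLeg]
    exact mul_nonneg hles (add_nonneg (Finset.sum_nonneg fun b _ => mul_nonneg (pdcolO_nonneg _ _ _ _) (norm_nonneg _))
      (Finset.sum_nonneg fun b _ => mul_nonneg (pdcolO_nonneg _ _ _ _) (norm_nonneg _)))
  have hLegsum : ∑ j₁ ∈ Finset.range k, ∑ j₂ ∈ Finset.range k, Leg j₂ j₁ = LEG := by
    rw [hLEG, ← sum_sum_mul_eq', ← sum_sum_mul_eq', ← Finset.sum_add_distrib, Finset.mul_sum]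
    refine Finset.sum_congr rfl fun j₁ _ => ?_
    rw [← Finset.sum_add_distrib, Finset.mul_sum]
  -- the double sum over the pieces, OUTER index = the piece `j₂` of `G_B`, inner = the piece `j₁` of `w`
  set T : ℕ → ℕ → ℝ := fun j₂ j₁ =>
    ‖covDeriv C B (pieceR C Ω B msq a k j₂
      ((P.mesh 0)⁻¹ • ∑ b : HiggsLattice.PBond P 0, if Inside Ω b then srcDM C A B b (wp j₁) else 0)) b₀‖ with hT
  have step1 : ‖covDeriv C B (propagatorK C Ω B msq a k
        ((P.mesh 0)⁻¹ • ∑ b : HiggsLattice.PBond P 0, if Inside Ω b then srcDM C A B b w else 0)) b₀‖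
      ≤ ∑ j₂ ∈ Finset.range k, ∑ j₁ ∈ Finset.range k, T j₂ j₁ := by
    have hsrc : (P.mesh 0)⁻¹ • (∑ b : HiggsLattice.PBond P 0, if Inside Ω b then srcDM C A B b w else 0)
        = ∑ j₁ ∈ Finset.range k, (P.mesh 0)⁻¹ • ∑ b : HiggsLattice.PBond P 0, (if Inside Ω b then srcDM C A B b (wp j₁) else 0) := by
      rw [← Finset.smul_sum, Finset.sum_comm]
      congr 1
      refine Finset.sum_congr rfl fun b _ => ?_
      split_ifs
      · rw [← hw]; exact srcDM_sum C A B _ _ b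
      · simp
    rw [hsrc, map_sum, B3Ineq210RegularTorus.covDeriv_sum'']
    refine (norm_sum_le _ _).trans ?_
    rw [Finset.sum_comm]
    refine Finset.sum_le_sum fun j₁ _ => ?_
    rw [covDeriv_propagatorK_eq_sum_piecesR C msq a k B B hmsq ha hL1 hk hkK]
    rw [hT]
    exact norm_sum_le (Finset.range k)
      (fun j₂ => covDeriv C B (pieceR C Ω B msq a k j₂
        ((P.mesh 0)⁻¹ • ∑ b : HiggsLattice.PBond P 0, if Inside Ω b then srcDM C A B b (wp j₁) else 0)) b₀)
  -- the two cases
  set gD : ℕ → ℝ := fun j₂ => KD * (P.mesh j₂ ^ (0 : ℝ) * (P.mesh j₂ ^ P.d)⁻¹) * E2 j₂ with hgD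
  set gP : ℕ → ℝ := fun j₁ => (KP1 * (P.mesh j₁ ^ aw * (P.mesh j₁ ^ P.d)⁻¹) + KP2 * (P.mesh j₁ ^ (aw - 1) * (P.mesh j₁ ^ P.d)⁻¹))
    * E2 j₁ with hgP
  have hgD0 : ∀ j, 0 ≤ gD j := fun j => by
    rw [hgD]; exact mul_nonneg (mul_nonneg hKD0 (mul_nonneg (hm j _) (hmi j))) (hE20 j)
  have hgP0 : ∀ j, 0 ≤ gP j := fun j => by
    rw [hgP]
    exact mul_nonneg (add_nonneg (mul_nonneg hKP10 (mul_nonneg (hm j _) (hmi j))) (mul_nonneg hKP20 (mul_nonneg (hm j _) (hmi j))))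
      (hE20 j)
  have hle : ∀ j₂ j₁, j₁ ≤ j₂ → T j₂ j₁ ≤ P.mesh j₁ ^ aw * gD j₂ := by
    intro j₂ j₁ hj
    have h := dm_direct_le_box hδ₁ hδ₁1 hCM hs hpm hA i₀ hb₀ x' j₁ j₂ (wp j₁) hcw (hwv j₁)
    rw [max_eq_left hj] at h
    refine h.trans (le_of_eq ?_)
    rw [hgD, hKD, hE2]; ring
  have hlt : ∀ j₂ j₁, j₂ < j₁ → T j₂ j₁ ≤ P.mesh j₂ ^ (1 : ℝ) * gP j₁ + Leg j₂ j₁ := by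
    intro j₂ j₁ hj
    have h := dm_parts_le_box hmsq ha hL1 hk hkK hΩ hδ₁ hδ₁1 hCst hs hδA hpd hA hreg i₀ hb₀ x' j₁ j₂ (wp j₁) (hw0 j₁) hcw hcw'
      (hwv j₁) (hwd j₁)
    rw [max_eq_right hj.le] at h
    refine h.trans (le_of_eq ?_)
    rw [hgP, hKP1, hKP2, hE2]; ring
  have step2 := sum_sq_le_of_cases k T (fun j₂ j₁ => P.mesh j₁ ^ aw * gD j₂) (fun j₂ j₁ => P.mesh j₂ ^ (1 : ℝ) * gP j₁ + Leg j₂ j₁)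
    (fun i j => add_nonneg (mul_nonneg (hm i _) (hgP0 j)) (hLeg0 i j)) hle hlt
  -- pairs `j₁ ≤ j₂` (PAIR BOUND 3): finer index `j₁` with exponent `a_w`
  have step3 : ∑ j₂ ∈ Finset.range k, ∑ j₁ ∈ Finset.range (j₂ + 1), P.mesh j₁ ^ aw * gD j₂
      ≤ Ga * (KD * ∑ j ∈ Finset.range k, P.mesh j ^ (aw - (P.d : ℝ)) * E2 j) := by
    have hpt : ∀ j, P.mesh j ^ aw * gD j = KD * (P.mesh j ^ (aw - (P.d : ℝ)) * E2 j) := by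
      intro j
      rw [hgD]
      calc P.mesh j ^ aw * (KD * (P.mesh j ^ (0 : ℝ) * (P.mesh j ^ P.d)⁻¹) * E2 j)
          = KD * (P.mesh j ^ aw * P.mesh j ^ (0 : ℝ) * (P.mesh j ^ P.d)⁻¹) * E2 j := by ring
        _ = KD * P.mesh j ^ (aw - (P.d : ℝ)) * E2 j := by rw [mesh_rpow_mul_zero_mul_inv]
        _ = _ := by ring
    have hsum : ∑ j ∈ Finset.range k, P.mesh j ^ aw * gD j = KD * ∑ j ∈ Finset.range k, P.mesh j ^ (aw - (P.d : ℝ)) * E2 j := by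
      rw [Finset.mul_sum]; exact Finset.sum_congr rfl fun j _ => hpt j
    have hGa0 : 0 ≤ Ga := by
      have := Real.one_lt_rpow hL1' haw; rw [hGa]; exact div_nonneg (by linarith) (by linarith)
    refine (sum_lower_pair_le hL1 haw k gD hgD0).trans (le_of_eq ?_)
    rw [hsum]
  -- pairs `j₂ < j₁` (PAIR BOUND 4): finer index `j₂` with exponent `1`, plus the legs of all pairs
  have step4 : ∑ j₁ ∈ Finset.range k, ∑ j₂ ∈ Finset.range (j₁ + 1), P.mesh j₂ ^ (1 : ℝ) * gP j₁
      ≤ G1 * (KP1 * ∑ j ∈ Finset.range k, P.mesh j ^ (aw + 1 - (P.d : ℝ)) * E2 j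
          + KP2 * ∑ j ∈ Finset.range k, P.mesh j ^ (aw - (P.d : ℝ)) * E2 j) := by
    have hpt : ∀ j, P.mesh j ^ (1 : ℝ) * gP j
        = KP1 * (P.mesh j ^ (aw + 1 - (P.d : ℝ)) * E2 j) + KP2 * (P.mesh j ^ (aw - (P.d : ℝ)) * E2 j) := by
      intro j
      rw [hgP]
      calc P.mesh j ^ (1 : ℝ) * ((KP1 * (P.mesh j ^ aw * (P.mesh j ^ P.d)⁻¹) + KP2 * (P.mesh j ^ (aw - 1) * (P.mesh j ^ P.d)⁻¹)) * E2 j)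
          = KP1 * (P.mesh j ^ (1 : ℝ) * P.mesh j ^ aw * (P.mesh j ^ P.d)⁻¹) * E2 j
            + KP2 * (P.mesh j ^ (1 : ℝ) * P.mesh j ^ (aw - 1) * (P.mesh j ^ P.d)⁻¹) * E2 j := by ring
        _ = KP1 * P.mesh j ^ (aw + 1 - (P.d : ℝ)) * E2 j + KP2 * P.mesh j ^ (aw - (P.d : ℝ)) * E2 j := by
            rw [mesh_one_mul_rpow_mul_inv, mesh_one_mul_rpow_mul_inv, show (1 : ℝ) + aw - (P.d : ℝ) = aw + 1 - (P.d : ℝ) by ring,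
              show (1 : ℝ) + (aw - 1) - (P.d : ℝ) = aw - (P.d : ℝ) by ring]
        _ = _ := by ring
    have hsum : ∑ j ∈ Finset.range k, P.mesh j ^ (1 : ℝ) * gP j
        = KP1 * ∑ j ∈ Finset.range k, P.mesh j ^ (aw + 1 - (P.d : ℝ)) * E2 j
          + KP2 * ∑ j ∈ Finset.range k, P.mesh j ^ (aw - (P.d : ℝ)) * E2 j := by
      rw [Finset.mul_sum, Finset.mul_sum, ← Finset.sum_add_distrib]; exact Finset.sum_congr rfl fun j _ => hpt j
    refine (sum_lower_pair_le hL1 one_pos k gP hgP0).trans (le_of_eq ?_)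
    rw [hsum]
  have step4L : ∑ j₁ ∈ Finset.range k, ∑ j₂ ∈ Finset.range (j₁ + 1), Leg j₂ j₁ ≤ LEG := by
    rw [← hLegsum]
    refine Finset.sum_le_sum fun j₁ hj₁ => ?_
    exact Finset.sum_le_sum_of_subset_of_nonneg (Finset.range_subset_range.2 (by have := Finset.mem_range.1 hj₁; omega))
      (fun j₂ _ _ => hLeg0 j₂ j₁)
  have step4' : ∑ j₁ ∈ Finset.range k, ∑ j₂ ∈ Finset.range (j₁ + 1), (P.mesh j₂ ^ (1 : ℝ) * gP j₁ + Leg j₂ j₁)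
      ≤ G1 * (KP1 * ∑ j ∈ Finset.range k, P.mesh j ^ (aw + 1 - (P.d : ℝ)) * E2 j
          + KP2 * ∑ j ∈ Finset.range k, P.mesh j ^ (aw - (P.d : ℝ)) * E2 j) + LEG := by
    simp only [Finset.sum_add_distrib]
    exact add_le_add step4 step4L
  -- assemble
  calc ‖covDeriv C B (propagatorK C Ω B msq a k
        ((P.mesh 0)⁻¹ • ∑ b : HiggsLattice.PBond P 0, if Inside Ω b then srcDM C A B b w else 0)) b₀‖
      ≤ ∑ j₂ ∈ Finset.range k, ∑ j₁ ∈ Finset.range k, T j₂ j₁ := step1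
    _ ≤ _ := step2
    _ ≤ Ga * (KD * ∑ j ∈ Finset.range k, P.mesh j ^ (aw - (P.d : ℝ)) * E2 j)
        + (G1 * (KP1 * ∑ j ∈ Finset.range k, P.mesh j ^ (aw + 1 - (P.d : ℝ)) * E2 j
          + KP2 * ∑ j ∈ Finset.range k, P.mesh j ^ (aw - (P.d : ℝ)) * E2 j) + LEG) := add_le_add step3 step4'
    _ = _ := by rw [hG1, hGa, hKD, hKP1, hKP2, hK', hE2]; ring

end PairSums

/-! ## §5 The `M^*M` sources (bonds `⊂ Ω`) and the averaging sources on `Ω` (no second derivative: the totals suffice; no legs) -/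

section Totals

variable {C : ChargeData N} {Ω : Finset (HiggsLattice.Site P 0)} {A B : HiggsLattice.VecField P 0} {msq a : ℝ} {k : ℕ}
  {δ₁ Cst s : ℝ}

/-- **The differentiated column of `G_k(Ω,X)` is below the sum of the differentiated columns of its pieces** ((2.6) + triangle inequality).
[cite: Balaban1983Higgs3, (2.6) p.424] -/
theorem dcolO_le_sum_pdcolO (Y X : HiggsLattice.VecField P 0) (hmsq : 0 < msq) (ha : 0 < a) (hL1 : 1 < P.L) (hk : 1 ≤ k) (hkK : k ≤ P.K)
    (b : HiggsLattice.PBond P 0) (y : HiggsLattice.Site P 0) :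
    ∑ i : Ix N, ‖covDeriv C Y (propagatorK C Ω X msq a k (cb P N 0 (y, i))) b‖ ≤ ∑ j ∈ Finset.range k, pdcolO C Ω msq a k j Y X b y := by
  unfold pdcolO
  rw [Finset.sum_comm]
  refine Finset.sum_le_sum fun i _ => ?_
  rw [covDeriv_propagatorK_eq_sum_piecesR C msq a k Y X hmsq ha hL1 hk hkK]
  exact norm_sum_le _ _

/-- **The differentiated column of `G_k(Ω,B)` at a bond `⊂ Ω` is majorised at every source site** by the per-piece dictionary:
`Σ_i‖(D^ε_BG_k(Ω,B)e_{(y,i)})(b)‖ ≤ Σ_{j<k}ε^dC(L^jε)^{1−d}e_j(b₋,y)`. [cite: Balaban1983Higgs3, (2.6) p.424, (2.10) p.426] -/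
theorem dcolO_le_majorant (hmsq : 0 < msq) (ha : 0 < a) (hL1 : 1 < P.L) (hk : 1 ≤ k) (hkK : k ≤ P.K)
    (hpd : ∀ (j : ℕ) (b : HiggsLattice.PBond P 0), Inside Ω b → ∀ y : HiggsLattice.Site P 0,
      pdcolO C Ω msq a k j B B b y ≤ (P.mesh 0 ^ P.d * Cst) * P.mesh j ^ ((1 : ℝ) - (P.d : ℝ)) *
        Real.exp (-(δ₁ * (P.mesh j)⁻¹ * (P.mesh 0 * (HiggsLattice.Site.tdist b.src y : ℝ)))))
    {b : HiggsLattice.PBond P 0} (hb : Inside Ω b) (y : HiggsLattice.Site P 0) :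
    ∑ i : Ix N, ‖covDeriv C B (propagatorK C Ω B msq a k (cb P N 0 (y, i))) b‖
      ≤ ∑ j ∈ Finset.range k, (P.mesh 0 ^ P.d * Cst) * P.mesh j ^ ((1 : ℝ) - (P.d : ℝ)) *
          Real.exp (-(δ₁ * (P.mesh j)⁻¹ * (P.mesh 0 * (HiggsLattice.Site.tdist b.src y : ℝ)))) :=
  (dcolO_le_sum_pdcolO B B hmsq ha hL1 hk hkK b y).trans (Finset.sum_le_sum fun j _ => hpd j b hb y)

/-- **THE `M^*M` SOURCES OF THE BONDS `⊂ Ω` through `D^ε_BG_k(Ω,B)`**: the torus right side of `B3Op116MixedSeed.mm_le` verbatim (the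
differentiated column of `G_k(Ω,B)` against the value of `w`; no cancellation, no legs). [cite: Balaban1983Higgs3, (1.16) p.414, (2.6) p.424, (2.10) p.426] [cite: Balaban1982Higgs1, (3.16) p.615] -/
theorem mm_le_box (hL1 : 1 < P.L) (hδ₁ : 0 < δ₁) (hδ₁1 : δ₁ ≤ 1) (hCst : 0 ≤ Cst) (hs : 0 ≤ s) (b₀ : HiggsLattice.PBond P 0)
    (hdc : ∀ y : HiggsLattice.Site P 0, ∑ i : Ix N, ‖covDeriv C B (propagatorK C Ω B msq a k (cb P N 0 (y, i))) b₀‖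
      ≤ ∑ j ∈ Finset.range k, (P.mesh 0 ^ P.d * Cst) * P.mesh j ^ ((1 : ℝ) - (P.d : ℝ)) *
          Real.exp (-(δ₁ * (P.mesh j)⁻¹ * (P.mesh 0 * (HiggsLattice.Site.tdist b₀.src y : ℝ)))))
    (hA : ∀ b : HiggsLattice.PBond P 0, |A b| ≤ s) (i₀ : Ix N) (x' : HiggsLattice.Site P 0)
    (w : ScalarField P 0 N) (wp : ℕ → ScalarField P 0 N) (hw : ∑ j ∈ Finset.range k, wp j = w) {aw cw : ℝ} (haw : 0 < aw)
    (hcw : 0 ≤ cw)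
    (hwv : ∀ (j : ℕ) (y : HiggsLattice.Site P 0), ‖wp j y‖ ≤ cw * P.mesh j ^ (aw - (P.d : ℝ)) *
      Real.exp (-(δ₁ * (P.mesh j)⁻¹ * (P.mesh 0 * (HiggsLattice.Site.tdist y x' : ℝ))))) :
    ∑ b : HiggsLattice.PBond P 0, ‖covDeriv C B (propagatorK C Ω B msq a k (if Inside Ω b then srcMM C A B b w else 0)) b₀‖
      ≤ (P.d : ℝ) * ∑ j ∈ Finset.range k, ((Real.exp 1 * (P.mesh 0 ^ P.d * Cst)) * (Real.exp 1 * ((|C.e| * s) ^ 2 * cw)) *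
            ((nCol N : ℝ) * (8 * P.d / δ₁) ^ P.d * (P.mesh 0 ^ P.d)⁻¹ *
              ((P.L : ℝ) ^ (1 : ℝ) / ((P.L : ℝ) ^ (1 : ℝ) - 1) + (P.L : ℝ) ^ aw / ((P.L : ℝ) ^ aw - 1)))) *
          P.mesh j ^ ((1 : ℝ) + aw - (P.d : ℝ)) *
          Real.exp (-(δ₁ / 2 * (P.mesh j)⁻¹ * (P.mesh 0 * (HiggsLattice.Site.tdist b₀.src x' : ℝ)))) := by
  have hes : 0 ≤ (|C.e| * s) ^ 2 := pow_nonneg (mul_nonneg (abs_nonneg _) hs) 2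
  have hc : 0 ≤ P.mesh 0 ^ P.d * Cst := mul_nonneg (pow_nonneg (P.mesh_pos 0).le _) hCst
  set K : HiggsLattice.Site P 0 → ℝ := fun y => ∑ i : Ix N, ‖covDeriv C B (propagatorK C Ω B msq a k (cb P N 0 (y, i))) b₀‖ with hK
  have hK0 : ∀ y, 0 ≤ K y := fun y => Finset.sum_nonneg fun _ _ => norm_nonneg _
  have step1 : ∑ b : HiggsLattice.PBond P 0, ‖covDeriv C B (propagatorK C Ω B msq a k (if Inside Ω b then srcMM C A B b w else 0)) b₀‖
      ≤ ∑ b : HiggsLattice.PBond P 0, K b.tgt * ((|C.e| * s) ^ 2 * ‖w b.tgt‖) := by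
    refine Finset.sum_le_sum fun b _ => ?_
    by_cases hb : Inside Ω b
    · rw [if_pos hb]
      have h := norm_mapE_srcMM_le C A B (covDerivAt C B b₀ ∘ₗ propagatorK C Ω B msq a k) (hA b) w
      simp only [LinearMap.coe_comp, Function.comp_apply, covDerivAt_apply] at h
      refine h.trans (le_of_eq ?_)
      rw [hK]; ring
    · rw [if_neg hb, map_zero, B3Ineq210RegularTorus.covDeriv_zero'', norm_zero]
      exact mul_nonneg (hK0 _) (mul_nonneg hes (norm_nonneg _))
  refine step1.trans ?_
  refine sum_bond_kernel_mul_le hL1 hδ₁ hδ₁1 one_pos haw (mul_nonneg (Real.exp_nonneg _) hc)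
    (mul_nonneg (Real.exp_nonneg _) (mul_nonneg hes hcw)) i₀ b₀.src x' _ _ (fun b => hK0 _)
    (fun b => mul_nonneg hes (norm_nonneg _)) (fun b => ?_) (fun b => ?_)
  · exact (hdc b.tgt).trans (majorant_shift_le hδ₁ hδ₁1 hc b₀.src b.src b.dir)
  · have h1 := norm_le_majorant_of_pieces w wp hw x' hwv b.tgt
    have h2 := majorant_shift_le' (k := k) (a := aw - (P.d : ℝ)) hδ₁ hδ₁1 hcw b.src x' b.dir
    calc (|C.e| * s) ^ 2 * ‖w b.tgt‖
        ≤ (|C.e| * s) ^ 2 * ∑ j ∈ Finset.range k, (Real.exp 1 * cw) * P.mesh j ^ (aw - (P.d : ℝ)) *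
            Real.exp (-(δ₁ * (P.mesh j)⁻¹ * (P.mesh 0 * (HiggsLattice.Site.tdist b.src x' : ℝ)))) :=
          mul_le_mul_of_nonneg_left (h1.trans h2) hes
      _ = _ := by rw [Finset.mul_sum]; exact Finset.sum_congr rfl fun j _ => by ring

/-- **THE AVERAGING SOURCES through `D^ε_BG_k(Ω,B)`**: the torus right side of `B3Op116MixedSeed.avg_le` verbatim (the averaging operators do
not see `Ω`; block averages of `‖w‖` are top-scale bumps, read against the differentiated column of `G_k(Ω,B)`).
[cite: Balaban1982Higgs1, (3.15) p.614, (3.16) p.615] [cite: Balaban1983Higgs3, (1.16) p.414, (2.10) p.426] -/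
theorem avg_le_box (hL1 : 1 < P.L) (hk : 1 ≤ k) (hkK : k ≤ P.K) (hδ₁ : 0 < δ₁) (hδ₁1 : δ₁ ≤ 1) (hCst : 0 ≤ Cst) (hs : 0 ≤ s)
    (b₀ : HiggsLattice.PBond P 0)
    (hdc : ∀ y : HiggsLattice.Site P 0, ∑ i : Ix N, ‖covDeriv C B (propagatorK C Ω B msq a k (cb P N 0 (y, i))) b₀‖
      ≤ ∑ j ∈ Finset.range k, (P.mesh 0 ^ P.d * Cst) * P.mesh j ^ ((1 : ℝ) - (P.d : ℝ)) *
          Real.exp (-(δ₁ * (P.mesh j)⁻¹ * (P.mesh 0 * (HiggsLattice.Site.tdist b₀.src y : ℝ)))))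
    (hA : ∀ b : HiggsLattice.PBond P 0, |A b| ≤ s) (i₀ : Ix N) (x' : HiggsLattice.Site P 0)
    (w : ScalarField P 0 N) (wp : ℕ → ScalarField P 0 N) (hw : ∑ j ∈ Finset.range k, wp j = w) {aw cw : ℝ} (haw : 0 < aw)
    (hcw : 0 ≤ cw)
    (hwv : ∀ (j : ℕ) (y : HiggsLattice.Site P 0), ‖wp j y‖ ≤ cw * P.mesh j ^ (aw - (P.d : ℝ)) *
      Real.exp (-(δ₁ * (P.mesh j)⁻¹ * (P.mesh 0 * (HiggsLattice.Site.tdist y x' : ℝ))))) :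
    ‖covDeriv C B (propagatorK C Ω B msq a k (avgSrc C A B k w)) b₀‖
      ≤ ((|C.e| * s * P.mesh 0 * (P.d * ((P.L : ℝ) ^ k - 1))) * (2 + |C.e| * s * P.mesh 0 * (P.d * ((P.L : ℝ) ^ k - 1)))) *
        ∑ j ∈ Finset.range (k + 1), ((P.mesh 0 ^ P.d * Cst) *
            ((Real.exp (δ₁ / 2) * ((nCol N : ℝ) * (4 * P.d / (δ₁ / 2)) ^ P.d) / ((P.L : ℝ) ^ aw - 1)) * cw) *
            ((nCol N : ℝ) * (8 * P.d / (δ₁ / 2)) ^ P.d * (P.mesh 0 ^ P.d)⁻¹ *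
              ((P.L : ℝ) ^ (1 : ℝ) / ((P.L : ℝ) ^ (1 : ℝ) - 1) + (P.L : ℝ) ^ aw / ((P.L : ℝ) ^ aw - 1)))) *
          P.mesh j ^ ((1 : ℝ) + aw - (P.d : ℝ)) *
          Real.exp (-(δ₁ / 2 / 2 * (P.mesh j)⁻¹ * (P.mesh 0 * (HiggsLattice.Site.tdist b₀.src x' : ℝ)))) := by
  have hL1' : (1 : ℝ) < (P.L : ℝ) := by exact_mod_cast hL1
  have hε := P.mesh_pos 0
  have hc : 0 ≤ P.mesh 0 ^ P.d * Cst := mul_nonneg (pow_nonneg hε.le _) hCst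
  set K : HiggsLattice.Site P 0 → ℝ := fun y => ∑ i : Ix N, ‖covDeriv C B (propagatorK C Ω B msq a k (cb P N 0 (y, i))) b₀‖ with hK
  have hK0 : ∀ y, 0 ≤ K y := fun y => Finset.sum_nonneg fun _ _ => norm_nonneg _
  set m : ℝ := |C.e| * s * P.mesh 0 * (P.d * ((P.L : ℝ) ^ k - 1)) with hm
  have hLk1 : (1 : ℝ) ≤ (P.L : ℝ) ^ k := one_le_pow₀ hL1'.le
  have hm0 : 0 ≤ m := by
    have : (0 : ℝ) ≤ (P.L : ℝ) ^ k - 1 := by linarith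
    rw [hm]; positivity
  set Cb : ℝ := (Real.exp (δ₁ / 2) * ((nCol N : ℝ) * (4 * P.d / (δ₁ / 2)) ^ P.d) / ((P.L : ℝ) ^ aw - 1)) * cw with hCb
  have hCb0 : 0 ≤ Cb := by
    have h1 : 0 < (P.L : ℝ) ^ aw - 1 := by have := Real.one_lt_rpow hL1' haw; linarith
    have h2 : 0 ≤ (4 * (P.d : ℝ) / (δ₁ / 2)) ^ P.d := pow_nonneg (by positivity) _
    rw [hCb]; positivity
  -- the averaging sources through the functional: block averages of `‖w‖` against the differentiated column
  have step1 := norm_mapE_avgSrc_le_block (C := C) (A := A) (B := B) (k := k)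
    (covDerivAt C B b₀ ∘ₗ propagatorK C Ω B msq a k) hkK hs hA w
  simp only [LinearMap.coe_comp, Function.comp_apply, covDerivAt_apply] at step1
  -- each block average is a top bump of exponent `a_w`
  have hblk : ∀ y : HiggsLattice.Site P 0,
      ((P.L : ℝ) ^ (k * P.d))⁻¹ * ∑ x ∈ blockK k (blockIter k y), ‖w x‖
        ≤ Cb * (P.mesh k ^ aw * (P.mesh k ^ P.d)⁻¹) *
          Real.exp (-(δ₁ / 2 * (P.mesh k)⁻¹ * (P.mesh 0 * (HiggsLattice.Site.tdist y x' : ℝ)))) := by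
    intro y
    have h := block_avg_majorant_le (N := N) hL1 hk hkK hδ₁ hδ₁1 hcw haw i₀ (fun x => ‖w x‖) y x'
      (fun x _ => norm_le_majorant_of_pieces w wp hw x' hwv x)
    refine h.trans (le_of_eq ?_)
    rw [hCb]
  -- the column against the bump: two kernels at range `k + 1`, rate `δ₁/2`
  have hδ2 : 0 < δ₁ / 2 := half_pos hδ₁
  have hδ21 : δ₁ / 2 ≤ 1 := by linarith
  have step2 : ∑ y : HiggsLattice.Site P 0, K y * (((P.L : ℝ) ^ (k * P.d))⁻¹ * ∑ x ∈ blockK k (blockIter k y), ‖w x‖)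
      ≤ ∑ j ∈ Finset.range (k + 1), ((P.mesh 0 ^ P.d * Cst) * Cb *
            ((nCol N : ℝ) * (8 * P.d / (δ₁ / 2)) ^ P.d * (P.mesh 0 ^ P.d)⁻¹ *
              ((P.L : ℝ) ^ (1 : ℝ) / ((P.L : ℝ) ^ (1 : ℝ) - 1) + (P.L : ℝ) ^ aw / ((P.L : ℝ) ^ aw - 1)))) *
          P.mesh j ^ ((1 : ℝ) + aw - (P.d : ℝ)) *
          Real.exp (-(δ₁ / 2 / 2 * (P.mesh j)⁻¹ * (P.mesh 0 * (HiggsLattice.Site.tdist b₀.src x' : ℝ)))) := by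
    refine sum_kernel_mul_le hL1 hδ2 hδ21 one_pos haw hc hCb0 i₀ b₀.src x' _ _ hK0
      (fun y => mul_nonneg (inv_nonneg.mpr (pow_nonneg (Nat.cast_nonneg _) _)) (Finset.sum_nonneg fun _ _ => norm_nonneg _))
      (fun y => ?_) (fun y => ?_)
    · exact (hdc y).trans (majorant_mono hc (by linarith) (Nat.le_succ k) b₀.src y)
    · refine (hblk y).trans ?_
      rw [mesh_rpow_mul_inv_pow_eq]
      exact top_bump_le_majorant_succ hCb0 y x'
  calc ‖covDeriv C B (propagatorK C Ω B msq a k (avgSrc C A B k w)) b₀‖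
      ≤ ∑ y : HiggsLattice.Site P 0, (m * (2 + m) * (((P.L : ℝ) ^ (k * P.d))⁻¹ * ∑ x ∈ blockK k (blockIter k y), ‖w x‖)) * K y := by
        refine step1.trans (le_of_eq (Finset.sum_congr rfl fun y _ => ?_))
        rw [hK]
    _ = m * (2 + m) * ∑ y : HiggsLattice.Site P 0, K y *
          (((P.L : ℝ) ^ (k * P.d))⁻¹ * ∑ x ∈ blockK k (blockIter k y), ‖w x‖) := by
        rw [Finset.mul_sum]; exact Finset.sum_congr rfl fun y _ => by ring
    _ ≤ _ := mul_le_mul_of_nonneg_left step2 (mul_nonneg hm0 (by linarith))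

end Totals

/-! ## §6 THE ROW THEOREM ON `Ω`: `D^ε_BG_k(Ω,B)V_k^Ω(A,B)w` at a bond `b₀ ⊂ Ω` — torus regular part + the face sheet -/

section RowTheorem

variable {C : ChargeData N} {Ω : Finset (HiggsLattice.Site P 0)} {A B : HiggsLattice.VecField P 0} {msq a : ℝ} {k : ℕ}
  {δ₁ Cst CM s δA : ℝ}

/-- The bond sources of `V_k^Ω` separated: `Σ_{b⊂Ω}bondSrc_b w = Σ_{b⊂Ω}srcMD_b w + ε⁻¹Σ_{b⊂Ω}srcDM_b w + Σ_{b⊂Ω}srcMM_b w`.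
[cite: Balaban1982Higgs1, (3.16) p.615] -/
theorem sum_ite_bondSrc_eq (w : ScalarField P 0 N) :
    (∑ b : HiggsLattice.PBond P 0, if Inside Ω b then bondSrc C A B b w else 0)
      = (∑ b : HiggsLattice.PBond P 0, if Inside Ω b then srcMD C A B b w else 0)
        + (P.mesh 0)⁻¹ • (∑ b : HiggsLattice.PBond P 0, if Inside Ω b then srcDM C A B b w else 0)
        + ∑ b : HiggsLattice.PBond P 0, (if Inside Ω b then srcMM C A B b w else 0) := by
  rw [Finset.smul_sum, ← Finset.sum_add_distrib, ← Finset.sum_add_distrib]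
  refine Finset.sum_congr rfl fun b _ => ?_
  split_ifs
  · rfl
  · simp

/-- **`V_k^Ω` through a linear map `T`, sources separated**: `T(V_k^Ωw) = −(T(Σ_{b⊂Ω}srcMD) + T(ε⁻¹Σ_{b⊂Ω}srcDM) + Σ_{b⊂Ω}T(srcMM_b w))
− a_k(L^kε)^{−2}T(avgSrc w)`. [cite: Balaban1982Higgs1, (3.16) p.615] [cite: Balaban1983Higgs3, (1.16) p.414] -/
theorem map_srcV_box {M' : Type*} [AddCommGroup M'] [Module ℝ M'] (T : ScalarField P 0 N →ₗ[ℝ] M') (w : ScalarField P 0 N) :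
    T (srcV C A B k Ω a w)
      = -(T (∑ b : HiggsLattice.PBond P 0, if Inside Ω b then srcMD C A B b w else 0)
          + T ((P.mesh 0)⁻¹ • ∑ b : HiggsLattice.PBond P 0, if Inside Ω b then srcDM C A B b w else 0)
          + ∑ b : HiggsLattice.PBond P 0, T (if Inside Ω b then srcMM C A B b w else 0))
        - (B1.aSeq a P.L k * ((P.mesh k)⁻¹ ^ 2)) • T (avgSrc C A B k w) := by
  rw [srcV, sum_ite_bondSrc_eq, map_sub, map_neg, map_smul, map_add, map_add,
    map_sum T (fun b => if Inside Ω b then srcMM C A B b w else 0) Finset.univ]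

variable (hmsq : 0 < msq) (ha : 0 < a) (hL1 : 1 < P.L) (hk : 1 ≤ k) (hkK : k ≤ P.K)
  (hΩ : ∀ l, l ≤ k → ∀ x x' : HiggsLattice.Site P 0, blockIter l x = blockIter l x' → (x ∈ Ω ↔ x' ∈ Ω))
include hmsq ha hL1 hk hkK hΩ

omit hmsq ha hL1 hk hkK hΩ in
/-- **The face legs regrouped over a face family** (`sum_src_le`/`sum_tgt_le`: at most `d` bonds per site; `sum_le_sum_cover`: the initial
points of `exB` and the final points of `enB` are covered by the `F_i`; the piecewise differentiated column and the value sum majorised):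
`Σ_{b∈exB}κ^D(b₀,b₋)N_w(b₋) + Σ_{b∈enB}κ^D(b₀,b₊)N_w(b₊) ≤ 2d·Σ_iΣ_{u∈F_i}𝔪_k(ε^dC,1;δ₁)(b₀₋,u)·𝔪_k(c_w,a_w;δ₁)(u,x′)`.
[cite: Balaban1983Higgs3, (2.6) p.424, (2.10) p.426, p.433] [cite: Balaban1982Higgs1, (2.20) p.610, (3.16) p.615] -/
theorem legs_le_faces
    (hpd : ∀ (j : ℕ) (b : HiggsLattice.PBond P 0), Inside Ω b → ∀ y : HiggsLattice.Site P 0,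
      pdcolO C Ω msq a k j B B b y ≤ (P.mesh 0 ^ P.d * Cst) * P.mesh j ^ ((1 : ℝ) - (P.d : ℝ)) *
        Real.exp (-(δ₁ * (P.mesh j)⁻¹ * (P.mesh 0 * (HiggsLattice.Site.tdist b.src y : ℝ)))))
    (hCst : 0 ≤ Cst) {b₀ : HiggsLattice.PBond P 0} (hb₀ : Inside Ω b₀) (x' : HiggsLattice.Site P 0) (wp : ℕ → ScalarField P 0 N)
    {aw cw : ℝ} (hcw : 0 ≤ cw)
    (hwv : ∀ (j : ℕ) (y : HiggsLattice.Site P 0), ‖wp j y‖ ≤ cw * P.mesh j ^ (aw - (P.d : ℝ)) *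
      Real.exp (-(δ₁ * (P.mesh j)⁻¹ * (P.mesh 0 * (HiggsLattice.Site.tdist y x' : ℝ)))))
    {nF : ℕ} (F : Fin nF → Finset (HiggsLattice.Site P 0))
    (hexF : ∀ b ∈ exB Ω A, ∃ i : Fin nF, b.src ∈ F i) (henF : ∀ b ∈ enB Ω A, ∃ i : Fin nF, b.tgt ∈ F i) :
    (∑ b ∈ exB Ω A, (∑ i ∈ Finset.range k, pdcolO C Ω msq a k i B B b₀ b.src) * (∑ j ∈ Finset.range k, ‖wp j b.src‖))
      + ∑ b ∈ enB Ω A, (∑ i ∈ Finset.range k, pdcolO C Ω msq a k i B B b₀ b.tgt) * (∑ j ∈ Finset.range k, ‖wp j b.tgt‖)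
      ≤ 2 * (P.d : ℝ) * ∑ i : Fin nF, ∑ u ∈ F i, maj P k (P.mesh 0 ^ P.d * Cst) 1 δ₁ b₀.src u * maj P k cw aw δ₁ u x' := by
  classical
  have hc : 0 ≤ P.mesh 0 ^ P.d * Cst := mul_nonneg (pow_nonneg (P.mesh_pos 0).le _) hCst
  set h : HiggsLattice.Site P 0 → ℝ := fun u => maj P k (P.mesh 0 ^ P.d * Cst) 1 δ₁ b₀.src u * maj P k cw aw δ₁ u x' with hh
  have hh0 : ∀ u, 0 ≤ h u := fun u => mul_nonneg (maj_nonneg hc _ _) (maj_nonneg hcw _ _)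
  -- the piecewise column and the value sum are majorised at every site
  have hKD : ∀ z, ∑ i ∈ Finset.range k, pdcolO C Ω msq a k i B B b₀ z ≤ maj P k (P.mesh 0 ^ P.d * Cst) 1 δ₁ b₀.src z := fun z => by
    unfold maj; exact Finset.sum_le_sum fun i _ => hpd i b₀ hb₀ z
  have hVw : ∀ z, ∑ j ∈ Finset.range k, ‖wp j z‖ ≤ maj P k cw aw δ₁ z x' := fun z => by
    unfold maj; exact Finset.sum_le_sum fun j _ => hwv j z
  have hprod : ∀ z, (∑ i ∈ Finset.range k, pdcolO C Ω msq a k i B B b₀ z) * (∑ j ∈ Finset.range k, ‖wp j z‖) ≤ h z := fun z =>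
    mul_le_mul (hKD z) (hVw z) (Finset.sum_nonneg fun _ _ => norm_nonneg _) (maj_nonneg hc _ _)
  -- regroup the bonds by their end on the faces
  have hcovS : ∀ y ∈ (exB Ω A).image (fun b => b.src), ∃ i ∈ (Finset.univ : Finset (Fin nF)), y ∈ F i := by
    intro y hy
    obtain ⟨b, hb, rfl⟩ := Finset.mem_image.1 hy
    obtain ⟨i, hi⟩ := hexF b hb
    exact ⟨i, Finset.mem_univ _, hi⟩
  have hcovT : ∀ y ∈ (enB Ω A).image (fun b => b.tgt), ∃ i ∈ (Finset.univ : Finset (Fin nF)), y ∈ F i := by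
    intro y hy
    obtain ⟨b, hb, rfl⟩ := Finset.mem_image.1 hy
    obtain ⟨i, hi⟩ := henF b hb
    exact ⟨i, Finset.mem_univ _, hi⟩
  have hfaces : ∀ S : Finset (HiggsLattice.Site P 0), (∀ y ∈ S, ∃ i ∈ (Finset.univ : Finset (Fin nF)), y ∈ F i) →
      ∑ y ∈ S, h y ≤ ∑ i : Fin nF, ∑ u ∈ F i, h u := by
    intro S hS
    refine (sum_le_sum_cover S Finset.univ (fun i y => y ∈ F i) h (fun y _ => hh0 y) hS).trans ?_
    refine Finset.sum_le_sum fun i _ => ?_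
    exact Finset.sum_le_sum_of_subset_of_nonneg (fun y hy => (Finset.mem_filter.1 hy).2) fun u _ _ => hh0 u
  have hex : ∑ b ∈ exB Ω A, (∑ i ∈ Finset.range k, pdcolO C Ω msq a k i B B b₀ b.src) * (∑ j ∈ Finset.range k, ‖wp j b.src‖)
      ≤ (P.d : ℝ) * ∑ i : Fin nF, ∑ u ∈ F i, h u :=
    calc ∑ b ∈ exB Ω A, (∑ i ∈ Finset.range k, pdcolO C Ω msq a k i B B b₀ b.src) * (∑ j ∈ Finset.range k, ‖wp j b.src‖)
        ≤ ∑ b ∈ exB Ω A, h b.src := Finset.sum_le_sum fun b _ => hprod b.src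
      _ ≤ (P.d : ℝ) * ∑ y ∈ (exB Ω A).image (fun b => b.src), h y := sum_src_le (exB Ω A) h hh0
      _ ≤ (P.d : ℝ) * ∑ i : Fin nF, ∑ u ∈ F i, h u := mul_le_mul_of_nonneg_left (hfaces _ hcovS) (Nat.cast_nonneg _)
  have hen : ∑ b ∈ enB Ω A, (∑ i ∈ Finset.range k, pdcolO C Ω msq a k i B B b₀ b.tgt) * (∑ j ∈ Finset.range k, ‖wp j b.tgt‖)
      ≤ (P.d : ℝ) * ∑ i : Fin nF, ∑ u ∈ F i, h u :=
    calc ∑ b ∈ enB Ω A, (∑ i ∈ Finset.range k, pdcolO C Ω msq a k i B B b₀ b.tgt) * (∑ j ∈ Finset.range k, ‖wp j b.tgt‖)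
        ≤ ∑ b ∈ enB Ω A, h b.tgt := Finset.sum_le_sum fun b _ => hprod b.tgt
      _ ≤ (P.d : ℝ) * ∑ y ∈ (enB Ω A).image (fun b => b.tgt), h y := sum_tgt_le (enB Ω A) h hh0
      _ ≤ (P.d : ℝ) * ∑ i : Fin nF, ∑ u ∈ F i, h u := mul_le_mul_of_nonneg_left (hfaces _ hcovT) (Nat.cast_nonneg _)
  have hsum : (P.d : ℝ) * ∑ i : Fin nF, ∑ u ∈ F i, h u + (P.d : ℝ) * ∑ i : Fin nF, ∑ u ∈ F i, h u
      = 2 * (P.d : ℝ) * ∑ i : Fin nF, ∑ u ∈ F i, h u := by ring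
  rw [← hsum]
  exact add_le_add hex hen

/-- **THE ROW THEOREM ON `Ω` (engine form of the mixed seed on a box).**  On a union `Ω` of `l`-blocks (`l ≤ k`), for backgrounds `A` (small,
`sup|A_b| ≤ s`; (I.2.23)-regular, `δ_A`) and `B` (the per-piece (2.10) dictionary of `G_k(Ω,B)` on `Ω` in its own background: differentiated
columns at bonds `⊂ Ω` with constant `C`, twice-differentiated kernels at pairs of bonds `⊂ Ω` with constant `C_M`), `m² > 0`, `a > 0`,
`1 ≤ k ≤ K`, `0 < δ₁ ≤ 1`, `(L^kε)|e|s ≤ 1`, a face family `F_i` covering the initial points of `exB` and the final points of `enB`, and EVERY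
`Ω`-supported field `w = Σ_{j<k}w_j` whose pieces vanish off `Ω` and obey single-scale bounds of exponents `a_w > 0` (value, every site) and
`a_w − 1` (`D^ε_B`-derivative, bonds `⊂ Ω`) anchored at `x′`, at every bond `b₀ ⊂ Ω`:
`‖(D^ε_BG_k(Ω,B)V_k^Ω(A,B)w)(b₀)‖ ≤ 𝔪_k(|e|s·K₁ + L^k|e|δ_A·K₂, a_w; δ₁/(4L))(b₀₋,x′) + 4dε⁻¹|e|s·Σ_iΣ_{u∈F_i}𝔪_k(ε^dC,1;δ₁)(b₀₋,u)·𝔪_k(c_w,a_w;δ₁)(u,x′)`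
with the TORUS constants `K₁ = seedK1(…)`, `K₂ = seedK2(…)` of `B3Op116MixedSeed` — the regular part of the torus row theorem plus the face sheet
(two Leibniz families × (exiting + entering) legs).  THEOREM A on `Ω` separates the sources; §4 (pairs), §5 (totals), the torus conversions
`md_arith`/`dm_arith`/`mm_arith`/`avg_arith` by name, `legs_le_faces`. [cite: Balaban1983Higgs3, (1.16) p.414, (2.6) p.424, (2.10) p.426, p.433] [cite: Balaban1982Higgs1, (2.23) p.610, (3.14)–(3.16) pp.614–615] -/
theorem phi_row_srcV_le_box (hδ₁ : 0 < δ₁) (hδ₁1 : δ₁ ≤ 1) (hCst : 0 ≤ Cst) (hCM : 0 ≤ CM) (hs : 0 ≤ s) (hδA : 0 ≤ δA)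
    (ht1 : P.mesh k * (|C.e| * s) ≤ 1)
    (hpd : ∀ (j : ℕ) (b : HiggsLattice.PBond P 0), Inside Ω b → ∀ y : HiggsLattice.Site P 0,
      pdcolO C Ω msq a k j B B b y ≤ (P.mesh 0 ^ P.d * Cst) * P.mesh j ^ ((1 : ℝ) - (P.d : ℝ)) *
        Real.exp (-(δ₁ * (P.mesh j)⁻¹ * (P.mesh 0 * (HiggsLattice.Site.tdist b.src y : ℝ)))))
    (hpm : ∀ (j : ℕ) (b₀ b : HiggsLattice.PBond P 0), Inside Ω b₀ → Inside Ω b →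
      pmixO C Ω msq a k j B B b₀ b ≤ (P.mesh 0 ^ P.d * CM) * P.mesh j ^ ((0 : ℝ) - (P.d : ℝ)) *
        Real.exp (-(δ₁ * (P.mesh j)⁻¹ * (P.mesh 0 * (HiggsLattice.Site.tdist b₀.src b.src : ℝ)))))
    (hA : ∀ b : HiggsLattice.PBond P 0, |A b| ≤ s)
    (hreg : ∀ (z : HiggsLattice.Site P 0) (μ ν : Fin P.d), |A ⟨z.shift ν, μ⟩ - A ⟨z, μ⟩| ≤ δA)
    (i₀ : Ix N) {b₀ : HiggsLattice.PBond P 0} (hb₀ : Inside Ω b₀) (x' : HiggsLattice.Site P 0)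
    (w : ScalarField P 0 N) (wp : ℕ → ScalarField P 0 N) (hw : ∑ j ∈ Finset.range k, wp j = w)
    (hw0 : ∀ (j : ℕ) (y : HiggsLattice.Site P 0), y ∉ Ω → wp j y = 0) {aw cw cw' : ℝ} (haw : 0 < aw) (hcw : 0 ≤ cw) (hcw' : 0 ≤ cw')
    (hwv : ∀ (j : ℕ) (y : HiggsLattice.Site P 0), ‖wp j y‖ ≤ cw * P.mesh j ^ (aw - (P.d : ℝ)) *
      Real.exp (-(δ₁ * (P.mesh j)⁻¹ * (P.mesh 0 * (HiggsLattice.Site.tdist y x' : ℝ)))))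
    (hwd : ∀ (j : ℕ) (b : HiggsLattice.PBond P 0), Inside Ω b → ‖covDeriv C B (wp j) b‖ ≤ cw' * P.mesh j ^ (aw - 1 - (P.d : ℝ)) *
      Real.exp (-(δ₁ * (P.mesh j)⁻¹ * (P.mesh 0 * (HiggsLattice.Site.tdist b.src x' : ℝ)))))
    {nF : ℕ} (F : Fin nF → Finset (HiggsLattice.Site P 0))
    (hexF : ∀ b ∈ exB Ω A, ∃ i : Fin nF, b.src ∈ F i) (henF : ∀ b ∈ enB Ω A, ∃ i : Fin nF, b.tgt ∈ F i) :
    ‖covDeriv C B (propagatorK C Ω B msq a k (srcV C A B k Ω a w)) b₀‖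
      ≤ maj P k (|C.e| * s * seedK1 P N δ₁ Cst CM a aw cw cw' + (P.L : ℝ) ^ k * (|C.e| * δA) * seedK2 P N δ₁ Cst aw cw)
            aw (δ₁ / 2 / 2 / P.L) b₀.src x'
        + 4 * (P.d : ℝ) * ((P.mesh 0)⁻¹ * (|C.e| * s)) *
          ∑ i : Fin nF, ∑ u ∈ F i, maj P k (P.mesh 0 ^ P.d * Cst) 1 δ₁ b₀.src u * maj P k cw aw δ₁ u x' := by
  have hles : 0 ≤ (P.mesh 0)⁻¹ * (|C.e| * s) := mul_nonneg (inv_nonneg.mpr (P.mesh_pos 0).le) (mul_nonneg (abs_nonneg _) hs)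
  have hdc := fun y => dcolO_le_majorant (C := C) (Ω := Ω) (B := B) hmsq ha hL1 hk hkK hpd hb₀ y
  -- the four operator bounds (§4, §5)
  have hMD := md_sum_le_box hmsq ha hL1 hk hkK hΩ hδ₁ hδ₁1 hCst hCM hs hδA hpd hpm hA hreg i₀ hb₀ x' w wp hw hw0 haw hcw hcw' hwv hwd
  have hDM := dm_sum_le_box hmsq ha hL1 hk hkK hΩ hδ₁ hδ₁1 hCst hCM hs hδA hpd hpm hA hreg i₀ hb₀ x' w wp hw hw0 haw hcw hcw' hwv hwd
  have hMM := mm_le_box (Ω := Ω) (A := A) hL1 hδ₁ hδ₁1 hCst hs b₀ hdc hA i₀ x' w wp hw haw hcw hwv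
  have hAV := avg_le_box (Ω := Ω) (A := A) hL1 hk hkK hδ₁ hδ₁1 hCst hs b₀ hdc hA i₀ x' w wp hw haw hcw hwv
  have hLEG := legs_le_faces hpd hCst hb₀ x' wp hcw hwv F hexF henF
  -- name the legs
  set LEG : ℝ := (P.mesh 0)⁻¹ * (|C.e| * s) *
    ((∑ b ∈ exB Ω A, (∑ i ∈ Finset.range k, pdcolO C Ω msq a k i B B b₀ b.src) * (∑ j ∈ Finset.range k, ‖wp j b.src‖))
      + ∑ b ∈ enB Ω A, (∑ i ∈ Finset.range k, pdcolO C Ω msq a k i B B b₀ b.tgt) * (∑ j ∈ Finset.range k, ‖wp j b.tgt‖)) with hLEGdef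
  -- THEOREM A through the row functional `D^ε_B(·)(b₀)∘G_k(Ω,B)`, then norms
  have hid := map_srcV_box (C := C) (A := A) (B := B) (Ω := Ω) (k := k) (a := a) (covDerivAt C B b₀ ∘ₗ propagatorK C Ω B msq a k) w
  simp only [LinearMap.coe_comp, Function.comp_apply, covDerivAt_apply] at hid
  have htot : ‖covDeriv C B (propagatorK C Ω B msq a k (srcV C A B k Ω a w)) b₀‖
      ≤ ‖covDeriv C B (propagatorK C Ω B msq a k (∑ b : HiggsLattice.PBond P 0, if Inside Ω b then srcMD C A B b w else 0)) b₀‖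
        + ‖covDeriv C B (propagatorK C Ω B msq a k
            ((P.mesh 0)⁻¹ • ∑ b : HiggsLattice.PBond P 0, if Inside Ω b then srcDM C A B b w else 0)) b₀‖
        + ∑ b : HiggsLattice.PBond P 0, ‖covDeriv C B (propagatorK C Ω B msq a k (if Inside Ω b then srcMM C A B b w else 0)) b₀‖
        + |B1.aSeq a P.L k * (P.mesh k)⁻¹ ^ 2| *
          ‖covDeriv C B (propagatorK C Ω B msq a k (avgSrc C A B k w)) b₀‖ := by
    rw [hid]
    refine (norm_sub_le _ _).trans (add_le_add ?_ ?_)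
    · rw [norm_neg]
      exact (norm_add_le _ _).trans (add_le_add ((norm_add_le _ _).trans le_rfl) (norm_sum_le _ _))
    · rw [norm_smul, Real.norm_eq_abs]
  -- the four conversions (torus §6.1, the two Leibniz families net of their legs) and the bookkeeping of `K₁`, `K₂`
  have hMD' := md_arith (C := C) (N := N) (k := k) hL1 haw hCst hCM hcw hcw' hs hδA hδ₁ b₀.src x' (sub_le_iff_le_add.2 hMD)
  have hDM' := dm_arith (C := C) (N := N) (k := k) hL1 haw hCst hCM hcw hcw' hs hδA hδ₁ b₀.src x' (sub_le_iff_le_add.2 hDM)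
  have hMM' := mm_arith (C := C) (N := N) (k := k) hL1 haw hCst hcw hs hδ₁ ht1 b₀.src x' hMM
  have hAV' := avg_arith (C := C) (N := N) hL1 ha hk haw hCst hcw hs hδ₁ ht1 b₀.src x' (norm_nonneg _) hAV
  -- hide the sheet, display the regular part as a constant times the standard sum, and add up
  set SH : ℝ := ∑ i : Fin nF, ∑ u ∈ F i, maj P k (P.mesh 0 ^ P.d * Cst) 1 δ₁ b₀.src u * maj P k cw aw δ₁ u x' with hSH
  have hLEG' : LEG ≤ (P.mesh 0)⁻¹ * (|C.e| * s) * (2 * (P.d : ℝ) * SH) := by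
    rw [hLEGdef]; exact mul_le_mul_of_nonneg_left hLEG hles
  have hlegs2 : LEG + LEG ≤ 4 * (P.d : ℝ) * ((P.mesh 0)⁻¹ * (|C.e| * s)) * SH := by linarith [hLEG']
  rw [← mul_sumS_eq_maj]
  simp only [seedK1, seedK2]
  linarith [htot, hMD', hDM', hMM', hAV', hlegs2]

end RowTheorem

/-! ## §7 The instances on `Ω`: `W = G_k(Ω,A+B) − G_k(Ω,B)` on a dipole `dip^B_{b′}Y` (`b′ ⊂ Ω`) through one row derivative (THE MIXED
SEED ON A BOX, value exponent 1, sheet displayed), `W` on a point source (exponent 2), and the value of `W` on the dipole (symmetry of `W`) -/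

section Instances

variable {C : ChargeData N} {Ω : Finset (HiggsLattice.Site P 0)} {A B : HiggsLattice.VecField P 0} {msq a : ℝ} {k : ℕ}
  {δ₁ Cst CM s δA : ℝ}

/-- A dipole across a bond `⊂ Ω` vanishes off `Ω`. [cite: Balaban1982Higgs1, (1.7) p.605] -/
theorem dip_apply_eq_zero_of_inside (X' : HiggsLattice.VecField P 0) {b' : HiggsLattice.PBond P 0} (hb' : Inside Ω b')
    {y : HiggsLattice.Site P 0} (hy : y ∉ Ω) (Y : E N) : dip C X' b' Y y = 0 := by
  rw [dip, Pi.sub_apply, Pi.single_eq_of_ne (fun h : y = b'.tgt => hy (h ▸ hb'.2)),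
    Pi.single_eq_of_ne (fun h : y = b'.src => hy (h ▸ hb'.1)), sub_zero]

/-- A basis vector at a site of `Ω` vanishes off `Ω`. [cite: Balaban1982Higgs1, (1.5) p.604] -/
theorem cb_apply_eq_zero_of_mem {x : HiggsLattice.Site P 0} (hx : x ∈ Ω) (i : Ix N) {y : HiggsLattice.Site P 0} (hy : y ∉ Ω) :
    (cb P N 0 (x, i) : ScalarField P 0 N) y = 0 := by
  rw [B3Ineq210MixedRegularTorus.cb_eq_single, Pi.single_eq_of_ne (fun h : y = x => hy (h ▸ hx))]

/-- **The `D^ε_B`-differentiated column of a piece of `G_k(Ω,A+B)` through the split `D^ε_B = D^ε_{A+B} − M`**: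
`pdcolO j B (A+B) b y ≤ pdcolO j (A+B) (A+B) b y + |e|s·pcolO j (A+B) b₊ y`. [cite: Balaban1982Higgs1, (3.14) p.614] [cite: Balaban1983Higgs3, (2.6) p.424] -/
theorem pdcolO_cross_le (j : ℕ) (hA : ∀ b : HiggsLattice.PBond P 0, |A b| ≤ s) (b : HiggsLattice.PBond P 0) (y : HiggsLattice.Site P 0) :
    pdcolO C Ω msq a k j B (A + B) b y ≤ pdcolO C Ω msq a k j (A + B) (A + B) b y + |C.e| * s * pcolO C Ω msq a k j (A + B) b.tgt y := by
  unfold pdcolO pcolO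
  rw [Finset.mul_sum, ← Finset.sum_add_distrib]
  exact Finset.sum_le_sum fun i _ => norm_covDeriv_le_add_split C A B (hA b) _

/-- **(2.10) for the `D^ε_B`-differentiated column of a piece of `G_k(Ω,A+B)` at a bond `b ⊂ Ω`, `j < k`**:
`pdcolO j B (A+B) b y ≤ ε^dC(1 + e)(L^jε)^{1−d}e_j(b₋,y)` (the `M`-part has the exponent 2, one unit of which is `≤ L^kε`, and `(L^kε)|e|s ≤ 1`; its
bump sits at `b₊ ∈ Ω`, one step from `b₋`). [cite: Balaban1983Higgs3, (2.6) p.424, (2.10) p.426] [cite: Balaban1982Higgs1, (3.14) p.614] -/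
theorem pdcolO_cross_bound {j : ℕ} (hjk : j < k) (hδ₁ : 0 < δ₁) (hδ₁1 : δ₁ ≤ 1) (hCst : 0 ≤ Cst) (hs : 0 ≤ s)
    (ht1 : P.mesh k * (|C.e| * s) ≤ 1)
    (hpdAB : ∀ (j : ℕ) (b : HiggsLattice.PBond P 0), Inside Ω b → ∀ y : HiggsLattice.Site P 0,
      pdcolO C Ω msq a k j (A + B) (A + B) b y ≤ (P.mesh 0 ^ P.d * Cst) * P.mesh j ^ ((1 : ℝ) - (P.d : ℝ)) *
        Real.exp (-(δ₁ * (P.mesh j)⁻¹ * (P.mesh 0 * (HiggsLattice.Site.tdist b.src y : ℝ)))))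
    (hpcAB : ∀ (j : ℕ) (x : HiggsLattice.Site P 0), x ∈ Ω → ∀ y : HiggsLattice.Site P 0,
      pcolO C Ω msq a k j (A + B) x y ≤ (P.mesh 0 ^ P.d * Cst) * P.mesh j ^ ((2 : ℝ) - (P.d : ℝ)) *
        Real.exp (-(δ₁ * (P.mesh j)⁻¹ * (P.mesh 0 * (HiggsLattice.Site.tdist x y : ℝ)))))
    (hA : ∀ b : HiggsLattice.PBond P 0, |A b| ≤ s) {b : HiggsLattice.PBond P 0} (hb : Inside Ω b) (y : HiggsLattice.Site P 0) :
    pdcolO C Ω msq a k j B (A + B) b y ≤ (P.mesh 0 ^ P.d * Cst) * (1 + Real.exp 1) * P.mesh j ^ ((1 : ℝ) - (P.d : ℝ)) *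
        Real.exp (-(δ₁ * (P.mesh j)⁻¹ * (P.mesh 0 * (HiggsLattice.Site.tdist b.src y : ℝ)))) := by
  have hes : 0 ≤ |C.e| * s := mul_nonneg (abs_nonneg _) hs
  have hc : 0 ≤ P.mesh 0 ^ P.d * Cst := mul_nonneg (pow_nonneg (P.mesh_pos 0).le _) hCst
  have hm1 : 0 ≤ P.mesh j ^ ((1 : ℝ) - (P.d : ℝ)) := Real.rpow_nonneg (P.mesh_pos j).le _
  have hm2 : 0 ≤ P.mesh j ^ ((2 : ℝ) - (P.d : ℝ)) := Real.rpow_nonneg (P.mesh_pos j).le _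
  have hshift : Real.exp (-(δ₁ * (P.mesh j)⁻¹ * (P.mesh 0 * (HiggsLattice.Site.tdist b.tgt y : ℝ))))
      ≤ Real.exp 1 * Real.exp (-(δ₁ * (P.mesh j)⁻¹ * (P.mesh 0 * (HiggsLattice.Site.tdist b.src y : ℝ)))) :=
    bump_shift_le' hδ₁.le hδ₁1 j b.src y b.dir
  have hmesh : P.mesh j ^ ((2 : ℝ) - (P.d : ℝ)) = P.mesh j * P.mesh j ^ ((1 : ℝ) - (P.d : ℝ)) := by
    rw [show (2 : ℝ) - (P.d : ℝ) = 1 + ((1 : ℝ) - (P.d : ℝ)) by ring, ← mesh_rpow_add, Real.rpow_one]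
  have hjle : P.mesh j * (|C.e| * s) ≤ 1 :=
    (mul_le_mul_of_nonneg_right (B3Ineq210RegularTorus.mesh_mono P hjk.le) hes).trans ht1
  set Ex : ℝ := Real.exp (-(δ₁ * (P.mesh j)⁻¹ * (P.mesh 0 * (HiggsLattice.Site.tdist b.src y : ℝ)))) with hEx
  have hE0 : 0 ≤ Ex := Real.exp_nonneg _
  calc pdcolO C Ω msq a k j B (A + B) b y
      ≤ pdcolO C Ω msq a k j (A + B) (A + B) b y + |C.e| * s * pcolO C Ω msq a k j (A + B) b.tgt y := pdcolO_cross_le j hA b y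
    _ ≤ (P.mesh 0 ^ P.d * Cst) * P.mesh j ^ ((1 : ℝ) - (P.d : ℝ)) * Ex
        + |C.e| * s * ((P.mesh 0 ^ P.d * Cst) * P.mesh j ^ ((2 : ℝ) - (P.d : ℝ)) * (Real.exp 1 * Ex)) :=
        add_le_add (hpdAB j b hb y)
          (mul_le_mul_of_nonneg_left ((hpcAB j b.tgt hb.2 y).trans (mul_le_mul_of_nonneg_left hshift (mul_nonneg hc hm2))) hes)
    _ = (P.mesh 0 ^ P.d * Cst) * P.mesh j ^ ((1 : ℝ) - (P.d : ℝ)) * Ex * (1 + (P.mesh j * (|C.e| * s)) * Real.exp 1) := by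
        rw [hmesh]; ring
    _ ≤ (P.mesh 0 ^ P.d * Cst) * P.mesh j ^ ((1 : ℝ) - (P.d : ℝ)) * Ex * (1 + 1 * Real.exp 1) :=
        mul_le_mul_of_nonneg_left (add_le_add le_rfl (mul_le_mul_of_nonneg_right hjle (Real.exp_nonneg 1)))
          (mul_nonneg (mul_nonneg hc hm1) hE0)
    _ = _ := by ring

/-- **The VALUE of a piece of `G_k(Ω,A+B)` on the `B`-dipole `dip^B_{b′}Y`, `b′ ⊂ Ω`, `j < k`** (piece symmetry `norm_pieceR_dip_apply_le` on `Ω` +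
`pdcolO_cross_bound`): `‖(G^η_{(j)}(Ω,A+B)dip^B_{b′}Y)(y)‖ ≤ ε‖Y‖ε^dC(1+e)(L^jε)^{1−d}e_j(y,b′₋)` — exponent `a_w = 1`, anchor `b′₋`.
[cite: Balaban1983Higgs3, (2.6) p.424, (2.10) p.426] [cite: Balaban1982Higgs1, (1.7) p.605, (3.14) p.614] -/
theorem norm_pieceR_dipB_le_box {j : ℕ} (hjk : j < k) (hδ₁ : 0 < δ₁) (hδ₁1 : δ₁ ≤ 1) (hCst : 0 ≤ Cst) (hs : 0 ≤ s)
    (ht1 : P.mesh k * (|C.e| * s) ≤ 1)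
    (hpdAB : ∀ (j : ℕ) (b : HiggsLattice.PBond P 0), Inside Ω b → ∀ y : HiggsLattice.Site P 0,
      pdcolO C Ω msq a k j (A + B) (A + B) b y ≤ (P.mesh 0 ^ P.d * Cst) * P.mesh j ^ ((1 : ℝ) - (P.d : ℝ)) *
        Real.exp (-(δ₁ * (P.mesh j)⁻¹ * (P.mesh 0 * (HiggsLattice.Site.tdist b.src y : ℝ)))))
    (hpcAB : ∀ (j : ℕ) (x : HiggsLattice.Site P 0), x ∈ Ω → ∀ y : HiggsLattice.Site P 0,
      pcolO C Ω msq a k j (A + B) x y ≤ (P.mesh 0 ^ P.d * Cst) * P.mesh j ^ ((2 : ℝ) - (P.d : ℝ)) *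
        Real.exp (-(δ₁ * (P.mesh j)⁻¹ * (P.mesh 0 * (HiggsLattice.Site.tdist x y : ℝ)))))
    (hA : ∀ b : HiggsLattice.PBond P 0, |A b| ≤ s) {b' : HiggsLattice.PBond P 0} (hb' : Inside Ω b') (Y : E N)
    (y : HiggsLattice.Site P 0) :
    ‖pieceR C Ω (A + B) msq a k j (dip C B b' Y) y‖
      ≤ (P.mesh 0 * ‖Y‖ * ((P.mesh 0 ^ P.d * Cst) * (1 + Real.exp 1))) * P.mesh j ^ ((1 : ℝ) - (P.d : ℝ)) *
          Real.exp (-(δ₁ * (P.mesh j)⁻¹ * (P.mesh 0 * (HiggsLattice.Site.tdist y b'.src : ℝ)))) := by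
  have h := norm_pieceR_dip_apply_le C Ω (A + B) msq a B k j b' Y y
  have h2 := pdcolO_cross_bound hjk hδ₁ hδ₁1 hCst hs ht1 hpdAB hpcAB hA hb' y
  rw [tdist_comm y b'.src]
  calc ‖pieceR C Ω (A + B) msq a k j (dip C B b' Y) y‖
      ≤ P.mesh 0 * ‖Y‖ * pdcolO C Ω msq a k j B (A + B) b' y := h
    _ ≤ P.mesh 0 * ‖Y‖ * ((P.mesh 0 ^ P.d * Cst) * (1 + Real.exp 1) * P.mesh j ^ ((1 : ℝ) - (P.d : ℝ)) *
          Real.exp (-(δ₁ * (P.mesh j)⁻¹ * (P.mesh 0 * (HiggsLattice.Site.tdist b'.src y : ℝ))))) :=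
        mul_le_mul_of_nonneg_left h2 (mul_nonneg (P.mesh_pos 0).le (norm_nonneg _))
    _ = _ := by ring

/-- **The `D^ε_B`-DERIVATIVE of a piece of `G_k(Ω,A+B)` on the `B`-dipole at a bond `b ⊂ Ω`, `b′ ⊂ Ω`, `j < k`**:
`‖(D^ε_BG^η_{(j)}(Ω,A+B)dip^B_{b′}Y)(b)‖ ≤ ε‖Y‖(ε^dC_M + ε^dC·e + ε^dC(1+e)e)(L^jε)^{−d}e_j(b₋,b′₋)` — exponent `a_w − 1 = 0` (torus
`norm_covDeriv_pieceR_dipB_le` line by line on `Ω`). [cite: Balaban1983Higgs3, (2.6) p.424, (2.10) p.426] [cite: Balaban1982Higgs1, (1.7) p.605, (3.14) p.614] -/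
theorem norm_covDeriv_pieceR_dipB_le_box {j : ℕ} (hjk : j < k) (hδ₁ : 0 < δ₁) (hδ₁1 : δ₁ ≤ 1) (hCst : 0 ≤ Cst)
    (hs : 0 ≤ s) (ht1 : P.mesh k * (|C.e| * s) ≤ 1)
    (hpdAB : ∀ (j : ℕ) (b : HiggsLattice.PBond P 0), Inside Ω b → ∀ y : HiggsLattice.Site P 0,
      pdcolO C Ω msq a k j (A + B) (A + B) b y ≤ (P.mesh 0 ^ P.d * Cst) * P.mesh j ^ ((1 : ℝ) - (P.d : ℝ)) *
        Real.exp (-(δ₁ * (P.mesh j)⁻¹ * (P.mesh 0 * (HiggsLattice.Site.tdist b.src y : ℝ)))))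
    (hpcAB : ∀ (j : ℕ) (x : HiggsLattice.Site P 0), x ∈ Ω → ∀ y : HiggsLattice.Site P 0,
      pcolO C Ω msq a k j (A + B) x y ≤ (P.mesh 0 ^ P.d * Cst) * P.mesh j ^ ((2 : ℝ) - (P.d : ℝ)) *
        Real.exp (-(δ₁ * (P.mesh j)⁻¹ * (P.mesh 0 * (HiggsLattice.Site.tdist x y : ℝ)))))
    (hpmAB : ∀ (j : ℕ) (b₀ b : HiggsLattice.PBond P 0), Inside Ω b₀ → Inside Ω b →
      pmixO C Ω msq a k j (A + B) (A + B) b₀ b ≤ (P.mesh 0 ^ P.d * CM) * P.mesh j ^ ((0 : ℝ) - (P.d : ℝ)) *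
        Real.exp (-(δ₁ * (P.mesh j)⁻¹ * (P.mesh 0 * (HiggsLattice.Site.tdist b₀.src b.src : ℝ)))))
    (hA : ∀ b : HiggsLattice.PBond P 0, |A b| ≤ s) {b' : HiggsLattice.PBond P 0} (hb' : Inside Ω b') (Y : E N)
    {b : HiggsLattice.PBond P 0} (hb : Inside Ω b) :
    ‖covDeriv C B (pieceR C Ω (A + B) msq a k j (dip C B b' Y)) b‖
      ≤ (P.mesh 0 * ‖Y‖ * (P.mesh 0 ^ P.d * CM + (P.mesh 0 ^ P.d * Cst) * Real.exp 1
            + (P.mesh 0 ^ P.d * Cst) * (1 + Real.exp 1) * Real.exp 1)) * P.mesh j ^ ((1 : ℝ) - 1 - (P.d : ℝ)) *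
          Real.exp (-(δ₁ * (P.mesh j)⁻¹ * (P.mesh 0 * (HiggsLattice.Site.tdist b.src b'.src : ℝ)))) := by
  have hε := P.mesh_pos 0
  have hes : 0 ≤ |C.e| * s := mul_nonneg (abs_nonneg _) hs
  have hc : 0 ≤ P.mesh 0 ^ P.d * Cst := mul_nonneg (pow_nonneg hε.le _) hCst
  have hm1 : 0 ≤ P.mesh j ^ ((1 : ℝ) - (P.d : ℝ)) := Real.rpow_nonneg (P.mesh_pos j).le _
  have hjle : P.mesh j * (|C.e| * s) ≤ 1 :=
    (mul_le_mul_of_nonneg_right (B3Ineq210RegularTorus.mesh_mono P hjk.le) hes).trans ht1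
  set Ex : ℝ := Real.exp (-(δ₁ * (P.mesh j)⁻¹ * (P.mesh 0 * (HiggsLattice.Site.tdist b.src b'.src : ℝ)))) with hEx
  have hE0 : 0 ≤ Ex := Real.exp_nonneg _
  set v : E N := C.U (P.mesh 0) (-(B b')) Y - C.U (P.mesh 0) (-((A + B) b')) Y with hv
  have hvn : ‖v‖ ≤ P.mesh 0 * (|C.e| * s) * ‖Y‖ := norm_U_sub_U_add_le (hA b') Y
  -- the split `D^ε_B = D^ε_{A+B} − M`
  have h1 := norm_covDeriv_le_add_split C A B (hA b) (pieceR C Ω (A + B) msq a k j (dip C B b' Y))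
  -- `dip^B = dip^{A+B} + δ_{b′₊}v`
  have h2 : pieceR C Ω (A + B) msq a k j (dip C B b' Y)
      = pieceR C Ω (A + B) msq a k j (dip C (A + B) b' Y) + pieceR C Ω (A + B) msq a k j (Pi.single b'.tgt v) := by
    rw [dip_eq_dip_add_single, map_add]
  -- the twice-differentiated piece in its own background
  have h3 : ‖covDeriv C (A + B) (pieceR C Ω (A + B) msq a k j (dip C (A + B) b' Y)) b‖
      ≤ ‖Y‖ * (P.mesh 0 * ((P.mesh 0 ^ P.d * CM) * P.mesh j ^ ((0 : ℝ) - (P.d : ℝ)) * Ex)) := by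
    have h := norm_mapE_dip_le (C := C) (B := A + B) (covDerivAt C (A + B) b ∘ₗ pieceR C Ω (A + B) msq a k j) b' Y
    simp only [phiO_apply] at h
    refine h.trans (mul_le_mul_of_nonneg_left ?_ (norm_nonneg _))
    have h' : ∑ i : Ix N, ‖covDeriv C (A + B) (pieceR C Ω (A + B) msq a k j (dip C (A + B) b' (onb N i))) b‖
        = P.mesh 0 * pmixO C Ω msq a k j (A + B) (A + B) b b' := by
      rw [pmixO, ← mul_assoc, mul_inv_cancel₀ hε.ne', one_mul]
    rw [h']
    exact mul_le_mul_of_nonneg_left (hpmAB j b b' hb hb') hε.le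
  -- the differentiated column at `b′₊`, shifted back to `b′₋`
  have h4 : ‖covDeriv C (A + B) (pieceR C Ω (A + B) msq a k j (Pi.single b'.tgt v)) b‖
      ≤ (P.mesh 0 * (|C.e| * s) * ‖Y‖) * ((P.mesh 0 ^ P.d * Cst) * P.mesh j ^ ((1 : ℝ) - (P.d : ℝ)) * (Real.exp 1 * Ex)) := by
    refine (norm_phiO_single_le (A + B) (A + B) j b b'.tgt v).trans ?_
    refine mul_le_mul hvn ?_ (pdcolO_nonneg _ _ _ _) (by positivity)
    refine (hpdAB j b hb b'.tgt).trans ?_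
    exact mul_le_mul_of_nonneg_left (bump_shift_le hδ₁.le hδ₁1 j b.src b'.src b'.dir) (mul_nonneg hc hm1)
  -- the value at `b₊`, shifted back to `b₋`
  have h5 : ‖pieceR C Ω (A + B) msq a k j (dip C B b' Y) b.tgt‖
      ≤ (P.mesh 0 * ‖Y‖ * ((P.mesh 0 ^ P.d * Cst) * (1 + Real.exp 1))) * P.mesh j ^ ((1 : ℝ) - (P.d : ℝ)) * (Real.exp 1 * Ex) := by
    refine (norm_pieceR_dipB_le_box hjk hδ₁ hδ₁1 hCst hs ht1 hpdAB hpcAB hA hb' Y b.tgt).trans ?_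
    exact mul_le_mul_of_nonneg_left (bump_shift_le' hδ₁.le hδ₁1 j b.src b'.src b.dir) (by positivity)
  have h6 : ‖covDeriv C (A + B) (pieceR C Ω (A + B) msq a k j (dip C B b' Y)) b‖
      ≤ ‖Y‖ * (P.mesh 0 * ((P.mesh 0 ^ P.d * CM) * P.mesh j ^ ((0 : ℝ) - (P.d : ℝ)) * Ex))
        + (P.mesh 0 * (|C.e| * s) * ‖Y‖) * ((P.mesh 0 ^ P.d * Cst) * P.mesh j ^ ((1 : ℝ) - (P.d : ℝ)) * (Real.exp 1 * Ex)) := by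
    rw [h2, B3Ineq210RegularTorus.covDeriv_add'']
    exact (norm_add_le _ _).trans (add_le_add h3 h4)
  -- exponents: `(L^jε)^{1−d} = (L^jε)·(L^jε)^{0−d}`
  have hm10 : P.mesh j ^ ((1 : ℝ) - (P.d : ℝ)) = P.mesh j * P.mesh j ^ ((1 : ℝ) - 1 - (P.d : ℝ)) := by
    rw [show (1 : ℝ) - (P.d : ℝ) = 1 + ((1 : ℝ) - 1 - (P.d : ℝ)) by ring, ← mesh_rpow_add, Real.rpow_one]
  have hm00 : P.mesh j ^ ((0 : ℝ) - (P.d : ℝ)) = P.mesh j ^ ((1 : ℝ) - 1 - (P.d : ℝ)) := by norm_num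
  have hm0 : 0 ≤ P.mesh j ^ ((1 : ℝ) - 1 - (P.d : ℝ)) := Real.rpow_nonneg (P.mesh_pos j).le _
  calc ‖covDeriv C B (pieceR C Ω (A + B) msq a k j (dip C B b' Y)) b‖
      ≤ ‖covDeriv C (A + B) (pieceR C Ω (A + B) msq a k j (dip C B b' Y)) b‖
        + |C.e| * s * ‖pieceR C Ω (A + B) msq a k j (dip C B b' Y) b.tgt‖ := h1
    _ ≤ ‖Y‖ * (P.mesh 0 * ((P.mesh 0 ^ P.d * CM) * P.mesh j ^ ((0 : ℝ) - (P.d : ℝ)) * Ex))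
        + (P.mesh 0 * (|C.e| * s) * ‖Y‖) * ((P.mesh 0 ^ P.d * Cst) * P.mesh j ^ ((1 : ℝ) - (P.d : ℝ)) * (Real.exp 1 * Ex))
        + |C.e| * s * ((P.mesh 0 * ‖Y‖ * ((P.mesh 0 ^ P.d * Cst) * (1 + Real.exp 1))) * P.mesh j ^ ((1 : ℝ) - (P.d : ℝ)) *
          (Real.exp 1 * Ex)) := add_le_add h6 (mul_le_mul_of_nonneg_left h5 hes)
    _ = P.mesh 0 * ‖Y‖ * P.mesh j ^ ((1 : ℝ) - 1 - (P.d : ℝ)) * Ex *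
          (P.mesh 0 ^ P.d * CM + (P.mesh j * (|C.e| * s)) * ((P.mesh 0 ^ P.d * Cst) * Real.exp 1
            + (P.mesh 0 ^ P.d * Cst) * (1 + Real.exp 1) * Real.exp 1)) := by
        rw [hm10, hm00]; ring
    _ ≤ P.mesh 0 * ‖Y‖ * P.mesh j ^ ((1 : ℝ) - 1 - (P.d : ℝ)) * Ex *
          (P.mesh 0 ^ P.d * CM + 1 * ((P.mesh 0 ^ P.d * Cst) * Real.exp 1
            + (P.mesh 0 ^ P.d * Cst) * (1 + Real.exp 1) * Real.exp 1)) :=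
        mul_le_mul_of_nonneg_left (add_le_add le_rfl (mul_le_mul_of_nonneg_right hjle
          (by positivity : (0 : ℝ) ≤ (P.mesh 0 ^ P.d * Cst) * Real.exp 1 + (P.mesh 0 ^ P.d * Cst) * (1 + Real.exp 1) * Real.exp 1)))
          (by positivity)
    _ = _ := by ring

variable (hmsq : 0 < msq) (ha : 0 < a) (hL1 : 1 < P.L) (hk : 1 ≤ k) (hkK : k ≤ P.K)
  (hΩ : ∀ l, l ≤ k → ∀ x x' : HiggsLattice.Site P 0, blockIter l x = blockIter l x' → (x ∈ Ω ↔ x' ∈ Ω))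
include hmsq ha hL1 hk hkK hΩ

omit hkK hΩ in
/-- **(I.3.44) + THEOREM A on `Ω`**: `(G_k(Ω,A+B) − G_k(Ω,B))φ = G_k(Ω,B)V_k^Ω(A,B)G_k(Ω,A+B)φ`. [cite: Balaban1982Higgs1, (3.16) p.615, (3.44) p.619] -/
theorem W_apply_eq (φ : ScalarField P 0 N) :
    (propagatorK C Ω (A + B) msq a k - propagatorK C Ω B msq a k) φ
      = propagatorK C Ω B msq a k (srcV C A B k Ω a (propagatorK C Ω (A + B) msq a k φ)) := by
  have hL1' : (1 : ℝ) < (P.L : ℝ) := by exact_mod_cast hL1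
  have hak : 0 ≤ B1.aSeq a P.L k := (B1.aSeq_pos ha hL1' hk).le
  rw [sub_eq_iff_eq_add'.mpr (B3Eq116TwoSidedExpansion.eq344_model C Ω A B a k hmsq hak), Module.End.mul_apply,
    Module.End.mul_apply, B3Op116SourceForm.opV_apply_eq_srcV]

/-- **THE MIXED SEED ON `Ω` (row side).**  On a union `Ω` of `l`-blocks (`l ≤ k`), for `A` small and regular and the per-piece dictionaries
of `G_k(Ω,B)`, `G_k(Ω,A+B)` on `Ω`, `m² > 0`, `a > 0`, `1 ≤ k ≤ K`, `0 < δ₁ ≤ 1`, `(L^kε)|e|s ≤ 1`, a face family covering the ends in `Ω` of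
the charged bonds crossing `∂Ω`, every row bond `b₀ ⊂ Ω`, dipole bond `b′ ⊂ Ω` and charge `Y`:
`‖(D^ε_B[G_k(Ω,A+B) − G_k(Ω,B)]dip^B_{b′}Y)(b₀)‖ ≤ 𝔪_k(|e|s·K₁ + L^k|e|δ_A·K₂, 1; δ₁/(4L))(b₀₋,b′₋)
+ 4dε⁻¹|e|s·Σ_iΣ_{u∈F_i}𝔪_k(ε^dC,1;δ₁)(b₀₋,u)·𝔪_k(c_w,1;δ₁)(u,b′₋)` with the TORUS constants `K₁ = seedK1(…,1,c_w,c_w′)`, `K₂ = seedK2(…,1,c_w)`,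
`c_w = ε‖Y‖ε^dC(1+e)`, `c_w′ = ε‖Y‖(ε^dC_M + ε^dCe + ε^dC(1+e)e)` — the torus seed `B3Op116MixedSeed.mixed_seed_le` plus the face sheet of the
route γ′ (no support clause on `A`). [cite: Balaban1983Higgs3, (1.16) p.414, (2.6) p.424, (2.10) p.426, p.433] [cite: Balaban1982Higgs1, (3.16) p.615, (3.44) p.619] -/
theorem mixed_seed_le_box (hδ₁ : 0 < δ₁) (hδ₁1 : δ₁ ≤ 1) (hCst : 0 ≤ Cst) (hCM : 0 ≤ CM) (hs : 0 ≤ s) (hδA : 0 ≤ δA)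
    (ht1 : P.mesh k * (|C.e| * s) ≤ 1)
    (hpdB : ∀ (j : ℕ) (b : HiggsLattice.PBond P 0), Inside Ω b → ∀ y : HiggsLattice.Site P 0,
      pdcolO C Ω msq a k j B B b y ≤ (P.mesh 0 ^ P.d * Cst) * P.mesh j ^ ((1 : ℝ) - (P.d : ℝ)) *
        Real.exp (-(δ₁ * (P.mesh j)⁻¹ * (P.mesh 0 * (HiggsLattice.Site.tdist b.src y : ℝ)))))
    (hpmB : ∀ (j : ℕ) (b₀ b : HiggsLattice.PBond P 0), Inside Ω b₀ → Inside Ω b →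
      pmixO C Ω msq a k j B B b₀ b ≤ (P.mesh 0 ^ P.d * CM) * P.mesh j ^ ((0 : ℝ) - (P.d : ℝ)) *
        Real.exp (-(δ₁ * (P.mesh j)⁻¹ * (P.mesh 0 * (HiggsLattice.Site.tdist b₀.src b.src : ℝ)))))
    (hpdAB : ∀ (j : ℕ) (b : HiggsLattice.PBond P 0), Inside Ω b → ∀ y : HiggsLattice.Site P 0,
      pdcolO C Ω msq a k j (A + B) (A + B) b y ≤ (P.mesh 0 ^ P.d * Cst) * P.mesh j ^ ((1 : ℝ) - (P.d : ℝ)) *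
        Real.exp (-(δ₁ * (P.mesh j)⁻¹ * (P.mesh 0 * (HiggsLattice.Site.tdist b.src y : ℝ)))))
    (hpcAB : ∀ (j : ℕ) (x : HiggsLattice.Site P 0), x ∈ Ω → ∀ y : HiggsLattice.Site P 0,
      pcolO C Ω msq a k j (A + B) x y ≤ (P.mesh 0 ^ P.d * Cst) * P.mesh j ^ ((2 : ℝ) - (P.d : ℝ)) *
        Real.exp (-(δ₁ * (P.mesh j)⁻¹ * (P.mesh 0 * (HiggsLattice.Site.tdist x y : ℝ)))))
    (hpmAB : ∀ (j : ℕ) (b₀ b : HiggsLattice.PBond P 0), Inside Ω b₀ → Inside Ω b →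
      pmixO C Ω msq a k j (A + B) (A + B) b₀ b ≤ (P.mesh 0 ^ P.d * CM) * P.mesh j ^ ((0 : ℝ) - (P.d : ℝ)) *
        Real.exp (-(δ₁ * (P.mesh j)⁻¹ * (P.mesh 0 * (HiggsLattice.Site.tdist b₀.src b.src : ℝ)))))
    (hA : ∀ b : HiggsLattice.PBond P 0, |A b| ≤ s)
    (hreg : ∀ (z : HiggsLattice.Site P 0) (μ ν : Fin P.d), |A ⟨z.shift ν, μ⟩ - A ⟨z, μ⟩| ≤ δA)
    {nF : ℕ} (F : Fin nF → Finset (HiggsLattice.Site P 0))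
    (hexF : ∀ b ∈ exB Ω A, ∃ i : Fin nF, b.src ∈ F i) (henF : ∀ b ∈ enB Ω A, ∃ i : Fin nF, b.tgt ∈ F i)
    (i₀ : Ix N) {b₀ b' : HiggsLattice.PBond P 0} (hb₀ : Inside Ω b₀) (hb' : Inside Ω b') (Y : E N) :
    ‖covDeriv C B ((propagatorK C Ω (A + B) msq a k - propagatorK C Ω B msq a k) (dip C B b' Y)) b₀‖
      ≤ maj P k (|C.e| * s * seedK1 P N δ₁ Cst CM a 1 (P.mesh 0 * ‖Y‖ * ((P.mesh 0 ^ P.d * Cst) * (1 + Real.exp 1)))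
              (P.mesh 0 * ‖Y‖ * (P.mesh 0 ^ P.d * CM + (P.mesh 0 ^ P.d * Cst) * Real.exp 1
                + (P.mesh 0 ^ P.d * Cst) * (1 + Real.exp 1) * Real.exp 1))
            + (P.L : ℝ) ^ k * (|C.e| * δA) * seedK2 P N δ₁ Cst 1 (P.mesh 0 * ‖Y‖ * ((P.mesh 0 ^ P.d * Cst) * (1 + Real.exp 1))))
          1 (δ₁ / 2 / 2 / P.L) b₀.src b'.src
        + 4 * (P.d : ℝ) * ((P.mesh 0)⁻¹ * (|C.e| * s)) *
          ∑ i : Fin nF, ∑ u ∈ F i, maj P k (P.mesh 0 ^ P.d * Cst) 1 δ₁ b₀.src u *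
            maj P k (P.mesh 0 * ‖Y‖ * ((P.mesh 0 ^ P.d * Cst) * (1 + Real.exp 1))) 1 δ₁ u b'.src := by
  have hε := P.mesh_pos 0
  have hcw0 : 0 ≤ P.mesh 0 * ‖Y‖ * ((P.mesh 0 ^ P.d * Cst) * (1 + Real.exp 1)) := by positivity
  have hcw0' : 0 ≤ P.mesh 0 * ‖Y‖ * (P.mesh 0 ^ P.d * CM + (P.mesh 0 ^ P.d * Cst) * Real.exp 1
      + (P.mesh 0 ^ P.d * Cst) * (1 + Real.exp 1) * Real.exp 1) := by positivity
  rw [W_apply_eq hmsq ha hL1 hk]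
  -- the pieces (2.6) of `w = G_k(Ω,A+B)dip^B_{b′}Y`, all vanishing off `Ω`
  have hw : ∑ j ∈ Finset.range k, (fun j => if j < k then pieceR C Ω (A + B) msq a k j (dip C B b' Y) else 0) j
      = propagatorK C Ω (A + B) msq a k (dip C B b' Y) := by
    rw [propagatorK_apply_eq_sum_piecesR C msq a k (A + B) hmsq ha hL1 hk hkK]
    exact Finset.sum_congr rfl fun j hj => if_pos (Finset.mem_range.1 hj)
  have hw0 : ∀ (j : ℕ) (y : HiggsLattice.Site P 0), y ∉ Ω →
      (fun j => if j < k then pieceR C Ω (A + B) msq a k j (dip C B b' Y) else 0) j y = 0 := by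
    intro j y hy
    by_cases hjk : j < k
    · simp only [if_pos hjk]
      exact pieceR_apply_eq_zero_of_not_mem C Ω (A + B) hmsq ha hL1 hkK hΩ hk j _ (fun z hz => dip_apply_eq_zero_of_inside B hb' hz Y) hy
    · simp only [if_neg hjk, Pi.zero_apply]
  refine phi_row_srcV_le_box hmsq ha hL1 hk hkK hΩ hδ₁ hδ₁1 hCst hCM hs hδA ht1 hpdB hpmB hA hreg i₀ hb₀ b'.src _ _ hw hw0 one_pos hcw0 hcw0'
    (fun j y => ?_) (fun j b hb => ?_) F hexF henF
  · by_cases hjk : j < k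
    · simp only [if_pos hjk]
      exact norm_pieceR_dipB_le_box hjk hδ₁ hδ₁1 hCst hs ht1 hpdAB hpcAB hA hb' Y y
    · simp only [if_neg hjk, Pi.zero_apply, norm_zero]
      exact mul_nonneg (mul_nonneg hcw0 (Real.rpow_nonneg (P.mesh_pos j).le _)) (Real.exp_nonneg _)
  · by_cases hjk : j < k
    · simp only [if_pos hjk]
      exact norm_covDeriv_pieceR_dipB_le_box hjk hδ₁ hδ₁1 hCst hs ht1 hpdAB hpcAB hpmAB hA hb' Y hb
    · simp only [if_neg hjk, B3Ineq210RegularTorus.covDeriv_zero'', norm_zero]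
      exact mul_nonneg (mul_nonneg hcw0' (Real.rpow_nonneg (P.mesh_pos j).le _)) (Real.exp_nonneg _)

/-- **The row of `W = G_k(Ω,A+B) − G_k(Ω,B)` on a point source `e_{(y,i)}`, `y ∈ Ω`, through `D^ε_B` at `b₀ ⊂ Ω`** (value exponent `a_w = 2`):
`‖(D^ε_BWe_{(y,i)})(b₀)‖ ≤ 𝔪_k(|e|s·K₁ + L^k|e|δ_A·K₂, 2; δ₁/(4L))(b₀₋,y) + 4dε⁻¹|e|s·Σ_iΣ_{u∈F_i}𝔪_k(ε^dC,1;δ₁)(b₀₋,u)·𝔪_k(ε^dC,2;δ₁)(u,y)`,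
`K₁ = seedK1(…,2,ε^dC,ε^dC(1+e))`, `K₂ = seedK2(…,2,ε^dC)` — the pieces of `w = G_k(Ω,A+B)e_{(y,i)}` are single columns (`hpcAB`) with
`D^ε_B`-differentiated columns `pdcolO_cross_bound`. [cite: Balaban1983Higgs3, (1.16) p.414, (2.6) p.424, (2.10) p.426, p.433] [cite: Balaban1982Higgs1, (3.16) p.615, (3.44) p.619] -/
theorem deriv_W_single_le_box (hδ₁ : 0 < δ₁) (hδ₁1 : δ₁ ≤ 1) (hCst : 0 ≤ Cst) (hCM : 0 ≤ CM) (hs : 0 ≤ s) (hδA : 0 ≤ δA)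
    (ht1 : P.mesh k * (|C.e| * s) ≤ 1)
    (hpdB : ∀ (j : ℕ) (b : HiggsLattice.PBond P 0), Inside Ω b → ∀ y : HiggsLattice.Site P 0,
      pdcolO C Ω msq a k j B B b y ≤ (P.mesh 0 ^ P.d * Cst) * P.mesh j ^ ((1 : ℝ) - (P.d : ℝ)) *
        Real.exp (-(δ₁ * (P.mesh j)⁻¹ * (P.mesh 0 * (HiggsLattice.Site.tdist b.src y : ℝ)))))
    (hpmB : ∀ (j : ℕ) (b₀ b : HiggsLattice.PBond P 0), Inside Ω b₀ → Inside Ω b →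
      pmixO C Ω msq a k j B B b₀ b ≤ (P.mesh 0 ^ P.d * CM) * P.mesh j ^ ((0 : ℝ) - (P.d : ℝ)) *
        Real.exp (-(δ₁ * (P.mesh j)⁻¹ * (P.mesh 0 * (HiggsLattice.Site.tdist b₀.src b.src : ℝ)))))
    (hpdAB : ∀ (j : ℕ) (b : HiggsLattice.PBond P 0), Inside Ω b → ∀ y : HiggsLattice.Site P 0,
      pdcolO C Ω msq a k j (A + B) (A + B) b y ≤ (P.mesh 0 ^ P.d * Cst) * P.mesh j ^ ((1 : ℝ) - (P.d : ℝ)) *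
        Real.exp (-(δ₁ * (P.mesh j)⁻¹ * (P.mesh 0 * (HiggsLattice.Site.tdist b.src y : ℝ)))))
    (hpcAB : ∀ (j : ℕ) (x : HiggsLattice.Site P 0), x ∈ Ω → ∀ y : HiggsLattice.Site P 0,
      pcolO C Ω msq a k j (A + B) x y ≤ (P.mesh 0 ^ P.d * Cst) * P.mesh j ^ ((2 : ℝ) - (P.d : ℝ)) *
        Real.exp (-(δ₁ * (P.mesh j)⁻¹ * (P.mesh 0 * (HiggsLattice.Site.tdist x y : ℝ)))))
    (hA : ∀ b : HiggsLattice.PBond P 0, |A b| ≤ s)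
    (hreg : ∀ (z : HiggsLattice.Site P 0) (μ ν : Fin P.d), |A ⟨z.shift ν, μ⟩ - A ⟨z, μ⟩| ≤ δA)
    {nF : ℕ} (F : Fin nF → Finset (HiggsLattice.Site P 0))
    (hexF : ∀ b ∈ exB Ω A, ∃ i : Fin nF, b.src ∈ F i) (henF : ∀ b ∈ enB Ω A, ∃ i : Fin nF, b.tgt ∈ F i)
    (i₀ : Ix N) {b₀ : HiggsLattice.PBond P 0} (hb₀ : Inside Ω b₀) {y : HiggsLattice.Site P 0} (hy : y ∈ Ω) (i : Ix N) :
    ‖covDeriv C B ((propagatorK C Ω (A + B) msq a k - propagatorK C Ω B msq a k) (cb P N 0 (y, i))) b₀‖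
      ≤ maj P k (|C.e| * s * seedK1 P N δ₁ Cst CM a 2 (P.mesh 0 ^ P.d * Cst) ((P.mesh 0 ^ P.d * Cst) * (1 + Real.exp 1))
            + (P.L : ℝ) ^ k * (|C.e| * δA) * seedK2 P N δ₁ Cst 2 (P.mesh 0 ^ P.d * Cst)) 2 (δ₁ / 2 / 2 / P.L) b₀.src y
        + 4 * (P.d : ℝ) * ((P.mesh 0)⁻¹ * (|C.e| * s)) *
          ∑ i : Fin nF, ∑ u ∈ F i, maj P k (P.mesh 0 ^ P.d * Cst) 1 δ₁ b₀.src u * maj P k (P.mesh 0 ^ P.d * Cst) 2 δ₁ u y := by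
  have hε := P.mesh_pos 0
  have hcw0 : 0 ≤ P.mesh 0 ^ P.d * Cst := by positivity
  have hcw0' : 0 ≤ (P.mesh 0 ^ P.d * Cst) * (1 + Real.exp 1) := by positivity
  rw [W_apply_eq hmsq ha hL1 hk]
  have hw : ∑ j ∈ Finset.range k, (fun j => if j < k then pieceR C Ω (A + B) msq a k j (cb P N 0 (y, i)) else 0) j
      = propagatorK C Ω (A + B) msq a k (cb P N 0 (y, i)) := by
    rw [propagatorK_apply_eq_sum_piecesR C msq a k (A + B) hmsq ha hL1 hk hkK]
    exact Finset.sum_congr rfl fun j hj => if_pos (Finset.mem_range.1 hj)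
  have hw0 : ∀ (j : ℕ) (z : HiggsLattice.Site P 0), z ∉ Ω →
      (fun j => if j < k then pieceR C Ω (A + B) msq a k j (cb P N 0 (y, i)) else 0) j z = 0 := by
    intro j z hz
    by_cases hjk : j < k
    · simp only [if_pos hjk]
      exact pieceR_apply_eq_zero_of_not_mem C Ω (A + B) hmsq ha hL1 hkK hΩ hk j _ (fun u hu => cb_apply_eq_zero_of_mem hy i hu) hz
    · simp only [if_neg hjk, Pi.zero_apply]
  refine phi_row_srcV_le_box hmsq ha hL1 hk hkK hΩ hδ₁ hδ₁1 hCst hCM hs hδA ht1 hpdB hpmB hA hreg i₀ hb₀ y _ _ hw hw0 two_pos hcw0 hcw0'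
    (fun j x => ?_) (fun j b hb => ?_) F hexF henF
  · by_cases hjk : j < k
    · simp only [if_pos hjk]
      by_cases hx : x ∈ Ω
      · refine le_trans ?_ (hpcAB j x hx y)
        exact Finset.single_le_sum (f := fun i' : Ix N => ‖pieceR C Ω (A + B) msq a k j (cb P N 0 (y, i')) x‖)
          (fun _ _ => norm_nonneg _) (Finset.mem_univ i)
      · rw [pieceR_apply_eq_zero_of_not_mem C Ω (A + B) hmsq ha hL1 hkK hΩ hk j _ (fun u hu => cb_apply_eq_zero_of_mem hy i hu) hx,
          norm_zero]
        exact mul_nonneg (mul_nonneg hcw0 (Real.rpow_nonneg (P.mesh_pos j).le _)) (Real.exp_nonneg _)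
    · simp only [if_neg hjk, Pi.zero_apply, norm_zero]
      exact mul_nonneg (mul_nonneg hcw0 (Real.rpow_nonneg (P.mesh_pos j).le _)) (Real.exp_nonneg _)
  · by_cases hjk : j < k
    · simp only [if_pos hjk]
      rw [show (2 : ℝ) - 1 - (P.d : ℝ) = (1 : ℝ) - (P.d : ℝ) by ring]
      refine le_trans ?_ (pdcolO_cross_bound hjk hδ₁ hδ₁1 hCst hs ht1 hpdAB hpcAB hA hb y)
      exact Finset.single_le_sum (f := fun i' : Ix N => ‖covDeriv C B (pieceR C Ω (A + B) msq a k j (cb P N 0 (y, i'))) b‖)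
        (fun _ _ => norm_nonneg _) (Finset.mem_univ i)
    · simp only [if_neg hjk, B3Ineq210RegularTorus.covDeriv_zero'', norm_zero]
      exact mul_nonneg (mul_nonneg hcw0' (Real.rpow_nonneg (P.mesh_pos j).le _)) (Real.exp_nonneg _)

omit hkK in
/-- `W` of a source supported in `Ω` vanishes off `Ω` (both propagators are block-diagonal). [cite: Balaban1982Higgs1, (2.20) p.610] -/
theorem W_dip_apply_eq_zero_of_not_mem {b' : HiggsLattice.PBond P 0} (hb' : Inside Ω b') {x : HiggsLattice.Site P 0} (hx : x ∉ Ω)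
    (Y : E N) : (propagatorK C Ω (A + B) msq a k - propagatorK C Ω B msq a k) (dip C B b' Y) x = 0 := by
  have hL1' : (1 : ℝ) < (P.L : ℝ) := by exact_mod_cast hL1
  have hak : 0 ≤ B1.aSeq a P.L k := (B1.aSeq_pos ha hL1' hk).le
  have h0 : ∀ X : HiggsLattice.VecField P 0, propagatorK C Ω X msq a k (dip C B b' Y) x = 0 := fun X => by
    rw [dip, map_sub, Pi.sub_apply, propagatorK_single_apply_eq_zero_of_mem C Ω X a hmsq hak (hΩ k le_rfl) hb'.2 hx,
      propagatorK_single_apply_eq_zero_of_mem C Ω X a hmsq hak (hΩ k le_rfl) hb'.1 hx, sub_zero]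
  rw [LinearMap.sub_apply, Pi.sub_apply, h0, h0, sub_zero]

/-- **THE MIXED SEED ON `Ω`, column side (value of `W` on the `B`-dipole).**  For `x ∈ Ω`:
`‖([G_k(Ω,A+B) − G_k(Ω,B)]dip^B_{b′}Y)(x)‖ ≤ ε‖Y‖·#Ix·[𝔪_k(|e|s·K₁ + L^k|e|δ_A·K₂, 2; δ₁/(4L))(b′₋,x) + 4dε⁻¹|e|s·Σ_iΣ_{u∈F_i}𝔪_k(ε^dC,1;δ₁)(b′₋,u)·𝔪_k(ε^dC,2;δ₁)(u,x)]`
with the constants of `deriv_W_single_le_box` — by the symmetry of `W` (`norm_W_dip_apply_le_box`) and the row bound at the row bond `b′ ⊂ Ω`: the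
value sheet sits at the SOURCE bond (digested in M2 by the source margin, M0 `face_conv_maj_le_far`); off `Ω` the value is `0`.
[cite: Balaban1983Higgs3, (1.16) p.414, (2.10) p.426, p.433] [cite: Balaban1982Higgs1, (2.20) p.610, (3.44) p.619] -/
theorem value_W_dip_le_box (hδ₁ : 0 < δ₁) (hδ₁1 : δ₁ ≤ 1) (hCst : 0 ≤ Cst) (hCM : 0 ≤ CM) (hs : 0 ≤ s) (hδA : 0 ≤ δA)
    (ht1 : P.mesh k * (|C.e| * s) ≤ 1)
    (hpdB : ∀ (j : ℕ) (b : HiggsLattice.PBond P 0), Inside Ω b → ∀ y : HiggsLattice.Site P 0,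
      pdcolO C Ω msq a k j B B b y ≤ (P.mesh 0 ^ P.d * Cst) * P.mesh j ^ ((1 : ℝ) - (P.d : ℝ)) *
        Real.exp (-(δ₁ * (P.mesh j)⁻¹ * (P.mesh 0 * (HiggsLattice.Site.tdist b.src y : ℝ)))))
    (hpmB : ∀ (j : ℕ) (b₀ b : HiggsLattice.PBond P 0), Inside Ω b₀ → Inside Ω b →
      pmixO C Ω msq a k j B B b₀ b ≤ (P.mesh 0 ^ P.d * CM) * P.mesh j ^ ((0 : ℝ) - (P.d : ℝ)) *
        Real.exp (-(δ₁ * (P.mesh j)⁻¹ * (P.mesh 0 * (HiggsLattice.Site.tdist b₀.src b.src : ℝ)))))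
    (hpdAB : ∀ (j : ℕ) (b : HiggsLattice.PBond P 0), Inside Ω b → ∀ y : HiggsLattice.Site P 0,
      pdcolO C Ω msq a k j (A + B) (A + B) b y ≤ (P.mesh 0 ^ P.d * Cst) * P.mesh j ^ ((1 : ℝ) - (P.d : ℝ)) *
        Real.exp (-(δ₁ * (P.mesh j)⁻¹ * (P.mesh 0 * (HiggsLattice.Site.tdist b.src y : ℝ)))))
    (hpcAB : ∀ (j : ℕ) (x : HiggsLattice.Site P 0), x ∈ Ω → ∀ y : HiggsLattice.Site P 0,
      pcolO C Ω msq a k j (A + B) x y ≤ (P.mesh 0 ^ P.d * Cst) * P.mesh j ^ ((2 : ℝ) - (P.d : ℝ)) *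
        Real.exp (-(δ₁ * (P.mesh j)⁻¹ * (P.mesh 0 * (HiggsLattice.Site.tdist x y : ℝ)))))
    (hA : ∀ b : HiggsLattice.PBond P 0, |A b| ≤ s)
    (hreg : ∀ (z : HiggsLattice.Site P 0) (μ ν : Fin P.d), |A ⟨z.shift ν, μ⟩ - A ⟨z, μ⟩| ≤ δA)
    {nF : ℕ} (F : Fin nF → Finset (HiggsLattice.Site P 0))
    (hexF : ∀ b ∈ exB Ω A, ∃ i : Fin nF, b.src ∈ F i) (henF : ∀ b ∈ enB Ω A, ∃ i : Fin nF, b.tgt ∈ F i)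
    (i₀ : Ix N) {b' : HiggsLattice.PBond P 0} (hb' : Inside Ω b') (Y : E N) {x : HiggsLattice.Site P 0} (hx : x ∈ Ω) :
    ‖(propagatorK C Ω (A + B) msq a k - propagatorK C Ω B msq a k) (dip C B b' Y) x‖
      ≤ P.mesh 0 * ‖Y‖ * ((Fintype.card (Ix N) : ℝ) *
        (maj P k (|C.e| * s * seedK1 P N δ₁ Cst CM a 2 (P.mesh 0 ^ P.d * Cst) ((P.mesh 0 ^ P.d * Cst) * (1 + Real.exp 1))
            + (P.L : ℝ) ^ k * (|C.e| * δA) * seedK2 P N δ₁ Cst 2 (P.mesh 0 ^ P.d * Cst)) 2 (δ₁ / 2 / 2 / P.L) b'.src x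
          + 4 * (P.d : ℝ) * ((P.mesh 0)⁻¹ * (|C.e| * s)) *
            ∑ i : Fin nF, ∑ u ∈ F i, maj P k (P.mesh 0 ^ P.d * Cst) 1 δ₁ b'.src u * maj P k (P.mesh 0 ^ P.d * Cst) 2 δ₁ u x)) := by
  refine (norm_W_dip_apply_le B b' Y x).trans (mul_le_mul_of_nonneg_left ?_ (mul_nonneg (P.mesh_pos 0).le (norm_nonneg _)))
  refine (Finset.sum_le_sum fun i _ =>
    deriv_W_single_le_box hmsq ha hL1 hk hkK hΩ hδ₁ hδ₁1 hCst hCM hs hδA ht1 hpdB hpmB hpdAB hpcAB hA hreg F hexF henF i₀ hb' hx i).trans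
    (le_of_eq ?_)
  rw [Finset.sum_const, nsmul_eq_mul, Finset.card_univ]

end Instances





end Literature.MathematicalPhysics.QuantumFieldTheory.Balaban1983to89.B3Op116MixedSeedBox

end
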